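/-
Copyright: lit-balaban Phase-2 proof seat p27 (gens 41–44).  Statement-level skeleton of a published paper; no proof claims beyond what the
kernel checks below.
-/
import Literature.MathematicalPhysics.QuantumFieldTheory.BalabanImbrieJaffe1984to88.BIJ88Small333ScalarField
import Literature.MathematicalPhysics.QuantumFieldTheory.BalabanImbrieJaffe1984to88.BIJ88Small333GaugeField
import Literature.MathematicalPhysics.QuantumFieldTheory.BalabanImbrieJaffe1984to88.BIJ88SmallChargeRegime
import Literature.MathematicalPhysics.QuantumFieldTheory.BalabanImbrieJaffe1984to88.BIJ88RegionTower274
import Literature.MathematicalPhysics.QuantumFieldTheory.BalabanImbrieJaffe1984to88.BIJ85Ineq723Torus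
import Literature.MathematicalPhysics.QuantumFieldTheory.BalabanImbrieJaffe1984to88.BIJ88SmallBlockFields332Ubar
import Literature.MathematicalPhysics.QuantumFieldTheory.BalabanImbrieJaffe1984to88.BIJ88NeumannPropagatorSmallFieldRegion
import Literature.MathematicalPhysics.QuantumFieldTheory.BalabanImbrieJaffe1984to88.BIJ88ScalarTranslation330Size
import Literature.MathematicalPhysics.QuantumFieldTheory.BalabanImbrieJaffe1984to88.BIJ85HolonomyDeviation
import Literature.MathematicalPhysics.QuantumFieldTheory.BalabanImbrieJaffe1984to88.BIJ88Eq249GaugeCovarianceUniformTorus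

/-!
# `BalabanImbrieJaffe1984to88.BIJ88Small333Regime` — T. Bałaban, J. Imbrie, A. Jaffe, *Effective action and cluster properties of the
abelian Higgs model*, Commun. Math. Phys. **114** (1988) 257–315 [BalabanImbrieJaffe1988], Sect. 3 p. 270 [PDF 14] (3.33): the STANDING
REGIME of the paper — p. 266 *"since e²/λ = O(1) we have also e_k²/λ_k = O(1) by (2.2)"*, (2.3) p. 260 *"r(e_k) = |log e_k⁻¹|^r, r > 1"*,
(2.33) p. 263 *"p(e_k) = |log e_k⁻¹|^p"* — DISCHARGES the explicit regime inequalities under which the scalar-field half of (3.33) was proved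
(`BIJ88Small333ScalarField`), and the p. 267 / p. 274 collars (r18's `BIJ88RegionTower274.collarShrink`) DISCHARGE the located margin under
which the gauge-field half was proved (`BIJ88Small333GaugeField`); v1.4 (§9–§11) DISCHARGES the [6] (5.6)/invertibility hypotheses on the
first-step covariance `G(Λ, u₁)` from the axial gauge, (3.15) and the gauge half, with the block Poincaré smallness assumed on `Λ` only.
Theorems only.

statement-level skeleton of published theorems with citation tags; proofs where landed; nothing here is a claim about the Yang–Mills mass gap

PDF held: `paper:balaban1988-cmp114-bij-abelian-higgs-effective-action` (journal page = PDF page + 256); p. 260 [PDF 4] ((2.2)–(2.3)), p. 266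
[PDF 10], p. 267 [PDF 11], p. 270 [PDF 14], p. 274 [PDF 18] read this session from the text layer (`lit read …`, files `p0004.txt`,
`p0010.txt`–`p0014.txt`).

CITATION HEADER (lean-in-tree rule).  Part of the lit-balaban TYPED SKELETON (HOME `run/shared/lean/pub/lit-balaban/`), Phase 2, seat p27
GEN 41 (unit `lit-balaban-p27`; free-target protocol G.5-34(d): TAKING line HOME/STATUS.md 2026-08-23T17:13:17Z; v1.2 §8: GEN 42, TAKING line
2026-08-23T19:59:55Z; v1.4 §9–§12 / v1.5 §13: GEN 43, TAKING line 2026-08-23T23:33:30Z); row **C2.Eq3.33** of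
`HOME/lit-balaban-r18/ROWS-C2.md` (C2 §§1–4 fold owner r18, referee ref-5) — cells only: the row is `proved p239829 · p364385 · p365797`
and its ⟦v2.100 SCOPE⟧ clause lists *"remaining scope: regime inequalities, …"*; this file retires that word and the HONEST SCOPE item
(iv) of `BIJ88Small333GaugeField` (*"The located margin is stated as a hypothesis on the regions, not derived from a typed region tower"*).

THE PRINTED TEXT (verbatim).  p. 260 [PDF 4]: *"e_k = (L^kε)^{(4−d)/2}e, λ_k = (L^kε)^{4−d}λ, (2.2)  r(e_k) = |log e_k⁻¹|^r, r > 1. (2.3)"*;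
p. 263 [PDF 7]: *"Here p(e_k) = |log e_k⁻¹|^p, p = O(1) (2.33) is our logarithmic scale for small fields."*; p. 266 [PDF 10]: *"We use a
rescaled coupling constant λ_k = (L^kε)^{4−d}λ, (3.9) and since e²/λ = O(1) we have also e_k²/λ_k = O(1) by (2.2)."*; p. 267 [PDF 11]:
*"Later in this step we will introduce sets Λ₁^{(0)}, Λ₂^{(0)}, etc., which are obtained from Λ₀^{(0)} either by deleting r(e₀)-cubes at the
boundary of Λ₀^{(0)}, or by deleting r(e₀)-cubes covering regions with "irrelevant" terms from the expansions."* (at the general step, p. 274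
[PDF 18]: *"by subtracting collar neighborhoods of width r(e_j)"* — r18's `BIJ88RegionTower274.collarShrink`); p. 270 [PDF 14]: *"Similarly, it can be shown that
|A^{(0)}| ≦ cp(e₀) in Λ₁^{(0)*}, |φ^{(0)}| ≦ cp(e₀) in Λ₁^{(0)*}, (3.33)"*.

WHAT IS PROVED (0 `sorry`, standard axioms, NO definitions, no named facts; every object consumed BY NAME).
* §1 REAL-ANALYSIS KERNELS of the regime (on p36's `BIJ88SmallCoupling23.tendsto_abs_log_inv` and `BIJ88SmallChargeRegime.exists_threshold`):
  `eventually_mul_exp_le_exp_rpow` (on `u → +∞`: `K·e^{θu} ≤ e^{a·u^r}` for `a > 0`, `r > 1`), **`eventually_rpow_neg_le_exp_rLen`** (at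
  `e → 0⁺`: `K·e^{−θ} ≤ exp(a·r(e))` — the exponential of the localization length beats every inverse power of the charge; this is where
  print's `r > 1` is used), **`eventually_rpow_mul_pLog_le_one`** (`K·e^{θ}·p(e) ≤ 1`, `θ > 0`), `rpow_neg_quarter_le` (`e² ≤ Cλ`, the p. 266
  regime, gives `λ^{−1/4} ≤ C^{1/4}e^{−1/2}`).
* §2 **`regime333`**: for constants `a, b > 0` (decay rates), `K₁, K₂ ≥ 0`, `K₃` (prefactors), `κ, κ′ > 0` (margins in units of `r(e)`),
  `r > 1`, `C > 0` and any exponent `p`: there is `e* > 0` such that for `0 < e₀ < e*`, every `λ₀` with `e₀² ≤ Cλ₀`, every `R ≥ κ·r(e₀)`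
  and every `ρ` with `ρ − 3 ≥ κ′·r(e₀)`: `K₁e^{−aR}λ₀^{−1/4} ≤ 1`, `K₂e^{−b(ρ−3)}λ₀^{−1/4} ≤ 1` and `e₀·K₃·p(e₀)·λ₀^{−1/4} ≤ 1` — the three
  regime hypotheses `hRlam`, `hδlam`, `helam` of `BIJ88Small333ScalarField.small333_scalar_of_smallField315[_at_u]` in print's vocabulary;
  `rpow_quarter_ge` + **`regime332`**: likewise `K₁e₀p(e₀) < π`, `K₂e₀p(e₀) ≤ λ₀^{1/4}`, `K₃e₀p(e₀) ≤ λ₀^{1/4}` for `0 < e₀ < e*` under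
  `p(e₀) ≤ c_p|log e₀⁻¹|^p`, `e₀² ≤ Cλ₀` — the regime hypotheses of the (3.32)/(3.33) plaquette-level theorems (p30's
  `BIJ88SmallBlockFields332Ubar.smallBlock332_u1bar_byName`, gen-39's `small333_gauge_of_plaquettes`).
* §3 **(3.33), SCALAR-FIELD HALF, IN PRINT'S REGIME**: `small333_scalar_of_smallField315_regime` and `small333_scalar_of_smallField315_at_u_regime`
  — the gen-40 theorems with `hRlam`/`hδlam`/`helam` REPLACED by `0 < e₀ < e*`, `e₀² ≤ C·λ₀`, `κ·rLen r e₀ ≤ R`, `κ′·rLen r e₀ ≤ ρ − 3`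
  (and `pe₀ ≤ c_p·pLog p e₀` for the transfer term), `e*` depending only on `(d, γ₀, c₀, δ₀, M, c′, c_A, c_p, p, r, κ, κ′, C)` and chosen
  BEFORE the torus, the regions and the fields.
* §4 **(3.33), GAUGE-FIELD HALF, ON THE COLLAR-SHRUNK REGION**: geometric kernels `supDist_le_of_blockOf_eq_shift` / `_shift_shift` (a site
  of a block adjacent / diagonal-adjacent to `B(blockOf x)` is within `2L − 1` / `3L − 1` of `x`), **`margin_coarse_of_collarShrink`** (if the
  bonds of `Λ₁*` start in `Λ₁ ⊆ collarShrink r Λ₀` with `R + 7L ≤ r`, then every coarse plaquette based at a block met within sup-distance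
  `R + 4L + 1` of such a bond has its four blocks inside `Λ₀`, hence lies in `Y**` for every coarse region `Y` containing the blocks inside
  `Λ₀`) and **`small333_gauge_collar`** = gen-39's `small333_gauge_of_bound` with its `hmargin` DISCHARGED by r18's `collarShrink` BY NAME.
* §5 **(3.33), GAUGE-FIELD HALF, FROM r18's TYPED (3.15) BY NAME**: `mem_starP_of_near_collarShrink`, `collarShrink_add_subset` (nested collars),
  **`small333_gauge_of_smallField315_collar`** — gen-39's `small333_gauge_of_plaquettes` with ALL THREE located hypotheses (`hεA`, `hεF`,
  `hmargin`) DISCHARGED from `SmallField315 … (‖f^{(0)}‖)` on `Λ₀` (fourth clause, via p30's `plaqSmall_of_smallField315`) and the collar data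
  `Λ₁s ⊆ Λ₁*`, `Λ₁ ⊆ collarShrink r Λ₀`, `R + 7L + 2 ≤ r`, `Y` = the blocks inside `collarShrink 2 Λ₀`; and
  **`small333_gauge_of_smallField315_collar_regime`** — the same with ONE constant `c(d, L)` and the last regime inequality
  `17d²L²e₀p(e₀) < π` DISCHARGED for `0 < e₀ < e*` under `p(e₀) ≤ c_p|log e₀⁻¹|^p` (`regime332`, first clause).
* §6 (v1.1) **(3.32) AT PRINT'S `ū₁`, IN PRINT'S REGIME** (p30's `BIJ88SmallBlockFields332Ubar` BY NAME): **`margin332_of_collarShrink`** (p30's located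
  margin `hmargin` — coarse plaquettes near the axial runs from the centres of the blocks of `Λ′` lie in `Λ₀′**` — READ OFF r18's `collarShrink`:
  blocks of `Λ′` inside `Λ₁ ⊆ collarShrink r Λ_c`, `R + 8L ≤ r`, `Λ₀′ ⊇` the blocks inside `Λ_c`), **`smallBlock332_u1bar_of_smallF_regime`** (p30's
  `smallBlock332_u1bar_of_smallField315_of_smallF` with the kernel bound supplied by p09's `cloc_decay` and its three regime inequalities
  `17d²L²e₀p(e₀) < π`, `2·17d²L²e₀p(e₀) ≤ λ₀^{1/4}`, `L·e₀(C·c₂)p(e₀) ≤ λ₀^{1/4}` DISCHARGED for `0 < e₀ < e*(d, L, c₂, c_p, p, C_λ)` under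
  `p(e₀) ≤ c_p|log e₀⁻¹|^p`, `e₀² ≤ C_λλ₀`), **`smallBlock332_u1bar_of_smallF_collar_regime`** (both at once).
* §7 (v1.1) **`small333_scalar_at_u_collar_regime`**: §3's `_at_u_regime` with the pointwise margin REPLACED by `Λ₇ ⊆ collarShrink R Λ` (gen-40
  v1.1 §7 `margin_of_subset_collarShrink`) and the collar width `R ≥ κ·r(e₀)` — the scalar half with regime AND location in print's vocabulary.
* §8 (v1.2) **(3.33) AS ONE CONJUNCTION AT THE OBJECTS OF RECORD**: **`small333_of_smallField315_collar_regime`** — r18's typed predicate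
  `Small333 c p(e₀) Λ₇ A^{(0)} φ^{(0)}` (BOTH clauses: `|A^{(0)}_b| ≤ cp(e₀)` on `Λ₇*` — indeed on all of `Λ₁*` — and `‖φ^{(0)}(x)‖ ≤ cp(e₀)` on `Λ₇`) with ONE `c > 0` and ONE
  `e* > 0` chosen before the torus, FROM r18's (3.15) `SmallField315 … (D^c_uφ) ψ (Q(u)φ) φ |f^{(0)}|` at the objects of record on `(Λ₀, Λ₀′)`
  (one hypothesis) and (3.32) on `Λ₀′`, for `u` in the axial gauge, `A^{(0)}` tied to `arg(u′)/e₀` by (3.27), on the collar tower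
  `Λ₇ ⊆ collarShrink R₇ Λ`, `Λ ⊆ Λ₁ ⊆ collarShrink r₁ Λ₀` and in print's regime — §5 (gauge half on all of `Λ₁*`) FEEDS §7 (`hA0`);
  `c = max(c_g, c_s)` (r18's `BIJ88SmallFieldPredicatesAPI.small333_of_halves_subset`, three lines, inlined — see (v)).
* §8 (v1.3) **`small333_of_smallField315_only_collar_regime`**: the same with the (3.32) input DISCHARGED from (3.15) — its `ψ`-clause (the
  only one the scalar half uses) is p30's `BIJ88SmallBlockFields332.norm_psi_le_of_smallField315` (`c′ = 2`, `0 < λ₀ ≤ 1`, blocks of `Λ₀′`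
  inside `Λ₀`); hypotheses left: (3.15) alone at the objects of record, the axial gauge, (3.27), the collar tower / located margins, the
  [6] (5.6)/`IsUnit`/localized-kernel data of `G(Λ, u₁)`, print's regime with `λ₀ ≤ 1`.
* §9 (v1.4) **[6] (5.6) AND INVERTIBILITY WITH THE SMALLNESS ON `Λ` ONLY** (the `…_on` family): `sum_norm_sq_le_smallField_on` (p34's regional
  block Poincaré inequality `BIJ88NeumannPropagatorSmallFieldRegion.coercive_region_poincare` at `k = 1`, right side enlarged to the full sums),
  `lowerBound_op240_smallField_on`, `re_form_op240_smallField_pos_on`, `isUnit_compress_op240_smallField_on`,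
  `re_coercive_compress_smallField_on`, **`hyp56_op240_smallField_on`** — p31's `BIJ88Decay241SmallFieldTorus` §1–§2 /
  `BIJ88Eq242HiggsCovarianceTorus.hyp56_op240_smallField` chain with `hInt`/`hTree` assumed ON THE BLOCK UNION `Λ` ONLY (`‖u_b − 1‖ ≤ T` on
  the in-block bonds of `Λ*`, `‖u(Γ_{yx}) − 1‖ ≤ δ` on `Λ`) instead of on the whole torus; **`hyp56_nOp_univ_smallField_on`** /
  **`isUnit_compress_nOp_univ_smallField_on`** — p29's `BIJ88ScalarTranslation330Size` §2 for the first-step operator `−Δ_u + κQ(u)*Q(u)`,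
  localized likewise (their `nOp_univ_eq_op240`, `h238_lapU`, `lapU_isHermitian`, `norm_lapU_apply_le_cdist` BY NAME).
* §10 (v1.4) **THE SMALLNESS OF `u₁ = u·e^{−ie₀A⁽⁰⁾}` ON A BLOCK UNION**: `not_isCross_of_blkIter_eq`,
  `norm_toC_uOne_sub_one_le` (`‖u₁(b) − 1‖ ≤ ‖u(b) − 1‖ + |eA_b|`), **`norm_toC_uOne_sub_one_le_of_plaquettes`** (axial gauge + `|arg u(∂p)| ≤ ε`
  on the plaquettes based in the block of an in-block bond `b`, p31's `BIJ88Eq531SmallAPrime.interior_bound_bond`: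
  `‖u₁(b) − 1‖ ≤ (d−1)(L−1)ε + |eA_b|`), `holCK_uOne_of_deltaAx` (`u₁(Γ_{yx}) = Π_{b∈Γ_{yx}}e^{−ieA_b}` in the axial gauge, p11's
  `holC_of_deltaAx`/`holCK_mul`), `norm_holC_sub_one_le_on` (p11's `norm_holC_sub_one_le` from the leg bonds of `x` only), `legBond_mem_starB`,
  **`norm_holCK_uOne_sub_one_le`** (`‖u₁(Γ_{yx}) − 1‖ ≤ d(L−1)|e|α` for `x` in a block union `Λ` if `|A_b| ≤ α` on `Λ*`).
* §11 (v1.4) `regime_smallU1` (`K₁e₀p(e₀) < π` and `K₂(e₀p(e₀))² ≤ ½` for `e₀ < e*`), **`hyp56_isUnit_uOne_on`** (the two operator hypotheses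
  of §3/§7/§8 on `G(Λ, u₁)` HOLD at `u₁ = uOne U e₀ A⁽⁰⁾` given the axial gauge, the plaquettes of the blocks of `Λ`, `|A⁽⁰⁾| ≤ α` on `Λ*`, a
  no-wrap block union `Λ`, `c ≠ 0`, `κ > 0` and the smallness `σ ≤ ½`; constants `γ₀ ≤ ½c₂₄₀(c², κ)`, `c₀ ≥ 4dc²e^{δ₀} + κL^{−2d}e^{δ₀(L−1)}`), and
  **`small333_of_smallField315_noWrap_collar_regime`** — §8's `small333_of_smallField315_only_collar_regime` with `B4.Hyp56 …` AND
  `IsUnit (compress Λ …)` REMOVED from the hypotheses (discharged from the fourth clause of (3.15) on `Λ₀**`, the gauge half §5 on `Λ₁* ⊇ Λ*`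
  and print's regime `e₀p(e₀) → 0`), at the price of p29's NO-WRAP hypothesis on `Λ` (`|b₋ − b₊|_chart ≤ 1` on `Λ*`), `c ≠ 0`, `0 < aL_r^{−2}`
  and explicit walk constants `0 < γ₀ ≤ ½c₂₄₀(c², aL_r^{−2})`, `c₀ ≥ 4dc²e^{δ₀} + aL_r^{−2}L^{−2d}e^{δ₀(L−1)}` at `(d, L)`.
* §12 (v1.4) **`small333_scalar_corr330_smallField_on`** — p29's `BIJ88ScalarTranslation330Size.small333_scalar_corr330_smallField` ((3.33) scalar
  half at the composed correction `corr330` of (3.30), small-field form) with its whole-torus `hInt`/`hTree` replaced by the smallness on `Λ`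
  only (§9); p29's `small333_scalar_corr330` BY NAME.
* §13 (v1.5) `cdist_src_tgt_le_one`, **`noWrap_of_seamFree`** (the no-wrap hypothesis of §9/§11/§12 HOLDS for every `Λ` none of whose sites has
  a coordinate representative `N − 1` — p29's *"Λ inside a box not crossing the coordinate seam"* made a one-line check), and
  **`small333_of_smallField315_corr330_collar_regime`** — §11 AT THE (2.43)-LOCALIZED KERNEL OF RECORD: the kernel data `K`/`hK0`/`hKl` and
  the correction data `corr`/`hcorr` ELIMINATED in favour of p29's definite `cLocC Λ (−Δ_{u₁} + aL_r^{−2}Q(u₁)*Q(u₁)) M ρ` and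
  `corr330 … = C^{(0)}_{Λ,loc}(u₁)Q(u₁)*ψ` (`cLocC_of_not_mem_right`, `cLocC_of_mem`, `rfl`), so that (3.33) is stated for
  `φ = φ^{(0)} + aL_r^{−2}χ_{Λ₇}C^{(0)}_{Λ,loc}(u₁)Q(u₁)*ψ` exactly as (3.30) prints it.
* §14 (v1.6) **THE CUBE SIZE FIXED FIRST** ([6] p. 596 *"Finally we fix M"*, p. 264 *"a walk on a lattice of spacing M = O(1)"*):
  `exists_walkConsts` (for every `(d, L > 1, aL_r^{−2} > 0, c ≠ 0)` the [6] (5.6) constants `γ₀, c₀, δ₀` and a cube size `M ≥ 5` meeting all eight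
  side conditions of §11/§13 — p31's `BIJ88Eq249GaugeCovarianceUniformTorus.exists_cubeSize` BY NAME), `eventually_const_le_rLen`,
  **`small333_of_smallField315_corr330_regime_uniform`** (§13 with the binders `hγ`/`hγle`/`hc₀`/`hδ`/`hM`/`hMR`/`hMθ`/`hθW` ELIMINATED:
  `∃ M c₃ e*` depending on `(d, L, aL_r^{−2}, c, c_p, p, κ, κ′, r, C)` only, BEFORE the torus, the field and the regions) and
  **`small333_of_smallField315_corr330_regime_printRadius`** (moreover AT PRINT'S (2.43) RADIUS *"only ω remaining within ¼r(e_k) of x₁, x₂"*: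
  `ρ = r(e₀)/(4M)` in p13's label units, the `ρ`/`κ′` binders ELIMINATED, `e*` shrunk so that `r(e₀) ≥ 24M`).
* §15 (v1.6) **NON-VACUITY OF THE THEOREM OF RECORD**: **`small333_of_smallField315_corr330_regime_printRadius_nonvacuous`** — for every admissible
  `e₀ < e*` (`e₀² ≤ C`) an explicit torus `(ℤ/2L^m)^d` (`m = ⌈κr(e₀)⌉ + L + 2`), the seam-free block union «innerRegion» (every `L`-block off the last
  coarse layer; r18's `barRegion`), `Λ₇ = collarShrink ⌈κr(e₀)⌉ «innerRegion»` — NONEMPTY, it contains the centre site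
  (`collarShrink_innerRegion_nonempty`, `supDist_centreSite_ge`: the centre is `≥ N/2 − L` from the complement) —, `Λ₀ = Λ₁ = T` and the TRIVIAL
  configuration `u ≡ 1`, `A⁽⁰⁾ = φ⁽⁰⁾ = ψ = 0` (`qU_one` `Q(1) = 1`, `uPrime_one` `u′ = 1`, `fieldStrength_one`, `plaqVar_cfg_one`, `phi330_corr330_zero`)
  meet EVERY hypothesis of §14 simultaneously, and §14's conclusion at these data is obtained by the theorem itself.
HONEST SCOPE.  (i) Nothing new is claimed about (3.33) itself: §3/§4 are the gen-39/gen-40 theorems with two kinds of hypotheses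
re-expressed in print's vocabulary ((2.2)/(2.3)/(2.33) scales, p. 274 collars); the [6] (5.6)/`IsUnit` kernel hypotheses, the constants
and the (3.15)-inputs are untouched (their discharges are p29's `BIJ88ScalarTranslation330Size`); likewise §6 re-expresses p30's hypotheses only
(`SmallF` stays an input there; p30's v1.1 `smallBlock332_u1bar_byName` derives it from (3.15) — compose with it; `λ₀ ≤ 1` as printed).  (ii) `e*` is not computed (a threshold
from `Filter.Eventually`, as in p36's `BIJ88SmallChargeRegime`).  (iii) Print fixes `r > 1` in (2.3); §1 records that `r > 1` is exactly what
makes `e^{−c r(e)}` beat the powers `λ^{−1/4} ∼ e^{−1/2}` (for `r = 1` the comparison depends on the constants).  (iv) The hypothesis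
`e₀² ≤ Cλ₀` is print's *"e²/λ = O(1)"* read with an explicit constant; `λ₀ ≤ 1` is not needed.  Literature + Mathlib only; no Summits import.
(v) §8 composes §5 and §7 and restricts (3.15) from `Λ₀` to `Λ₁` (r18's `smallField315_mono`) — pure bookkeeping over the tree's
theorems; the [6] (5.6)/`IsUnit` hypotheses on `G(Λ, u₁)`, the localized kernel `K`, the (3.32) input and (3.27) stay hypotheses exactly as
in §5/§7; r18's two API lemmas are inlined (not re-declared) because the olean of `BIJ88SmallFieldPredicatesAPI` (p370996) was not yet
built on the farm at filing time.  (vi) v1.4: the localization of §9 is bookkeeping over p34's regional Poincaré inequality (the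
smallness terms of the Poincaré step multiply `φ`, which vanishes off `Λ`); the no-wrap hypothesis of §11 (chart distance = torus distance on
the bonds of `Λ*`) is inherited from p29/p31's charted (2.36)-shape kernel bound; v1.5 `noWrap_of_seamFree` reduces it to «no site of `Λ`
has a coordinate representative `N − 1`» (a region inside a box not crossing the seam; the seam itself is an artefact of the chart, not of print); the localized kernel `K = C_loc(ρ)` of (2.43) stays DATA characterized by `hK0`/`hKl`;
the cube-size conditions on `M` are hypotheses at the explicit `(γ₀, c₀, δ₀)` exactly as in p29's §2; (3.15), the axial gauge, (3.27) and
the collar tower remain the inputs; print's `u₁` (p. 270) carries further factors `(Λ₁*Q^{s*}v)(Λ₆*ᶜu⁰)e^{ie₀Λ₄*L^{−2}C_loc∂*Q^{e*}f}` —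
here, as in §3/§7/§8 and p29's files, `u₁ = u·e^{−ie₀A⁽⁰⁾}` (p11's `uOne`) is the object at which `G(Λ, u₁)` is taken.
(vii) v1.6: §14 is bookkeeping over §13 — the walk constants are instantiated (`δ₀ = 1`, `γ₀`/`c₀` at their bounds, `M` from p31's
`exists_cubeSize`), the radius at print's `¼r(e₀)`; `M`, `c₃`, `e*` stay existential (recipes in the proofs, no optimality); nothing of (3.33) is re-proved.
(viii) v1.6 §15 certifies only that the binders of the theorem of record are JOINTLY CONSISTENT with a nonempty `Λ₇` (trivial fields, arbitrarily
large tori); it says nothing about non-trivial configurations, and the regime slot `p(e₀)` is taken `0` there.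
Unit `lit-balaban-p27` (literature-prover-lit-balaban-p27-g41-0 / -g42-0 / -g43-0 / -g44-0), 2026-08-23/24.  NOT summit progress, continuum or Clay.
-/

open Filter Set
open scoped Topology BigOperators Matrix

namespace Literature.MathematicalPhysics.QuantumFieldTheory.BalabanImbrieJaffe1984to88.BIJ88Small333Regime

open Literature.MathematicalPhysics.QuantumFieldTheory.Balaban1983to89
open BIJ88Sect2Statements (rLen pLog)
open BIJ88SmallCoupling23 (tendsto_abs_log_inv eventually_pLog_le_exp_rLen)
open BIJ88SmallChargeRegime (exists_threshold eventually_le_one)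

noncomputable section

/-! ## §1  Real-analysis kernels of the regime (2.2)/(2.3)/(2.33) -/

/-- on `u → +∞`: `K·e^{θu} ≤ e^{a·u^r}` eventually, for every `K`, `θ` and every `a > 0`, `r > 1` (`θu − au^r = u(θ − au^{r−1}) → −∞`).
[cite: BalabanImbrieJaffe1988, (2.3) p.260] -/
theorem eventually_mul_exp_le_exp_rpow (K θ a r : ℝ) (ha : 0 < a) (hr : 1 < r) :
    ∀ᶠ u : ℝ in atTop, K * Real.exp (θ * u) ≤ Real.exp (a * u ^ r) := by
  have h1 : Tendsto (fun u : ℝ => u ^ (r - 1)) atTop atTop := tendsto_rpow_atTop (by linarith)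
  have h2 : Tendsto (fun u : ℝ => θ - a * u ^ (r - 1)) atTop atBot :=
    (tendsto_atBot_add_const_left _ θ (tendsto_neg_atTop_atBot.comp (h1.const_mul_atTop ha))).congr fun u => by
      simp only [Function.comp_apply]; ring
  have h3 : Tendsto (fun u : ℝ => u * (θ - a * u ^ (r - 1))) atTop atBot := tendsto_id.atTop_mul_atBot₀ h2
  have h4 : Tendsto (fun u : ℝ => θ * u - a * u ^ r) atTop atBot := by
    refine h3.congr' ?_
    filter_upwards [eventually_gt_atTop 0] with u hu
    have hur : u ^ r = u * u ^ (r - 1) := by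
      rw [← Real.rpow_one_add' hu.le (by linarith)]; ring_nf
    rw [hur]; ring
  have h5 : Tendsto (fun u : ℝ => K * Real.exp (θ * u - a * u ^ r)) atTop (𝓝 0) := by
    simpa using (Real.tendsto_exp_atBot.comp h4).const_mul K
  filter_upwards [h5.eventually (gt_mem_nhds one_pos)] with u hu
  have hsplit : K * Real.exp (θ * u) = K * Real.exp (θ * u - a * u ^ r) * Real.exp (a * u ^ r) := by
    rw [mul_assoc, ← Real.exp_add, sub_add_cancel]
  rw [hsplit]
  calc K * Real.exp (θ * u - a * u ^ r) * Real.exp (a * u ^ r) ≤ 1 * Real.exp (a * u ^ r) :=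
      mul_le_mul_of_nonneg_right hu.le (Real.exp_pos _).le
    _ = Real.exp (a * u ^ r) := one_mul _

/-- **THE EXPONENTIAL OF THE LOCALIZATION LENGTH BEATS EVERY INVERSE POWER OF THE CHARGE** (print's `r > 1` in (2.3)): for every `K`, `θ`,
every `a > 0` and `r > 1`, `K·e^{−θ} ≤ exp(a·r(e))` for all sufficiently small `e > 0` (`e^{−θ} = exp(θ|log e⁻¹|)` for `e < 1`).
[cite: BalabanImbrieJaffe1988, (2.3) p.260] -/
theorem eventually_rpow_neg_le_exp_rLen (K θ a r : ℝ) (ha : 0 < a) (hr : 1 < r) :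
    ∀ᶠ x : ℝ in 𝓝[>] 0, K * x ^ (-θ) ≤ Real.exp (a * rLen r x) := by
  filter_upwards [tendsto_abs_log_inv.eventually (eventually_mul_exp_le_exp_rpow K θ a r ha hr), Ioo_mem_nhdsGT one_pos]
    with x hx hx01
  have hlog : 0 ≤ Real.log x⁻¹ := Real.log_nonneg ((one_le_inv₀ hx01.1).mpr hx01.2.le)
  have hpow : x ^ (-θ) = Real.exp (θ * |Real.log x⁻¹|) := by
    rw [abs_of_nonneg hlog, Real.log_inv, Real.rpow_def_of_pos hx01.1]; ring_nf
  rw [hpow]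
  simpa only [rLen] using hx

/-- **A POSITIVE POWER OF THE CHARGE BEATS THE LOGARITHMIC SCALE** (2.33): for every `K`, `p` and every `θ > 0`, `K·e^{θ}·p(e) ≤ 1` for all
sufficiently small `e > 0`. [cite: BalabanImbrieJaffe1988, (2.33) p.263] -/
theorem eventually_rpow_mul_pLog_le_one (K θ p : ℝ) (hθ : 0 < θ) :
    ∀ᶠ x : ℝ in 𝓝[>] 0, K * x ^ θ * pLog p x ≤ 1 := by
  filter_upwards [eventually_pLog_le_exp_rLen K (θ / 2) p 1 (by positivity) one_pos, Ioo_mem_nhdsGT one_pos, eventually_le_one]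
    with x hx hx01 hx1
  have hlog : 0 ≤ Real.log x⁻¹ := Real.log_nonneg ((one_le_inv₀ hx01.1).mpr hx01.2.le)
  -- `exp((θ/2)·r₁(x)) = x^{−θ/2}` for the exponent-one localization length `r₁(x) = |log x⁻¹|`
  have hexp : Real.exp (θ / 2 * rLen 1 x) = x ^ (-(θ / 2)) := by
    unfold rLen
    rw [Real.rpow_one, abs_of_nonneg hlog, Real.log_inv, Real.rpow_def_of_pos hx01.1]; ring_nf
  have hxθ : 0 ≤ x ^ θ := Real.rpow_nonneg hx01.1.le _
  calc K * x ^ θ * pLog p x = x ^ θ * (K * pLog p x) := by ring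
    _ ≤ x ^ θ * x ^ (-(θ / 2)) := mul_le_mul_of_nonneg_left (hx.trans hexp.le) hxθ
    _ = x ^ (θ / 2) := by rw [← Real.rpow_add hx01.1]; ring_nf
    _ ≤ 1 := Real.rpow_le_one hx01.1.le hx1 (by positivity)

/-- **p. 266 «e²/λ = O(1)»**: `e² ≤ C·λ` with `e, C > 0` gives `λ^{−1/4} ≤ C^{1/4}·e^{−1/2}`. [cite: BalabanImbrieJaffe1988, (3.9) p.266] -/
theorem rpow_neg_quarter_le {e C lam : ℝ} (he : 0 < e) (hC : 0 < C) (hlam : e ^ 2 ≤ C * lam) :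
    lam ^ (-(1 / 4 : ℝ)) ≤ C ^ (1 / 4 : ℝ) * e ^ (-(1 / 2 : ℝ)) := by
  have he2 : 0 < e ^ 2 / C := by positivity
  have hle : e ^ 2 / C ≤ lam := by rw [div_le_iff₀ hC]; linarith
  calc lam ^ (-(1 / 4 : ℝ)) ≤ (e ^ 2 / C) ^ (-(1 / 4 : ℝ)) := Real.rpow_le_rpow_of_nonpos he2 hle (by norm_num)
    _ = C ^ (1 / 4 : ℝ) * e ^ (-(1 / 2 : ℝ)) := by
        rw [div_eq_mul_inv, Real.mul_rpow (by positivity) (by positivity), Real.inv_rpow hC.le, ← Real.rpow_neg hC.le, neg_neg,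
          show ((e ^ 2 : ℝ)) = e ^ ((2 : ℕ) : ℝ) by rw [Real.rpow_natCast], ← Real.rpow_mul he.le]
        norm_num
        ring

/-! ## §2  The regime of (3.33): the three inequalities hold for `e₀` small -/

/-- **THE REGIME OF (3.33)** (p. 266 *"e²/λ = O(1)"*, (2.3) `r > 1`, (2.33)): for decay rates `a, b > 0`, prefactors `K₁, K₂ ≥ 0`, `K₃`,
margins `κ, κ′ > 0` in units of `r(e)`, `r > 1` and `C > 0` there is `e* > 0` such that for `0 < e₀ < e*`, all `λ₀` with `e₀² ≤ Cλ₀`, all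
`R ≥ κ·r(e₀)` and all `ρ` with `ρ − 3 ≥ κ′·r(e₀)`:  `K₁·e^{−aR}·λ₀^{−1/4} ≤ 1`, `K₂·e^{−b(ρ−3)}·λ₀^{−1/4} ≤ 1`, and
`e₀·K₃·p(e₀)·λ₀^{−1/4} ≤ 1` (`p` any exponent). [cite: BalabanImbrieJaffe1988, (3.9) p.266] -/
theorem regime333 {a b K₁ K₂ κ κ' r C : ℝ} (K₃ p : ℝ) (ha : 0 < a) (hb : 0 < b) (hK₁ : 0 ≤ K₁) (hK₂ : 0 ≤ K₂) (hκ : 0 < κ)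
    (hκ' : 0 < κ') (hr : 1 < r) (hC : 0 < C) :
    ∃ estar > 0, ∀ e₀ : ℝ, 0 < e₀ → e₀ < estar → ∀ lam₀ R ρ : ℝ, e₀ ^ 2 ≤ C * lam₀ → κ * rLen r e₀ ≤ R → κ' * rLen r e₀ ≤ ρ - 3 →
      K₁ * Real.exp (-(a * R)) * lam₀ ^ (-(1 / 4 : ℝ)) ≤ 1 ∧
        K₂ * Real.exp (-(b * (ρ - 3))) * lam₀ ^ (-(1 / 4 : ℝ)) ≤ 1 ∧
          e₀ * K₃ * pLog p e₀ * lam₀ ^ (-(1 / 4 : ℝ)) ≤ 1 := by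
  have hC4 : 0 < C ^ (1 / 4 : ℝ) := Real.rpow_pos_of_pos hC _
  apply exists_threshold
  filter_upwards [eventually_rpow_neg_le_exp_rLen (K₁ * C ^ (1 / 4 : ℝ)) (1 / 2) (a * κ) r (mul_pos ha hκ) hr,
    eventually_rpow_neg_le_exp_rLen (K₂ * C ^ (1 / 4 : ℝ)) (1 / 2) (b * κ') r (mul_pos hb hκ') hr,
    eventually_rpow_mul_pLog_le_one (|K₃| * C ^ (1 / 4 : ℝ)) (1 / 2) p one_half_pos, Ioo_mem_nhdsGT one_pos]
    with e h1 h2 h3 he01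
  intro lam₀ R ρ hlam hR hρ
  have he : 0 < e := he01.1
  have hq := rpow_neg_quarter_le he hC hlam
  have hlam0 : 0 < lam₀ := by
    have : 0 < e ^ 2 := by positivity
    nlinarith
  have hlq : 0 ≤ lam₀ ^ (-(1 / 4 : ℝ)) := Real.rpow_nonneg hlam0.le _
  have hem : 0 < e ^ (-(1 / 2 : ℝ)) := Real.rpow_pos_of_pos he _
  have hep : 0 ≤ pLog p e := Real.rpow_nonneg (abs_nonneg _) _
  -- `e^{1/2}·e^{−1/2} = 1`
  have hee : e ^ (1 / 2 : ℝ) * e ^ (-(1 / 2 : ℝ)) = 1 := by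
    rw [← Real.rpow_add he]; norm_num
  refine ⟨?_, ?_, ?_⟩
  · -- K₁ e^{−aR} λ^{−1/4} ≤ K₁ C^{1/4} e^{−1/2} e^{−aκ r(e)} ≤ 1
    have hexp : Real.exp (-(a * R)) ≤ Real.exp (-(a * κ * rLen r e)) := Real.exp_le_exp.2 (by nlinarith)
    have h1' : K₁ * C ^ (1 / 4 : ℝ) * e ^ (-(1 / 2 : ℝ)) * Real.exp (-(a * κ * rLen r e)) ≤ 1 := by
      rw [Real.exp_neg]
      exact (mul_inv_le_iff₀ (Real.exp_pos _)).2 (by rw [one_mul]; exact h1)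
    calc K₁ * Real.exp (-(a * R)) * lam₀ ^ (-(1 / 4 : ℝ))
        ≤ K₁ * Real.exp (-(a * κ * rLen r e)) * (C ^ (1 / 4 : ℝ) * e ^ (-(1 / 2 : ℝ))) :=
          mul_le_mul (mul_le_mul_of_nonneg_left hexp hK₁) hq hlq (by positivity)
      _ = K₁ * C ^ (1 / 4 : ℝ) * e ^ (-(1 / 2 : ℝ)) * Real.exp (-(a * κ * rLen r e)) := by ring
      _ ≤ 1 := h1'
  · have hexp : Real.exp (-(b * (ρ - 3))) ≤ Real.exp (-(b * κ' * rLen r e)) := Real.exp_le_exp.2 (by nlinarith)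
    have h2' : K₂ * C ^ (1 / 4 : ℝ) * e ^ (-(1 / 2 : ℝ)) * Real.exp (-(b * κ' * rLen r e)) ≤ 1 := by
      rw [Real.exp_neg]
      exact (mul_inv_le_iff₀ (Real.exp_pos _)).2 (by rw [one_mul]; exact h2)
    calc K₂ * Real.exp (-(b * (ρ - 3))) * lam₀ ^ (-(1 / 4 : ℝ))
        ≤ K₂ * Real.exp (-(b * κ' * rLen r e)) * (C ^ (1 / 4 : ℝ) * e ^ (-(1 / 2 : ℝ))) :=
          mul_le_mul (mul_le_mul_of_nonneg_left hexp hK₂) hq hlq (by positivity)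
      _ = K₂ * C ^ (1 / 4 : ℝ) * e ^ (-(1 / 2 : ℝ)) * Real.exp (-(b * κ' * rLen r e)) := by ring
      _ ≤ 1 := h2'
  · -- e K₃ p(e) λ^{−1/4} ≤ |K₃| C^{1/4} e^{1/2} p(e) ≤ 1
    have he1 : e = e ^ (1 / 2 : ℝ) * e ^ (1 / 2 : ℝ) := by rw [← Real.rpow_add he]; norm_num
    calc e * K₃ * pLog p e * lam₀ ^ (-(1 / 4 : ℝ)) ≤ e * |K₃| * pLog p e * (C ^ (1 / 4 : ℝ) * e ^ (-(1 / 2 : ℝ))) :=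
          mul_le_mul (mul_le_mul_of_nonneg_right (mul_le_mul_of_nonneg_left (le_abs_self K₃) he.le) hep) hq hlq (by positivity)
      _ = |K₃| * C ^ (1 / 4 : ℝ) * e ^ (1 / 2 : ℝ) * pLog p e * (e ^ (1 / 2 : ℝ) * e ^ (-(1 / 2 : ℝ))) := by
          nth_rewrite 1 [he1]; ring
      _ = |K₃| * C ^ (1 / 4 : ℝ) * e ^ (1 / 2 : ℝ) * pLog p e := by rw [hee, mul_one]
      _ ≤ 1 := h3

/-- **p. 266 «e²/λ = O(1)», upward form**: `e² ≤ C·λ` with `e, C > 0` gives `C^{−1/4}·e^{1/2} ≤ λ^{1/4}`. [cite: BalabanImbrieJaffe1988, (3.9) p.266] -/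
theorem rpow_quarter_ge {e C lam : ℝ} (he : 0 < e) (hC : 0 < C) (hlam : e ^ 2 ≤ C * lam) :
    C ^ (-(1 / 4 : ℝ)) * e ^ (1 / 2 : ℝ) ≤ lam ^ (1 / 4 : ℝ) := by
  have he2 : 0 ≤ e ^ 2 / C := by positivity
  have hle : e ^ 2 / C ≤ lam := by rw [div_le_iff₀ hC]; linarith
  have hrew : (e ^ 2 / C) ^ (1 / 4 : ℝ) = C ^ (-(1 / 4 : ℝ)) * e ^ (1 / 2 : ℝ) := by
    rw [div_eq_mul_inv (e ^ 2) C, Real.mul_rpow (by positivity) (by positivity), Real.inv_rpow hC.le, ← Real.rpow_neg hC.le,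
      show ((e ^ 2 : ℝ)) = e ^ ((2 : ℕ) : ℝ) by rw [Real.rpow_natCast], ← Real.rpow_mul he.le]
    norm_num
    ring
  rw [← hrew]
  exact Real.rpow_le_rpow he2 hle (by norm_num)

/-- **THE REGIME OF (3.32)** (p. 270 *"|v(p) − 1| ≦ ce₀p(e₀)"*, *"|ψ(y)| ≦ cp(e₀)λ₀^{−1/4}"*; p. 266 *"e²/λ = O(1)"*, (2.33)): for prefactors
`K₁, K₂, K₃ ≥ 0`, any `c_p`, `p` and `C > 0` there is `e* > 0` such that for `0 < e₀ < e*`, every `p(e₀) ≤ c_p|log e₀⁻¹|^p` and every `λ₀`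
with `e₀² ≤ Cλ₀`: `K₁e₀p(e₀) < π`, `K₂e₀p(e₀) ≤ λ₀^{1/4}` and `K₃e₀p(e₀) ≤ λ₀^{1/4}` — the three regime hypotheses of p30's
`BIJ88SmallBlockFields332Ubar.smallBlock332_u1bar_byName` (`17d²L²e₀p(e₀) < π`, `2·17d²L²e₀p(e₀) ≤ λ₀^{1/4}`, `L·e₀Cp(e₀) ≤ λ₀^{1/4}`).
[cite: BalabanImbrieJaffe1988, (3.32) p.270] -/
theorem regime332 (K₁ K₂ K₃ cp p : ℝ) {C : ℝ} (hK₁ : 0 ≤ K₁) (hK₂ : 0 ≤ K₂) (hK₃ : 0 ≤ K₃) (hC : 0 < C) :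
    ∃ estar > 0, ∀ e : ℝ, 0 < e → e < estar → ∀ pe lam : ℝ, pe ≤ cp * pLog p e → e ^ 2 ≤ C * lam →
      K₁ * (e * pe) < Real.pi ∧ K₂ * (e * pe) ≤ lam ^ (1 / 4 : ℝ) ∧ K₃ * (e * pe) ≤ lam ^ (1 / 4 : ℝ) := by
  have hC4 : 0 < C ^ (1 / 4 : ℝ) := Real.rpow_pos_of_pos hC _
  apply exists_threshold
  filter_upwards [eventually_rpow_mul_pLog_le_one (K₁ * cp) 1 p one_pos,
    eventually_rpow_mul_pLog_le_one (K₂ * cp * C ^ (1 / 4 : ℝ)) (1 / 2) p one_half_pos,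
    eventually_rpow_mul_pLog_le_one (K₃ * cp * C ^ (1 / 4 : ℝ)) (1 / 2) p one_half_pos, Ioo_mem_nhdsGT one_pos]
    with e h1 h2 h3 he01
  intro pe lam hpe hlam
  have he : 0 < e := he01.1
  have hq := rpow_quarter_ge he hC hlam
  have hCe : 0 ≤ C ^ (-(1 / 4 : ℝ)) * e ^ (1 / 2 : ℝ) := by positivity
  -- `e = e^{1/2}·(C^{1/4}·(C^{−1/4}e^{1/2}))`
  have hCC : C ^ (1 / 4 : ℝ) * C ^ (-(1 / 4 : ℝ)) = 1 := by rw [← Real.rpow_add hC]; norm_num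
  have he1 : e = e ^ (1 / 2 : ℝ) * (C ^ (1 / 4 : ℝ) * (C ^ (-(1 / 4 : ℝ)) * e ^ (1 / 2 : ℝ))) := by
    calc e = e ^ (1 / 2 : ℝ) * e ^ (1 / 2 : ℝ) := by rw [← Real.rpow_add he]; norm_num
      _ = _ := by rw [← mul_assoc (C ^ (1 / 4 : ℝ)), hCC, one_mul]
  have key : ∀ K : ℝ, 0 ≤ K → K * cp * C ^ (1 / 4 : ℝ) * e ^ (1 / 2 : ℝ) * pLog p e ≤ 1 → K * (e * pe) ≤ lam ^ (1 / 4 : ℝ) := by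
    intro K hK hKe
    calc K * (e * pe) ≤ K * (e * (cp * pLog p e)) := mul_le_mul_of_nonneg_left (mul_le_mul_of_nonneg_left hpe he.le) hK
      _ = (K * cp * C ^ (1 / 4 : ℝ) * e ^ (1 / 2 : ℝ) * pLog p e) * (C ^ (-(1 / 4 : ℝ)) * e ^ (1 / 2 : ℝ)) := by
          nth_rewrite 1 [he1]; ring
      _ ≤ 1 * (C ^ (-(1 / 4 : ℝ)) * e ^ (1 / 2 : ℝ)) := mul_le_mul_of_nonneg_right hKe hCe
      _ ≤ lam ^ (1 / 4 : ℝ) := by rw [one_mul]; exact hq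
  refine ⟨?_, key K₂ hK₂ h2, key K₃ hK₃ h3⟩
  rw [Real.rpow_one] at h1
  calc K₁ * (e * pe) ≤ K₁ * (e * (cp * pLog p e)) := mul_le_mul_of_nonneg_left (mul_le_mul_of_nonneg_left hpe he.le) hK₁
    _ = K₁ * cp * e * pLog p e := by ring
    _ ≤ 1 := h1
    _ < Real.pi := by linarith [Real.pi_gt_three]

/-! ## §3  (3.33), scalar-field half, in print's regime -/

section Scalar

open Finset Matrix
open BIJ88Sect3Statements (U1 cfg covD)
open BIJ85BlockAveragesTorus BIJ85BlockAveragesTorusK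
open BIJ88NeumannPropagator227Torus (nOp)
open BIJ88DeltaLoc234Torus (qMatT)
open BIJ88Eq240FlatTorus (compress)
open BIJ88RandomWalk242 BIJ88Eq242Lattice BIJ88Ineq246Lattice B4Sect5CubeBounds
open BIJ88Eq242HiggsCovarianceTorus
open B4Sect5Proof (latticeConst)
open BIJ85Eq325Corrections (uOne)
open BIJ88Small333ScalarField (small333_scalar_of_smallField315 small333_scalar_of_smallField315_at_u)

/-- **(3.33), SCALAR-FIELD HALF, IN PRINT'S REGIME** — gen 40's `BIJ88Small333ScalarField.small333_scalar_of_smallField315` with its two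
regime inequalities `e^{−(δ₀/16M)R}λ₀^{−1/4} ≤ 1`, `δ₂₄₇c′λ₀^{−1/4} ≤ 1` DISCHARGED: there is `e* > 0`, depending only on
`(d, γ₀, c₀, δ₀, M, c′, κ, κ′, r, C)`, such that on every torus, for every region, kernel and fields as there, the conclusion
`‖φ^{(0)}(x)‖ ≤ c·p(e₀)` on `Λ₇` holds as soon as the charge of (3.32) satisfies `0 < e₀ < e*` and `e₀² ≤ Cλ₀` (p. 266 *"e²/λ = O(1)"*), the
located margin is `R ≥ κ·r(e₀)` and the walk-resummation radius is `ρ − 3 ≥ κ′·r(e₀)` ((2.3), `r > 1`; print: margins *"O(r(e_k))"*).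
[cite: BalabanImbrieJaffe1988, (3.33) p.270] -/
theorem small333_scalar_of_smallField315_regime (d : ℕ) (γ₀ c₀ : ℝ) {δ₀ : ℝ} (hδ : 0 < δ₀) {M : ℕ} (hM : 5 ≤ M) (c' : ℝ)
    {κ κ' r C : ℝ} (hκ : 0 < κ) (hκ' : 0 < κ') (hr : 1 < r) (hC : 0 < C) :
    ∃ estar > 0, ∀ {P : Params}, P.d = d → ∀ {j : ℕ} {Λ : Finset (Balaban1983to89.Site P j)} {a L c : ℝ},
      0 ≤ a * L ^ (-(2 : ℤ)) → ∀ (U : GaugeField P j U1), BIJ88NeumannNoZeroModesTorus.IsBlockUnion 1 Λ → 0 < γ₀ → 0 ≤ c₀ →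
      B4.Hyp56 (chartSet Λ) (reOp Λ (nOp (a * L ^ (-(2 : ℤ))) c U 1 univ)) γ₀ c₀ δ₀ →
      IsUnit (compress Λ (nOp (a * L ^ (-(2 : ℤ))) c U 1 univ)) → kR P.d 2 γ₀ c₀ δ₀ < M → thetaConst P.d 2 γ₀ c₀ δ₀ < M →
      thetaW P.d 2 γ₀ c₀ δ₀ M < 1 → ∀ (ρ : ℝ) (Kl : Matrix ↥Λ ↥Λ ℂ),
      (∀ x₁ x₂ : ↥Λ, Kl x₁ x₂ =
        ⟨cLoc (ldist (N := 2) M) ρ (fun ω y₁ y₂ => latticeCw M (chartSet Λ) 2 (reOp Λ (nOp (a * L ^ (-(2 : ℤ))) c U 1 univ)) ω y₁ y₂)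
            (idxEquiv Λ (x₁, 0)) (idxEquiv Λ (x₂, 0)),
         cLoc (ldist (N := 2) M) ρ (fun ω y₁ y₂ => latticeCw M (chartSet Λ) 2 (reOp Λ (nOp (a * L ^ (-(2 : ℤ))) c U 1 univ)) ω y₁ y₂)
            (idxEquiv Λ (x₁, 1)) (idxEquiv Λ (x₂, 0))⟩) →
      ∀ {φ φ0 corr : Balaban1983to89.Site P j → ℂ} {ψ : Balaban1983to89.Site P (j + 1) → ℂ} {Λ₇ : Finset (Balaban1983to89.Site P j)},
      Λ₇ ⊆ Λ → φ = BIJ88Sect3Translations.phi330 Λ₇ a L φ0 corr →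
      (∀ x₂ : ↥Λ, (x₂ : Balaban1983to89.Site P j) ∈ Λ₇ → corr x₂ = (Kl *ᵥ fun x₃ : ↥Λ => ((qMatT U 1)ᴴ *ᵥ ψ) x₃) x₂) →
      ∀ {Λ₀ : Finset (Balaban1983to89.Site P j)} {Λ₀' : Finset (Balaban1983to89.Site P (j + 1))} {pe₀ lam₀ e₀ R : ℝ}, 0 ≤ pe₀ →
      ∀ {f0 : Balaban1983to89.Plaq P j → ℝ} {v : Balaban1983to89.Plaq P (j + 1) → ℂ} {Dψ : PBond P (j + 1) → ℂ},
      BIJ88Sect3Statements.SmallField315 pe₀ lam₀ Λ₀ Λ₀' (covD c (cfg U) φ) ψ (qMatT U 1 *ᵥ φ) φ f0 →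
      BIJ88Sect3Statements.SmallBlock332 c' e₀ pe₀ lam₀ Λ₀' v ψ Dψ →
      (∀ b : PBond P j, (b.src ∈ Λ ∨ b.tgt ∈ Λ) → b ∈ BIJ88Sect3Statements.starB Λ₀) →
      (∀ y : Balaban1983to89.Site P (j + 1), blockK 1 y ⊆ Λ → y ∈ Λ₀') →
      (∀ x ∈ Λ₇, ∀ x₂ ∈ Λ, (∃ μ : Fin P.d, x₂.shift μ ∉ Λ ∨ x₂.unshift μ ∉ Λ) → R ≤ B5Ineq137Torus.T P j x x₂) →
      0 < e₀ → e₀ < estar → e₀ ^ 2 ≤ C * lam₀ → κ * rLen r e₀ ≤ R → κ' * rLen r e₀ ≤ ρ - 3 →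
      ∀ x ∈ Λ₇, ‖φ0 x‖ ≤
        (2 * (2 ^ P.d * γ₀⁻¹ * (1 - thetaW P.d 2 γ₀ c₀ δ₀ M)⁻¹ * Real.exp (δ₀ / 4)) * latticeConst P.d (δ₀ / 8 / M)
              * (|c| * (2 * P.d) + a * L ^ (-(2 : ℤ)) * ((P.L : ℝ) ^ P.d)⁻¹) * 1
          + 2 * (2 ^ P.d * γ₀⁻¹ * (1 - thetaW P.d 2 γ₀ c₀ δ₀ M)⁻¹ * Real.exp (δ₀ / 4)) * latticeConst P.d (δ₀ / 16 / M)
              * (|c| * (2 * P.d) * |c|)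
          + a * L ^ (-(2 : ℤ)) * 2 * latticeConst P.d (δ₀ / 16 / M) * ((P.L : ℝ) ^ P.d)⁻¹) * pe₀ := by
  have hM0 : (0 : ℝ) < M := by exact_mod_cast (show 0 < M by omega)
  obtain ⟨estar, hstar, hreg⟩ := regime333 (a := δ₀ / 16 / M) (b := δ₀ / 16) (K₁ := 1)
    (K₂ := |2 ^ d * γ₀⁻¹ * (1 - thetaW d 2 γ₀ c₀ δ₀ M)⁻¹ * c'|) 0 0 (by positivity) (by positivity) zero_le_one (abs_nonneg _)
    hκ hκ' hr hC
  refine ⟨estar, hstar, ?_⟩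
  intro P hPd j Λ a L c haL U hΛ hγ hc hA hU hMR hMθ hθW ρ Kl hKl φ φ0 corr ψ Λ₇ h7 hφ hcorr Λ₀ Λ₀' pe₀ lam₀ e₀ R hpe f0 v Dψ
    h315 h332 hB hY hR he₀ hlt hlam hRκ hρκ
  obtain ⟨h1, h2, -⟩ := hreg e₀ he₀ hlt lam₀ R ρ hlam hRκ hρκ
  have hlam0 : 0 ≤ lam₀ := by
    have : 0 < e₀ ^ 2 := by positivity
    nlinarith
  have hlq : 0 ≤ lam₀ ^ (-(1 / 4 : ℝ)) := Real.rpow_nonneg hlam0 _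
  subst hPd
  refine small333_scalar_of_smallField315 haL U hΛ hγ hc hδ hA hU hM hMR hMθ hθW ρ Kl hKl h7 hφ hcorr hpe hlam0 h315 h332 hB hY hR
    ?_ ?_
  · simpa only [one_mul] using h1
  · calc 2 ^ P.d * γ₀⁻¹ * (1 - thetaW P.d 2 γ₀ c₀ δ₀ M)⁻¹ * Real.exp (-(δ₀ / 16 * (ρ - 3))) * (c' * lam₀ ^ (-(1 / 4 : ℝ)))
        = (2 ^ P.d * γ₀⁻¹ * (1 - thetaW P.d 2 γ₀ c₀ δ₀ M)⁻¹ * c') * Real.exp (-(δ₀ / 16 * (ρ - 3))) * lam₀ ^ (-(1 / 4 : ℝ)) := by ring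
      _ ≤ |2 ^ P.d * γ₀⁻¹ * (1 - thetaW P.d 2 γ₀ c₀ δ₀ M)⁻¹ * c'| * Real.exp (-(δ₀ / 16 * (ρ - 3))) * lam₀ ^ (-(1 / 4 : ℝ)) :=
          mul_le_mul_of_nonneg_right (mul_le_mul_of_nonneg_right (le_abs_self _) (Real.exp_pos _).le) hlq
      _ ≤ 1 := h2

/-- **(3.33), SCALAR-FIELD HALF, FROM (3.15) AS PRINTED (AT `u`), IN PRINT'S REGIME** — gen 40's
`BIJ88Small333ScalarField.small333_scalar_of_smallField315_at_u` with its three regime inequalities (`hRlam`, `hδlam` and the transfer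
inequality `|e₀|c_Ap(e₀)λ₀^{−1/4} ≤ 1`) DISCHARGED: there is `e* > 0`, depending only on `(d, γ₀, c₀, δ₀, M, c′, c_A, c_p, p, κ, κ′, r, C)`,
such that the conclusion holds as soon as `0 < e₀ < e*`, `e₀² ≤ Cλ₀` (p. 266), `R ≥ κ·r(e₀)`, `ρ − 3 ≥ κ′·r(e₀)` ((2.3)) and the small-field
scale is print's, `p(e₀) ≤ c_p·|log e₀⁻¹|^p` ((2.33); r18's `pLog`). [cite: BalabanImbrieJaffe1988, (3.33) p.270] -/
theorem small333_scalar_of_smallField315_at_u_regime (d : ℕ) (γ₀ c₀ : ℝ) {δ₀ : ℝ} (hδ : 0 < δ₀) {M : ℕ} (hM : 5 ≤ M)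
    (c' cA cp p : ℝ) {κ κ' r C : ℝ} (hκ : 0 < κ) (hκ' : 0 < κ') (hr : 1 < r) (hC : 0 < C) :
    ∃ estar > 0, ∀ {P : Params}, P.d = d → ∀ {j : ℕ}, j + 1 ≤ P.m + P.K → ∀ {Λ : Finset (Balaban1983to89.Site P j)} {a L c e₀ : ℝ},
      0 ≤ a * L ^ (-(2 : ℤ)) → 0 ≤ cA → ∀ (U : GaugeField P j U1) (A0 : PBond P j → ℝ), BIJ88NeumannNoZeroModesTorus.IsBlockUnion 1 Λ →
      0 < γ₀ → 0 ≤ c₀ → B4.Hyp56 (chartSet Λ) (reOp Λ (nOp (a * L ^ (-(2 : ℤ))) c (uOne U e₀ A0) 1 univ)) γ₀ c₀ δ₀ →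
      IsUnit (compress Λ (nOp (a * L ^ (-(2 : ℤ))) c (uOne U e₀ A0) 1 univ)) → kR P.d 2 γ₀ c₀ δ₀ < M →
      thetaConst P.d 2 γ₀ c₀ δ₀ < M → thetaW P.d 2 γ₀ c₀ δ₀ M < 1 → ∀ (ρ : ℝ)
      (K : Matrix (Balaban1983to89.Site P j) (Balaban1983to89.Site P j) ℂ), (∀ x₁ ∈ Λ, ∀ x₂ ∉ Λ, K x₁ x₂ = 0) →
      (∀ x₁ x₂ : ↥Λ, K x₁ x₂ =
        ⟨cLoc (ldist (N := 2) M) ρ (fun ω y₁ y₂ => latticeCw M (chartSet Λ) 2 (reOp Λ (nOp (a * L ^ (-(2 : ℤ))) c (uOne U e₀ A0) 1 univ))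
              ω y₁ y₂) (idxEquiv Λ (x₁, 0)) (idxEquiv Λ (x₂, 0)),
         cLoc (ldist (N := 2) M) ρ (fun ω y₁ y₂ => latticeCw M (chartSet Λ) 2 (reOp Λ (nOp (a * L ^ (-(2 : ℤ))) c (uOne U e₀ A0) 1 univ))
              ω y₁ y₂) (idxEquiv Λ (x₁, 1)) (idxEquiv Λ (x₂, 0))⟩) →
      ∀ {φ φ0 corr : Balaban1983to89.Site P j → ℂ} {ψ : Balaban1983to89.Site P (j + 1) → ℂ} {Λ₇ : Finset (Balaban1983to89.Site P j)},
      Λ₇ ⊆ Λ → φ = BIJ88Sect3Translations.phi330 Λ₇ a L φ0 corr → (∀ x ∈ Λ₇, corr x = (K *ᵥ ((qMatT (uOne U e₀ A0) 1)ᴴ *ᵥ ψ)) x) →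
      ∀ {Λ₀ : Finset (Balaban1983to89.Site P j)} {Λ₀' : Finset (Balaban1983to89.Site P (j + 1))} {pe₀ lam₀ e₀' R : ℝ}, 0 ≤ pe₀ →
      ∀ {f0 : Balaban1983to89.Plaq P j → ℝ} {v : Balaban1983to89.Plaq P (j + 1) → ℂ} {Dψ : PBond P (j + 1) → ℂ},
      BIJ88Sect3Statements.SmallField315 pe₀ lam₀ Λ₀ Λ₀' (covD c (cfg U) φ) ψ (qMatT U 1 *ᵥ φ) φ f0 →
      BIJ88Sect3Statements.SmallBlock332 c' e₀' pe₀ lam₀ Λ₀' v ψ Dψ →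
      (∀ b ∈ BIJ88Sect3Statements.starB Λ₀, |A0 b| ≤ cA * pe₀) →
      (∀ b : PBond P j, (b.src ∈ Λ ∨ b.tgt ∈ Λ) → b ∈ BIJ88Sect3Statements.starB Λ₀) →
      (∀ y : Balaban1983to89.Site P (j + 1), blockK 1 y ⊆ Λ → y ∈ Λ₀') →
      (∀ x ∈ Λ₇, ∀ x₂ ∈ Λ, (∃ μ : Fin P.d, x₂.shift μ ∉ Λ ∨ x₂.unshift μ ∉ Λ) → R ≤ B5Ineq137Torus.T P j x x₂) →
      0 < e₀ → e₀ < estar → e₀ ^ 2 ≤ C * lam₀ → κ * rLen r e₀ ≤ R → κ' * rLen r e₀ ≤ ρ - 3 → pe₀ ≤ cp * pLog p e₀ →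
      ∀ x ∈ Λ₇, ‖φ0 x‖ ≤
        (2 * (2 ^ P.d * γ₀⁻¹ * (1 - thetaW P.d 2 γ₀ c₀ δ₀ M)⁻¹ * Real.exp (δ₀ / 4)) * latticeConst P.d (δ₀ / 8 / M)
              * (|c| * (2 * P.d) + a * L ^ (-(2 : ℤ)) * ((P.L : ℝ) ^ P.d)⁻¹) * (1 + |c| + P.d * (P.L - 1 : ℕ))
          + 2 * (2 ^ P.d * γ₀⁻¹ * (1 - thetaW P.d 2 γ₀ c₀ δ₀ M)⁻¹ * Real.exp (δ₀ / 4)) * latticeConst P.d (δ₀ / 16 / M)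
              * (|c| * (2 * P.d) * |c|)
          + a * L ^ (-(2 : ℤ)) * 2 * latticeConst P.d (δ₀ / 16 / M) * ((P.L : ℝ) ^ P.d)⁻¹) * pe₀ := by
  have hM0 : (0 : ℝ) < M := by exact_mod_cast (show 0 < M by omega)
  obtain ⟨estar, hstar, hreg⟩ := regime333 (a := δ₀ / 16 / M) (b := δ₀ / 16) (K₁ := 1)
    (K₂ := |2 ^ d * γ₀⁻¹ * (1 - thetaW d 2 γ₀ c₀ δ₀ M)⁻¹ * c'|) (cA * cp) p (by positivity) (by positivity) zero_le_one (abs_nonneg _)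
    hκ hκ' hr hC
  refine ⟨estar, hstar, ?_⟩
  intro P hPd j hj Λ a L c e₀ haL hcA U A0 hΛ hγ hc hA hU hMR hMθ hθW ρ K hK0 hKl φ φ0 corr ψ Λ₇ h7 hφ hcorr Λ₀ Λ₀' pe₀ lam₀ e₀' R hpe
    f0 v Dψ h315 h332 hA0 hB hY hR he₀ hlt hlam hRκ hρκ hpcp
  obtain ⟨h1, h2, h3⟩ := hreg e₀ he₀ hlt lam₀ R ρ hlam hRκ hρκ
  have hlam0 : 0 ≤ lam₀ := by
    have : 0 < e₀ ^ 2 := by positivity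
    nlinarith
  have hlq : 0 ≤ lam₀ ^ (-(1 / 4 : ℝ)) := Real.rpow_nonneg hlam0 _
  subst hPd
  refine small333_scalar_of_smallField315_at_u hj haL hcA U A0 hΛ hγ hc hδ hA hU hM hMR hMθ hθW ρ K hK0 hKl h7 hφ hcorr hpe hlam0
    h315 h332 hA0 hB hY hR ?_ ?_ ?_
  · simpa only [one_mul] using h1
  · calc 2 ^ P.d * γ₀⁻¹ * (1 - thetaW P.d 2 γ₀ c₀ δ₀ M)⁻¹ * Real.exp (-(δ₀ / 16 * (ρ - 3))) * (c' * lam₀ ^ (-(1 / 4 : ℝ)))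
        = (2 ^ P.d * γ₀⁻¹ * (1 - thetaW P.d 2 γ₀ c₀ δ₀ M)⁻¹ * c') * Real.exp (-(δ₀ / 16 * (ρ - 3))) * lam₀ ^ (-(1 / 4 : ℝ)) := by ring
      _ ≤ |2 ^ P.d * γ₀⁻¹ * (1 - thetaW P.d 2 γ₀ c₀ δ₀ M)⁻¹ * c'| * Real.exp (-(δ₀ / 16 * (ρ - 3))) * lam₀ ^ (-(1 / 4 : ℝ)) :=
          mul_le_mul_of_nonneg_right (mul_le_mul_of_nonneg_right (le_abs_self _) (Real.exp_pos _).le) hlq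
      _ ≤ 1 := h2
  · have hpl : 0 ≤ pLog p e₀ := Real.rpow_nonneg (abs_nonneg _) _
    calc |e₀| * (cA * pe₀) * lam₀ ^ (-(1 / 4 : ℝ)) ≤ |e₀| * (cA * (cp * pLog p e₀)) * lam₀ ^ (-(1 / 4 : ℝ)) :=
          mul_le_mul_of_nonneg_right (mul_le_mul_of_nonneg_left (mul_le_mul_of_nonneg_left hpcp hcA) (abs_nonneg _)) hlq
      _ = e₀ * (cA * cp) * pLog p e₀ * lam₀ ^ (-(1 / 4 : ℝ)) := by rw [abs_of_pos he₀]; ring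
      _ ≤ 1 := h3

end Scalar

/-! ## §4  (3.33), gauge-field half: the located margin from the collar (r18's `collarShrink`) -/

section Gauge

open Finset
open LatticeFieldCalculus (supDist)
open BIJ85Ineq722Torus (supDist_triangle supDist_runSite_le)
open BIJ85Ineq723Torus (supDist_le_of_blockOf_eq)
open BIJ85BlockAveragesTorus (blockOf_runSite_L)
open BIJ88RegionTower274 (collarShrink mem_collarShrink)
open BIJ88Sect3Statements (starB starP mem_starB)
open BIJ88Sect3Translations (Aprime327)
open BIJ88Sect5StatementsPart3 (SmallAPrime)
open BIJ88ClocEstimatesTorus (Cloc)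
open BIJ88ClocFactorsTorus (distB)
open BIJ85Eq531Proof (plaqDiv)
open BIJ85CurlQsstar (torusEdgeCells)
open BIJ88Small333GaugeField (small333_gauge_of_bound)

variable {P : Params} {j : ℕ}

/-- kernel: membership in `X**` (r18's `starP`: all four corners in `X`). [cite: BalabanImbrieJaffe1988, (3.5) p.266] -/
private theorem mem_starP {X : Finset (Balaban1983to89.Site P j)} {q : Balaban1983to89.Plaq P j} :
    q ∈ starP X ↔ q.src ∈ X ∧ q.src.shift q.μ ∈ X ∧ q.src.shift q.ν ∈ X ∧ (q.src.shift q.μ).shift q.ν ∈ X := by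
  simp [starP]

/-- kernel: `x + Le_μ` is within sup-distance `L` of `x` and lies in the adjacent block `blockOf x + e_μ` (the tree's `supDist_runSite_le`,
`blockOf_runSite_L`). [cite: BalabanImbrieJaffe1985, (2.10) p.303] -/
private theorem runSite_L_spec (hj : j + 1 ≤ P.m + P.K) (x : Balaban1983to89.Site P j) (μ : Fin P.d) :
    supDist x (BIJ85BlockAveragesTorus.runSite x μ P.L) ≤ P.L ∧ blockOf (BIJ85BlockAveragesTorus.runSite x μ P.L) = (blockOf x).shift μ :=
  ⟨supDist_runSite_le x μ P.L, blockOf_runSite_L hj x μ⟩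

/-- **A SITE OF THE ADJACENT BLOCK IS NEAR**: if `blockOf z = blockOf x + e_μ` then `|x − z|_∞ ≤ 2L − 1` (blocks are cubes of side `L`).
[cite: Balaban1987RG1, (0.1) p.252] -/
theorem supDist_le_of_blockOf_eq_shift (hj : j + 1 ≤ P.m + P.K) {x z : Balaban1983to89.Site P j} {μ : Fin P.d}
    (h : blockOf z = (blockOf x).shift μ) : supDist x z ≤ 2 * P.L - 1 := by
  obtain ⟨h1, h2⟩ := runSite_L_spec hj x μ
  have h3 : supDist (BIJ85BlockAveragesTorus.runSite x μ P.L) z ≤ P.L - 1 := supDist_le_of_blockOf_eq hj (h2.trans h.symm)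
  have h4 := supDist_triangle x (BIJ85BlockAveragesTorus.runSite x μ P.L) z
  have hL := P.L_pos
  omega

/-- **A SITE OF THE DIAGONALLY ADJACENT BLOCK IS NEAR**: if `blockOf z = blockOf x + e_μ + e_ν` then `|x − z|_∞ ≤ 3L − 1`.
[cite: Balaban1987RG1, (0.1) p.252] -/
theorem supDist_le_of_blockOf_eq_shift_shift (hj : j + 1 ≤ P.m + P.K) {x z : Balaban1983to89.Site P j} {μ ν : Fin P.d}
    (h : blockOf z = ((blockOf x).shift μ).shift ν) : supDist x z ≤ 3 * P.L - 1 := by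
  obtain ⟨h1, h2⟩ := runSite_L_spec hj x μ
  have h3 : supDist (BIJ85BlockAveragesTorus.runSite x μ P.L) z ≤ 2 * P.L - 1 :=
    supDist_le_of_blockOf_eq_shift hj (by rw [h, h2])
  have h4 := supDist_triangle x (BIJ85BlockAveragesTorus.runSite x μ P.L) z
  have hL := P.L_pos
  omega

/-- **THE LOCATED MARGIN OF THE GAUGE HALF FROM THE COLLAR** (p. 267 *"by deleting r(e₀)-cubes at the boundary"*; p. 274 *"subtracting collar
neighborhoods of width r(e_j)"* = r18's `BIJ88RegionTower274.collarShrink`): if `Λ₁ ⊆ collarShrink r Λ₀` (the sites of `Λ₀` more than `r`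
from `Λ₀ᶜ`) with `ρ + 3L ≤ r + 1`, then for every `x₀ ∈ Λ₁` and every `x` within sup-distance `ρ` of `x₀`, the four blocks around every coarse
plaquette `q` based at `blockOf x` lie inside `Λ₀`; hence `q ∈ Y**` for every coarse region `Y` containing the blocks inside `Λ₀` — the
hypothesis `hmargin` of `BIJ88Small333GaugeField.small333_gauge_of_bound` (there `ρ = R + 4L + 1`). [cite: BalabanImbrieJaffe1988, (3.33) p.270] -/
theorem margin_coarse_of_collarShrink (hj : j + 1 ≤ P.m + P.K) {Λ₀ Λ₁ : Finset (Balaban1983to89.Site P j)} {r : ℕ}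
    (hcol : Λ₁ ⊆ collarShrink r Λ₀) {Y : Finset (Balaban1983to89.Site P (j + 1))}
    (hY : ∀ y : Balaban1983to89.Site P (j + 1), block y ⊆ Λ₀ → y ∈ Y) {ρ : ℝ} (hρ : ρ + 3 * P.L ≤ r + 1) :
    ∀ x₀ ∈ Λ₁, ∀ x : Balaban1983to89.Site P j, (supDist x₀ x : ℝ) ≤ ρ →
      ∀ q : Balaban1983to89.Plaq P (j + 1), q.src = blockOf x → q ∈ starP Y := by
  intro x₀ hx₀ x hx q hq
  have hfar := (mem_collarShrink.1 (hcol hx₀)).2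
  -- every site within `3L − 1` of `x` lies in `Λ₀`
  have key : ∀ z : Balaban1983to89.Site P j, supDist x z ≤ 3 * P.L - 1 → z ∈ Λ₀ := by
    intro z hz
    by_contra hzΛ
    have h1 := hfar z hzΛ
    have h2 := supDist_triangle x₀ x z
    have hL := P.L_pos
    have h3 : (supDist x₀ x : ℝ) + (3 * P.L - 1 : ℕ) ≤ ρ + 3 * P.L - 1 := by
      rw [Nat.cast_sub (by omega)]; push_cast; linarith
    have h4 : ((r : ℕ) : ℝ) < (supDist x₀ z : ℕ) := by exact_mod_cast h1
    have h5 : ((supDist x₀ z : ℕ) : ℝ) ≤ (supDist x₀ x : ℕ) + (3 * P.L - 1 : ℕ) := by exact_mod_cast h2.trans (by omega)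
    linarith
  have hL := P.L_pos
  have hblk : ∀ y : Balaban1983to89.Site P (j + 1),
      (y = blockOf x ∨ (∃ μ, y = (blockOf x).shift μ) ∨ ∃ μ ν, y = ((blockOf x).shift μ).shift ν) → y ∈ Y := by
    intro y hy
    refine hY y fun z hz => key z ?_
    have hzb : blockOf z = y := by simpa [block] using hz
    rcases hy with rfl | ⟨μ, rfl⟩ | ⟨μ, ν, rfl⟩
    · exact (supDist_le_of_blockOf_eq hj hzb.symm).trans (by omega)
    · exact (supDist_le_of_blockOf_eq_shift hj hzb).trans (by omega)
    · exact supDist_le_of_blockOf_eq_shift_shift hj hzb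
  rw [mem_starP, hq]
  exact ⟨hblk _ (Or.inl rfl), hblk _ (Or.inr (Or.inl ⟨q.μ, rfl⟩)), hblk _ (Or.inr (Or.inl ⟨q.ν, rfl⟩)),
    hblk _ (Or.inr (Or.inr ⟨q.μ, q.ν, rfl⟩))⟩

/-- **(3.33), GAUGE-FIELD HALF, ON THE COLLAR-SHRUNK REGION** — gen 39's `BIJ88Small333GaugeField.small333_gauge_of_bound` with its located margin
READ OFF r18's `collarShrink` BY NAME: the bonds of `Λ₁*` start in `Λ₁ ⊆ collarShrink r Λ₀` with `R + 7L ≤ r` (print: `Λ₁^{(0)}` = `Λ₀^{(0)}`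
minus `r(e₀)`-cubes at the boundary, `R = ¼r(e₀)`), and `|f(q)| ≤ c₂p(e₀)` holds on `Y**` for a coarse region `Y` containing every block inside
`Λ₀`; then *"|A^{(0)}| ≦ cp(e₀) in Λ₁^{(0)*}"*: `|A^{(0)}_b| ≤ (c₁ + M·d(2(1+d/δ))^d·4d·c₂)·p(e₀)` on `Λ₁*`. [cite: BalabanImbrieJaffe1988, (3.33) p.270] -/
theorem small333_gauge_collar (hj : j + 1 ≤ P.m + P.K) (hd : 2 ≤ P.d) {M δ : ℝ} (hM : 0 ≤ M) (hδ : 0 < δ) {R : ℝ}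
    (hC : ∀ b b' : PBond P j, |Cloc P j R b b'| ≤ M * Real.exp (-(δ * distB P j b b')))
    {Λ₀ Λ₁ : Finset (Balaban1983to89.Site P j)} {r : ℕ} (hcol : Λ₁ ⊆ collarShrink r Λ₀) (hr : R + 7 * P.L ≤ r)
    {Λ₁s Λ₄s : Finset (PBond P j)} (hΛ₁ : Λ₁s ⊆ starB Λ₁) {Y : Finset (Balaban1983to89.Site P (j + 1))}
    (hY : ∀ y : Balaban1983to89.Site P (j + 1), block y ⊆ Λ₀ → y ∈ Y) {f : Balaban1983to89.Plaq P (j + 1) → ℝ}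
    {A0 : PBond P j → ℝ} {c₁ c₂ pe₀ : ℝ} (hpe : 0 ≤ pe₀) (hc₂ : 0 ≤ c₂)
    (hA' : SmallAPrime c₁ pe₀ Λ₁s (Aprime327 Λ₄s (P.L : ℝ) A0 ((Cloc P j R).mulVec (plaqDiv 1 ((torusEdgeCells P j hd).Qstar f)))))
    (hfY : ∀ q ∈ starP Y, |f q| ≤ c₂ * pe₀) :
    ∀ b ∈ Λ₁s, |A0 b| ≤ (c₁ + M * ((P.d : ℝ) * (2 * (1 + P.d / δ)) ^ P.d) * (4 * P.d) * c₂) * pe₀ :=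
  small333_gauge_of_bound hj hd hM hδ hC hpe hc₂ hA' hfY fun b hb _ x hx q hq =>
    margin_coarse_of_collarShrink hj hcol hY (ρ := R + 4 * P.L + 1) (by linarith) b.src ((mem_starB _ _).1 (hΛ₁ hb)).1 x hx q hq

end Gauge

/-! ## §5  (3.33), gauge-field half, FROM (3.15) BY NAME on the collar-shrunk region -/

section Gauge315

open Finset
open LatticeFieldCalculus (supDist)
open BIJ85Ineq722Torus (supDist_triangle)
open BIJ85Ineq723Torus (supDist_le_of_blockOf_eq)
open BIJ85TorusTentCutoff (supDist_shift_le_succ)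
open B3TorusRadialSums (supDist_eq_zero_iff)
open BIJ88RegionTower274 (collarShrink mem_collarShrink collarShrink_subset)
open BIJ88Sect3Statements (U1 toC cfg plaqVar fieldStrength starB starP mem_starB SmallField315)
open BIJ88Sect3Translations (Aprime327)
open BIJ88ClocEstimatesTorus (Cloc cloc_decay)
open BIJ88ClocFactorsTorus (distB)
open BIJ85Eq531Proof (plaqDiv)
open BIJ85CurlQsstar (torusEdgeCells)
open BIJ85Sect1Model (argB)
open BIJ88RenormTransf311 (DeltaAx)
open BIJ85BlockAveragesTorus (qU uPrime)
open GaugeField (plaqHol)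
open BIJ88SmallBlockFields332 (plaqSmall_of_smallField315)
open BIJ88Small333GaugeField (small333_gauge_of_plaquettes)

variable {P : Params} {j : ℕ}

/-- kernel: a plaquette based within `r − 2` of a site of `collarShrink r Λ₀` has all four corners in `Λ₀` (the corners are within sup-distance
`2` of the base). [cite: BalabanImbrieJaffe1988, (3.5) p.266] -/
theorem mem_starP_of_near_collarShrink {Λ₀ : Finset (Balaban1983to89.Site P j)} {r : ℕ} {x₀ : Balaban1983to89.Site P j}
    (hx₀ : x₀ ∈ collarShrink r Λ₀) (p : Balaban1983to89.Plaq P j) (hp : supDist x₀ p.src + 2 ≤ r) : p ∈ starP Λ₀ := by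
  have hfar := (mem_collarShrink.1 hx₀).2
  have key : ∀ z : Balaban1983to89.Site P j, supDist x₀ z ≤ supDist x₀ p.src + 2 → z ∈ Λ₀ := fun z hz => by
    by_contra h
    have := hfar z h
    omega
  have h1 : supDist x₀ (p.src.shift p.μ) ≤ supDist x₀ p.src + 2 := (supDist_shift_le_succ x₀ p.src p.μ).trans (by omega)
  have h2 : supDist x₀ (p.src.shift p.ν) ≤ supDist x₀ p.src + 2 := (supDist_shift_le_succ x₀ p.src p.ν).trans (by omega)
  have h3 : supDist x₀ ((p.src.shift p.μ).shift p.ν) ≤ supDist x₀ p.src + 2 :=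
    (supDist_shift_le_succ x₀ _ p.ν).trans (by have := supDist_shift_le_succ x₀ p.src p.μ; omega)
  exact mem_starP.2 ⟨key _ (by omega), key _ h1, key _ h2, key _ h3⟩

/-- kernel: nested collars — shrinking by `r + s` lands inside the `r`-shrink of the `s`-shrink. [cite: BalabanImbrieJaffe1988, (4.1) p.274] -/
theorem collarShrink_add_subset (r s : ℕ) (Λ₀ : Finset (Balaban1983to89.Site P j)) :
    collarShrink (r + s) Λ₀ ⊆ collarShrink r (collarShrink s Λ₀) := by
  intro x hx
  obtain ⟨hxΛ, hfar⟩ := mem_collarShrink.1 hx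
  refine mem_collarShrink.2 ⟨mem_collarShrink.2 ⟨hxΛ, fun y hy => lt_of_le_of_lt (Nat.le_add_left s r) (hfar y hy)⟩, fun z hz => ?_⟩
  -- if `z` were within `r` of `x` it would lie in the `s`-shrink
  refine lt_of_not_ge fun hle => hz (mem_collarShrink.2 ⟨?_, fun y hy => ?_⟩)
  · by_contra hzΛ
    have := hfar z hzΛ
    omega
  · have h1 := hfar y hy
    have h2 := supDist_triangle x z y
    omega

/-- **(3.33), GAUGE-FIELD HALF, FROM r18's TYPED (3.15) ON THE COLLAR-SHRUNK REGION** (print p. 269 *"From the restrictions on the fields, we have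
that u′_b = e^{ie₀A′_b}, with |A′_b| ≦ cp(e₀) in Λ₁^{(0)*}"*, p. 267 (3.15) *"|f^{(0)}(p)| ≦ p(e₀)"*, p. 270 (3.33)): for a `U(1)` field in the axial
gauge `δ_{Ax}` with r18's `SmallField315 pe₀ λ₀ Λ₀ Λ′ … (‖f^{(0)}‖)` (its fourth clause, read by p30's `plaqSmall_of_smallField315`:
`|arg u(∂p)| ≤ e₀p(e₀)` on `Λ₀**`), bonds `Λ₁s ⊆ Λ₁*` with `Λ₁ ⊆ collarShrink r Λ₀`, `0 ≤ R`, `R + 7L + 2 ≤ r` (print: `Λ₁^{(0)}` = `Λ₀^{(0)}` minus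
`r(e₀)`-cubes at the boundary), the coarse region `Y` = the blocks inside `collarShrink 2 Λ₀`, `17d²L²e₀p(e₀) < π`, and any `A^{(0)}` tied to
print's `A′ = arg(u′)/e₀` by (3.27) with the correction of record at `f = Re (ie₀)^{−1}log(Qu)(∂·)`: under `|C^{(0)}_{loc}(b,b′)| ≤ Me^{−δ|b−b′|_∞}`,
`|A^{(0)}_b| ≤ (6 + M·d(2(1+d/δ))^d·4d·17)d²L²·p(e₀)` on `Λ₁s` — gen-39's `small333_gauge_of_plaquettes` with `hεA`, `hεF`, `hmargin`
DISCHARGED. [cite: BalabanImbrieJaffe1988, (3.33) p.270] -/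
theorem small333_gauge_of_smallField315_collar (hj : j + 1 ≤ P.m + P.K) (hd : 2 ≤ P.d) {M δ : ℝ} (hM : 0 ≤ M) (hδ : 0 < δ) {R : ℝ}
    (hR : 0 ≤ R) (hC : ∀ b b' : PBond P j, |Cloc P j R b b'| ≤ M * Real.exp (-(δ * distB P j b b')))
    {U : GaugeField P j U1} (hU : DeltaAx U) {e₀ pe₀ lam₀ : ℝ} (he : 0 < e₀) (hpe : 0 ≤ pe₀)
    {Λ₀ Λ₁ : Finset (Balaban1983to89.Site P j)} {r : ℕ} (hcol : Λ₁ ⊆ collarShrink r Λ₀) (hr : R + 7 * P.L + 2 ≤ r)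
    {Λ' : Finset (Balaban1983to89.Site P (j + 1))} {Dφ : PBond P j → ℂ} {ψ Qφ : Balaban1983to89.Site P (j + 1) → ℂ}
    {φ : Balaban1983to89.Site P j → ℂ}
    (h315 : SmallField315 pe₀ lam₀ Λ₀ Λ' Dφ ψ Qφ φ (fun p => ‖fieldStrength e₀ (plaqVar (cfg U) p)‖))
    {Λ₁s : Finset (PBond P j)} (Λ₄s : Finset (PBond P j)) (hΛ₁ : Λ₁s ⊆ starB Λ₁) {Y : Finset (Balaban1983to89.Site P (j + 1))}
    (hY : ∀ y : Balaban1983to89.Site P (j + 1), y ∈ Y ↔ block y ⊆ collarShrink 2 Λ₀)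
    (hπ : 17 * (P.d : ℝ) ^ 2 * (P.L : ℝ) ^ 2 * (e₀ * pe₀) < Real.pi) (A0 : PBond P j → ℝ)
    (h327 : Aprime327 Λ₄s (P.L : ℝ) A0 ((Cloc P j R).mulVec (plaqDiv 1 ((torusEdgeCells P j hd).Qstar
        (fun q => (fieldStrength e₀ (toC (plaqHol (qU U) q))).re)))) = fun b => argB (toC (uPrime U b)) / e₀) :
    ∀ b ∈ Λ₁s, |A0 b| ≤ (6 * (P.d : ℝ) ^ 2 * (P.L : ℝ) ^ 2 +
      M * ((P.d : ℝ) * (2 * (1 + P.d / δ)) ^ P.d) * (4 * P.d) * (17 * (P.d : ℝ) ^ 2 * (P.L : ℝ) ^ 2)) * pe₀ := by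
  have hsmall := plaqSmall_of_smallField315 he h315
  have hL := P.L_pos
  have hrN : R + 7 * P.L + 2 ≤ (r : ℝ) := hr
  have hr7 : 7 * P.L + 2 ≤ r := by
    have : (7 * P.L + 2 : ℕ) ≤ (r : ℝ) := by push_cast; linarith
    exact_mod_cast this
  -- the plaquettes based in the two blocks at a bond of `Λ₁*` lie in `Λ₀**`
  have hεA : ∀ b ∈ Λ₁s, ∀ p : Balaban1983to89.Plaq P j,
      blockOf p.src = blockOf b.src ∨ blockOf p.src = (blockOf b.src).shift b.dir → |argB (toC (plaqHol U p))| ≤ e₀ * pe₀ := by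
    intro b hb p hp
    have hb1 : b.src ∈ Λ₁ := ((mem_starB _ _).1 (hΛ₁ hb)).1
    refine hsmall p (mem_starP_of_near_collarShrink (hcol hb1) p ?_)
    rcases hp with h | h
    · have := supDist_le_of_blockOf_eq hj h.symm; omega
    · have := supDist_le_of_blockOf_eq_shift hj h; omega
  -- the plaquettes based in the four blocks around a coarse plaquette of `Y**` lie in `Λ₀**`
  have hεF : ∀ q ∈ starP Y, ∀ p : Balaban1983to89.Plaq P j, blockOf p.src = q.src ∨ blockOf p.src = q.src.shift q.μ ∨
      blockOf p.src = q.src.shift q.ν ∨ blockOf p.src = (q.src.shift q.μ).shift q.ν → |argB (toC (plaqHol U p))| ≤ e₀ * pe₀ := by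
    intro q hq p hp
    have hq' : q.src ∈ Y ∧ q.src.shift q.μ ∈ Y ∧ q.src.shift q.ν ∈ Y ∧ (q.src.shift q.μ).shift q.ν ∈ Y := by
      simpa [starP] using hq
    have hin : p.src ∈ collarShrink 2 Λ₀ := by
      rcases hp with h | h | h | h
      · exact (hY _).1 hq'.1 (by simp [block, h])
      · exact (hY _).1 hq'.2.1 (by simp [block, h])
      · exact (hY _).1 hq'.2.2.1 (by simp [block, h])
      · exact (hY _).1 hq'.2.2.2 (by simp [block, h])
    exact hsmall p (mem_starP_of_near_collarShrink hin p (by rw [(supDist_eq_zero_iff p.src p.src).2 rfl]))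
  -- the located margin from the collar (§4), inside `collarShrink 2 Λ₀`
  have hcol' : Λ₁ ⊆ collarShrink (r - 2) (collarShrink 2 Λ₀) := by
    have h := collarShrink_add_subset (r - 2) 2 Λ₀
    rw [Nat.sub_add_cancel (by omega)] at h
    exact hcol.trans h
  have hmargin : ∀ b ∈ Λ₁s, b ∈ Λ₄s → ∀ x : Balaban1983to89.Site P j, (supDist b.src x : ℝ) ≤ R + 4 * P.L + 1 →
      ∀ q : Balaban1983to89.Plaq P (j + 1), q.src = blockOf x → q ∈ starP Y := fun b hb _ x hx q hq =>
    margin_coarse_of_collarShrink hj hcol' (fun y hy => (hY y).2 hy) (ρ := R + 4 * P.L + 1)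
      (by rw [Nat.cast_sub (by omega)]; push_cast; linarith) b.src ((mem_starB _ _).1 (hΛ₁ hb)).1 x hx q hq
  exact small333_gauge_of_plaquettes hj hd hM hδ hC hU he hpe Λ₁s Λ₄s Y hεA hεF hπ hmargin A0 h327

/-- **(3.33), GAUGE-FIELD HALF, FROM (3.15) BY NAME — UNIFORM CONSTANT AND PRINT'S REGIME**: there are `c = c(d, L) > 0` and, for every `c_p` and
`p`, `e* > 0` such that on every torus of these `(d, L)`, every `j + 1 ≤ m + K`, every `R ≥ 0`, every axial-gauge `U(1)` field with r18's
(3.15) on `Λ₀` (its fourth clause), every `Λ₁ ⊆ collarShrink r Λ₀` with `R + 7L + 2 ≤ r`, bonds `Λ₁s ⊆ Λ₁*`, `Y` = the blocks inside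
`collarShrink 2 Λ₀`, `0 < e₀ < e*`, `0 ≤ p(e₀) ≤ c_p|log e₀⁻¹|^p` ((2.33); this discharges `17d²L²e₀p(e₀) < π`), and any `A^{(0)}` tied to
`A′ = arg(u′)/e₀` by (3.27) with the correction of record: *"|A^{(0)}| ≦ cp(e₀) in Λ₁^{(0)*}"*, `∀ b ∈ Λ₁s, |A^{(0)}_b| ≤ c·p(e₀)`.
[cite: BalabanImbrieJaffe1988, (3.33) p.270] -/
theorem small333_gauge_of_smallField315_collar_regime (d L : ℕ) (hd : 2 ≤ d) (cp p : ℝ) :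
    ∃ c : ℝ, 0 < c ∧ ∃ estar : ℝ, 0 < estar ∧ ∀ (P : Params) (hPd : 2 ≤ P.d), P.d = d → P.L = L → ∀ (j : ℕ) (hj : j + 1 ≤ P.m + P.K)
      (R : ℝ), 0 ≤ R → ∀ (U : GaugeField P j U1), DeltaAx U → ∀ (e₀ pe₀ lam₀ : ℝ), 0 < e₀ → e₀ < estar → 0 ≤ pe₀ →
      pe₀ ≤ cp * pLog p e₀ →
      ∀ (Λ₀ Λ₁ : Finset (Balaban1983to89.Site P j)) (r : ℕ), Λ₁ ⊆ collarShrink r Λ₀ → R + 7 * L + 2 ≤ r →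
      ∀ (Λ' : Finset (Balaban1983to89.Site P (j + 1))) (Dφ : PBond P j → ℂ) (ψ Qφ : Balaban1983to89.Site P (j + 1) → ℂ)
      (φ : Balaban1983to89.Site P j → ℂ),
      SmallField315 pe₀ lam₀ Λ₀ Λ' Dφ ψ Qφ φ (fun p => ‖fieldStrength e₀ (plaqVar (cfg U) p)‖) →
      ∀ (Λ₁s Λ₄s : Finset (PBond P j)), Λ₁s ⊆ starB Λ₁ → ∀ (Y : Finset (Balaban1983to89.Site P (j + 1))),
      (∀ y : Balaban1983to89.Site P (j + 1), y ∈ Y ↔ block y ⊆ collarShrink 2 Λ₀) →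
      ∀ (A0 : PBond P j → ℝ), Aprime327 Λ₄s (L : ℝ) A0 ((Cloc P j R).mulVec (plaqDiv 1 ((torusEdgeCells P j hPd).Qstar
        (fun q => (fieldStrength e₀ (toC (plaqHol (qU U) q))).re)))) = (fun b => argB (toC (uPrime U b)) / e₀) →
      ∀ b ∈ Λ₁s, |A0 b| ≤ c * pe₀ := by
  obtain ⟨M', δ', hM', hδ', H⟩ := cloc_decay d L hd
  have hd0 : (0 : ℝ) < d := by exact_mod_cast (show 0 < d by omega)
  obtain ⟨estar, hstar, hreg⟩ := regime332 (17 * (d : ℝ) ^ 2 * (L : ℝ) ^ 2) 0 0 cp p (by positivity) le_rfl le_rfl one_pos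
  refine ⟨6 * (d : ℝ) ^ 2 * (L : ℝ) ^ 2 + M' * ((d : ℝ) * (2 * (1 + d / δ')) ^ d) * (4 * d) * (17 * (d : ℝ) ^ 2 * (L : ℝ) ^ 2) + 1,
    by positivity, estar, hstar, ?_⟩
  intro P hPd hP hPL j hj R hR0 U hU e₀ pe₀ lam₀ he hlt hpe hpcp Λ₀ Λ₁ r hcol hr Λ' Dφ ψ Qφ φ h315 Λ₁s Λ₄s hΛ₁ Y hY A0 h327 b hb
  have hC : ∀ u v : PBond P j, |Cloc P j R u v| ≤ M' * Real.exp (-(δ' * distB P j u v)) := fun u v => H P hP hPL j inferInstance hj R u v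
  obtain ⟨hπ, -, -⟩ := hreg e₀ he hlt pe₀ (e₀ ^ 2) hpcp (by rw [one_mul])
  subst hP hPL
  have hr' : R + 7 * (P.L : ℝ) + 2 ≤ r := by exact_mod_cast hr
  exact (small333_gauge_of_smallField315_collar hj hPd hM'.le hδ' hR0 hC hU he hpe hcol (by exact_mod_cast hr') h315 Λ₄s hΛ₁ hY hπ A0
    h327 b hb).trans (mul_le_mul_of_nonneg_right (le_add_of_nonneg_right zero_le_one) hpe)

end Gauge315

/-! ## §6  (3.32), the small block fields at print's `ū₁`, in print's regime (p30's theorem BY NAME) -/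

section Block332

open BIJ88Sect3Statements (U1 toC cfg covD plaqVar fieldStrength starB starP SmallField315 SmallBlock332)
open BIJ85Sect1Model (HiggsField)
open BIJ85BlockAveragesTorus (qU qCov)
open BIJ88Sect4Statements (barU)
open BIJ88RT51Background42 (bg42)
open BIJ88SecondTranslation327Torus (w327)
open LatticeFieldCalculus (supDist)
open B15DeterminingSets (embIter)
open BIJ88SmallBlockFields332Ubar (smallBlock332_u1bar_of_smallField315_of_smallF)
open BIJ88Sect5StatementsPart3 (SmallF)
open BIJ88ClocEstimatesTorus (Cloc cloc_decay)
open BIJ88ClocFactorsTorus (distB)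
open GaugeField (plaqHol)
open BIJ88Sect3Statements (mem_starB)
open BIJ85Ineq722Torus (supDist_triangle supDist_runSite_le)
open BIJ88RegionTower274 (collarShrink)
open Balaban1983to89.Site (blockOf_emb)

variable {P : Params}

/-- **THE LOCATED MARGIN OF (3.32) FROM THE COLLAR** (p. 267 *"by deleting r(e₀)-cubes at the boundary"*; r18's `collarShrink`): the
hypothesis `hmargin` of p30's `smallBlock332_u1bar_byName` — every coarse plaquette based at a block met within sup-distance `R + 4L + 1` of a site
`b′₋ + se_μ` (`s < L`) of the axial run from the centre of a block `b′₋ ∈ Λ′` lies in `Λ₀′**` — holds as soon as the blocks of `Λ′` lie in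
`Λ₁ ⊆ collarShrink r Λ_c` with `R + 8L ≤ r` and `Λ₀′` contains every block inside `Λ_c` (§4's `margin_coarse_of_collarShrink`; the centre
`embIter 1 b′₋ = emb b′₋` is in `B(b′₋)`, `blockOf_emb`; the run moves `≤ s ≤ L − 1`, `supDist_runSite_le`). [cite: BalabanImbrieJaffe1988, (3.32) p.270] -/
theorem margin332_of_collarShrink (h1 : 1 ≤ P.m + P.K) {Λc Λ₁ : Finset (Balaban1983to89.Site P 0)} {r : ℕ}
    (hcol : Λ₁ ⊆ collarShrink r Λc) {Λ' Λ₀' : Finset (Balaban1983to89.Site P 1)}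
    (hΛ' : ∀ x : Balaban1983to89.Site P 0, blockOf x ∈ Λ' → x ∈ Λ₁)
    (hY : ∀ y : Balaban1983to89.Site P 1, block y ⊆ Λc → y ∈ Λ₀') {R : ℝ} (hr : R + 8 * P.L ≤ r) :
    ∀ b' ∈ starB Λ', ∀ s < P.L, ∀ x : Balaban1983to89.Site P 0,
      (supDist (LatticeFieldCalculus.runSite (embIter 1 b'.src) b'.dir s) x : ℝ) ≤ R + 4 * P.L + 1 →
        ∀ q : Balaban1983to89.Plaq P 1, q.src = blockOf x → q ∈ starP Λ₀' := by
  intro b' hb' s hs x hx q hq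
  have h01 : 0 + 1 ≤ P.m + P.K := by simpa using h1
  have hsrc : b'.src ∈ Λ' := ((mem_starB _ _).1 hb').1
  have hemb : (embIter 1 b'.src : Balaban1983to89.Site P 0) = emb b'.src := rfl
  have hx₀ : embIter 1 b'.src ∈ Λ₁ := hΛ' _ (by rw [hemb, blockOf_emb h01]; exact hsrc)
  have hrun : supDist (embIter 1 b'.src) (LatticeFieldCalculus.runSite (embIter 1 b'.src) b'.dir s) ≤ s :=
    supDist_runSite_le _ _ _
  have htri := supDist_triangle (embIter 1 b'.src) (LatticeFieldCalculus.runSite (embIter 1 b'.src) b'.dir s) x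
  have hL := P.L_pos
  have hdist : (supDist (embIter 1 b'.src) x : ℝ) ≤ R + 5 * P.L := by
    have h1' : ((supDist (embIter 1 b'.src) x : ℕ) : ℝ) ≤ (s : ℝ) + supDist (LatticeFieldCalculus.runSite (embIter 1 b'.src) b'.dir s) x := by
      exact_mod_cast htri.trans (Nat.add_le_add_right hrun _)
    have hs' : (s : ℝ) ≤ P.L - 1 := by
      have : s + 1 ≤ P.L := hs
      have := (Nat.cast_le (α := ℝ)).2 this
      push_cast at this; linarith
    linarith
  exact margin_coarse_of_collarShrink h01 hcol hY (ρ := R + 5 * P.L) (by linarith) _ hx₀ x hdist q hq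

/-- **(3.32) AT PRINT'S `ū₁`, IN PRINT'S REGIME** — p30's `BIJ88SmallBlockFields332Ubar.smallBlock332_u1bar_of_smallField315_of_smallF` (the third
clause of (3.32) at `ū₁` with the correction of record; inputs: r18's (3.15) `SmallField315` on `Λ`, r16's `SmallF c₂ p(e₀) e₀ Λ₀′ v(∂·)` for
`v = Qu`, the located margins) with its kernel bound SUPPLIED by p09's `cloc_decay` and its three REGIME inequalities `17d²L²e₀p(e₀) < π`,
`2·17d²L²e₀p(e₀) ≤ λ₀^{1/4}`, `L·e₀(M·d(2(1+d/δ))^d·4d·c₂)p(e₀) ≤ λ₀^{1/4}` DISCHARGED: there is `e* > 0`, depending only on `(d, L, c₂, c_p, p, C_λ)`,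
such that the conclusion holds for `0 < e₀ < e*`, `p(e₀) ≤ c_p|log e₀⁻¹|^p` ((2.33)) and `e₀² ≤ C_λλ₀` (p. 266 *"e²/λ = O(1)"*); `λ₀ ≤ 1` as printed.
(p30's v1.1 `smallBlock332_u1bar_byName` discharges `SmallF` from (3.15) as well; compose with it once its olean is on the farm.)
[cite: BalabanImbrieJaffe1988, (3.32) p.270] -/
theorem smallBlock332_u1bar_of_smallF_regime (d L : ℕ) (hd : 2 ≤ d) (c₂ cp p : ℝ) (hc₂ : 0 ≤ c₂) {Cl : ℝ} (hCl : 0 < Cl) :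
    ∃ estar > 0, ∀ (P : Params), P.d = d → P.L = L → ∀ (h1 : 1 ≤ P.m + P.K) (hd' : 2 ≤ P.d) (R : ℝ) (U : GaugeField P 0 U1)
      {e₀ pe₀ lam₀ : ℝ}, 0 < e₀ → e₀ < estar → 0 ≤ pe₀ → pe₀ ≤ cp * pLog p e₀ → e₀ ^ 2 ≤ Cl * lam₀ → lam₀ ≤ 1 →
      ∀ {Λ : Finset (Balaban1983to89.Site P 0)} {Λ' : Finset (Balaban1983to89.Site P 1)},
      (∀ x : Balaban1983to89.Site P 0, blockOf x ∈ Λ' → x ∈ Λ) →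
      (∀ p : Balaban1983to89.Plaq P 0, blockOf p.src ∈ Λ' → p ∈ starP Λ) →
      ∀ {ψ : Balaban1983to89.Site P 1 → ℂ} {φ : HiggsField P 0} {c' : ℝ}, 0 ≤ c' → c' ≤ 1 →
      SmallField315 pe₀ lam₀ Λ Λ' (covD 1 (cfg U) φ) ψ (qCov U φ) φ (fun p => ‖fieldStrength e₀ (plaqVar (cfg U) p)‖) →
      ∀ (Λ₄s : Finset (PBond P 0)) {Λ₀' : Finset (Balaban1983to89.Site P 1)},
      SmallF c₂ pe₀ e₀ Λ₀' (fun q => toC (plaqHol (qU U) q)) →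
      (∀ b' ∈ starB Λ', ∀ s < P.L, ∀ x : Balaban1983to89.Site P 0,
        (supDist (LatticeFieldCalculus.runSite (embIter 1 b'.src) b'.dir s) x : ℝ) ≤ R + 4 * P.L + 1 →
          ∀ q : Balaban1983to89.Plaq P 1, q.src = blockOf x → q ∈ starP Λ₀') →
      SmallBlock332 (2 * (17 * (P.d : ℝ) ^ 2 * (P.L : ℝ) ^ 2)) e₀ pe₀ lam₀ Λ' (plaqVar (cfg (qU U))) ψ
        (covD c' (cfg (barU 1 (bg42 1 (w327 hd' R (P.L : ℝ) e₀ Λ₄s) (qU U)))) ψ) := by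
  obtain ⟨M', δ', hM', hδ', H⟩ := cloc_decay d L hd
  have hd0 : (0 : ℝ) < d := by exact_mod_cast (show 0 < d by omega)
  obtain ⟨estar, hstar, hreg⟩ := regime332 (17 * (d : ℝ) ^ 2 * (L : ℝ) ^ 2) (2 * (17 * (d : ℝ) ^ 2 * (L : ℝ) ^ 2))
    ((L : ℝ) * (M' * ((d : ℝ) * (2 * (1 + d / δ')) ^ d) * (4 * d) * c₂)) cp p (by positivity) (by positivity) (by positivity) hCl
  refine ⟨estar, hstar, ?_⟩
  intro P hP hPL h1 hd' R U e₀ pe₀ lam₀ he₀ hlt hpe hpcp hlam hlam1 Λ Λ' hΛ₁ hΛ₂ ψ φ c' hc0 hc1 h315 Λ₄s Λ₀' hF hmargin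
  obtain ⟨hπ, hsm, hsmC⟩ := hreg e₀ he₀ hlt pe₀ lam₀ hpcp hlam
  have hlam0 : 0 < lam₀ := by
    have : 0 < e₀ ^ 2 := by positivity
    nlinarith
  have hC : ∀ u v : PBond P 0, |Cloc P 0 R u v| ≤ M' * Real.exp (-(δ' * distB P 0 u v)) := fun u v =>
    H P hP hPL 0 inferInstance h1 R u v
  subst hP hPL
  exact smallBlock332_u1bar_of_smallField315_of_smallF h1 hd' hM'.le hδ' hC U he₀ hpe hlam0 hlam1 hπ hsm hΛ₁ hΛ₂ hc0 hc1 h315 Λ₄s hc₂ hF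
    hmargin (by
      calc (P.L : ℝ) * (e₀ * (M' * ((P.d : ℝ) * (2 * (1 + P.d / δ')) ^ P.d) * (4 * P.d) * c₂) * pe₀)
          = (P.L : ℝ) * (M' * ((P.d : ℝ) * (2 * (1 + P.d / δ')) ^ P.d) * (4 * P.d) * c₂) * (e₀ * pe₀) := by ring
        _ ≤ lam₀ ^ (1 / 4 : ℝ) := hsmC)

/-- **(3.32) AT PRINT'S `ū₁`, IN PRINT'S REGIME AND ON THE COLLAR** — `smallBlock332_u1bar_of_smallF_regime` with, in addition, the located margin
`hmargin` READ OFF r18's `collarShrink` (`margin332_of_collarShrink`): the blocks of `Λ′` lie in `Λ₁ ⊆ collarShrink r Λ_c`, `R + 8L ≤ r`, and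
`Λ₀′` contains every block inside `Λ_c`. [cite: BalabanImbrieJaffe1988, (3.32) p.270] -/
theorem smallBlock332_u1bar_of_smallF_collar_regime (d L : ℕ) (hd : 2 ≤ d) (c₂ cp p : ℝ) (hc₂ : 0 ≤ c₂) {Cl : ℝ} (hCl : 0 < Cl) :
    ∃ estar > 0, ∀ (P : Params), P.d = d → P.L = L → ∀ (h1 : 1 ≤ P.m + P.K) (hd' : 2 ≤ P.d) (R : ℝ) (U : GaugeField P 0 U1)
      {e₀ pe₀ lam₀ : ℝ}, 0 < e₀ → e₀ < estar → 0 ≤ pe₀ → pe₀ ≤ cp * pLog p e₀ → e₀ ^ 2 ≤ Cl * lam₀ → lam₀ ≤ 1 →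
      ∀ {Λ Λc Λ₁ : Finset (Balaban1983to89.Site P 0)} {r : ℕ} {Λ' Λ₀' : Finset (Balaban1983to89.Site P 1)},
      (∀ x : Balaban1983to89.Site P 0, blockOf x ∈ Λ' → x ∈ Λ) →
      (∀ p : Balaban1983to89.Plaq P 0, blockOf p.src ∈ Λ' → p ∈ starP Λ) →
      Λ₁ ⊆ collarShrink r Λc → (∀ x : Balaban1983to89.Site P 0, blockOf x ∈ Λ' → x ∈ Λ₁) →
      (∀ y : Balaban1983to89.Site P 1, block y ⊆ Λc → y ∈ Λ₀') → R + 8 * P.L ≤ r →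
      ∀ {ψ : Balaban1983to89.Site P 1 → ℂ} {φ : HiggsField P 0} {c' : ℝ}, 0 ≤ c' → c' ≤ 1 →
      SmallField315 pe₀ lam₀ Λ Λ' (covD 1 (cfg U) φ) ψ (qCov U φ) φ (fun p => ‖fieldStrength e₀ (plaqVar (cfg U) p)‖) →
      ∀ (Λ₄s : Finset (PBond P 0)), SmallF c₂ pe₀ e₀ Λ₀' (fun q => toC (plaqHol (qU U) q)) →
      SmallBlock332 (2 * (17 * (P.d : ℝ) ^ 2 * (P.L : ℝ) ^ 2)) e₀ pe₀ lam₀ Λ' (plaqVar (cfg (qU U))) ψ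
        (covD c' (cfg (barU 1 (bg42 1 (w327 hd' R (P.L : ℝ) e₀ Λ₄s) (qU U)))) ψ) := by
  obtain ⟨estar, hstar, H⟩ := smallBlock332_u1bar_of_smallF_regime d L hd c₂ cp p hc₂ hCl
  refine ⟨estar, hstar, ?_⟩
  intro P hP hPL h1 hd' R U e₀ pe₀ lam₀ he₀ hlt hpe hpcp hlam hlam1 Λ Λc Λ₁ r Λ' Λ₀' hΛ₁ hΛ₂ hcol hΛ' hY hr ψ φ c' hc0 hc1 h315 Λ₄s hF
  exact H P hP hPL h1 hd' R U he₀ hlt hpe hpcp hlam hlam1 hΛ₁ hΛ₂ hc0 hc1 h315 Λ₄s hF (margin332_of_collarShrink h1 hcol hΛ' hY hr)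

end Block332

/-! ## §7  (3.33), scalar-field half: print's regime AND the collar together -/

section ScalarCollar

open Finset Matrix
open BIJ88Sect3Statements (U1 cfg covD)
open BIJ85BlockAveragesTorus BIJ85BlockAveragesTorusK
open BIJ88NeumannPropagator227Torus (nOp)
open BIJ88DeltaLoc234Torus (qMatT)
open BIJ88Eq240FlatTorus (compress)
open BIJ88RandomWalk242 BIJ88Eq242Lattice BIJ88Ineq246Lattice B4Sect5CubeBounds
open BIJ88Eq242HiggsCovarianceTorus
open B4Sect5Proof (latticeConst)
open BIJ85Eq325Corrections (uOne)
open BIJ88RegionTower274 (collarShrink collarShrink_subset)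
open BIJ88Small333ScalarField (margin_of_subset_collarShrink)

/-- **(3.33), SCALAR-FIELD HALF, FROM (3.15) AS PRINTED, IN PRINT'S REGIME AND ON THE COLLAR-SHRUNK REGION** — `small333_scalar_of_smallField315_at_u_regime`
with the pointwise margin hypothesis REPLACED by `Λ₇ ⊆ collarShrink R Λ` (r18's `collarShrink`; gen-40 v1.1 §7 `margin_of_subset_collarShrink`), the
collar width `R ≥ κ·r(e₀)` ((2.3); print: `Λ₇^{(0)}` is reached from `Λ₀^{(0)}` by deleting `r(e₀)`-collars, p. 267). [cite: BalabanImbrieJaffe1988, (3.33) p.270] -/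
theorem small333_scalar_at_u_collar_regime (d : ℕ) (γ₀ c₀ : ℝ) {δ₀ : ℝ} (hδ : 0 < δ₀) {M : ℕ} (hM : 5 ≤ M)
    (c' cA cp p : ℝ) {κ κ' r C : ℝ} (hκ : 0 < κ) (hκ' : 0 < κ') (hr : 1 < r) (hC : 0 < C) :
    ∃ estar > 0, ∀ {P : Params}, P.d = d → ∀ {j : ℕ}, j + 1 ≤ P.m + P.K → ∀ {Λ : Finset (Balaban1983to89.Site P j)} {a L c e₀ : ℝ},
      0 ≤ a * L ^ (-(2 : ℤ)) → 0 ≤ cA → ∀ (U : GaugeField P j U1) (A0 : PBond P j → ℝ), BIJ88NeumannNoZeroModesTorus.IsBlockUnion 1 Λ →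
      0 < γ₀ → 0 ≤ c₀ → B4.Hyp56 (chartSet Λ) (reOp Λ (nOp (a * L ^ (-(2 : ℤ))) c (uOne U e₀ A0) 1 univ)) γ₀ c₀ δ₀ →
      IsUnit (compress Λ (nOp (a * L ^ (-(2 : ℤ))) c (uOne U e₀ A0) 1 univ)) → kR P.d 2 γ₀ c₀ δ₀ < M →
      thetaConst P.d 2 γ₀ c₀ δ₀ < M → thetaW P.d 2 γ₀ c₀ δ₀ M < 1 → ∀ (ρ : ℝ)
      (K : Matrix (Balaban1983to89.Site P j) (Balaban1983to89.Site P j) ℂ), (∀ x₁ ∈ Λ, ∀ x₂ ∉ Λ, K x₁ x₂ = 0) →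
      (∀ x₁ x₂ : ↥Λ, K x₁ x₂ =
        ⟨cLoc (ldist (N := 2) M) ρ (fun ω y₁ y₂ => latticeCw M (chartSet Λ) 2 (reOp Λ (nOp (a * L ^ (-(2 : ℤ))) c (uOne U e₀ A0) 1 univ))
              ω y₁ y₂) (idxEquiv Λ (x₁, 0)) (idxEquiv Λ (x₂, 0)),
         cLoc (ldist (N := 2) M) ρ (fun ω y₁ y₂ => latticeCw M (chartSet Λ) 2 (reOp Λ (nOp (a * L ^ (-(2 : ℤ))) c (uOne U e₀ A0) 1 univ))
              ω y₁ y₂) (idxEquiv Λ (x₁, 1)) (idxEquiv Λ (x₂, 0))⟩) →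
      ∀ {φ φ0 corr : Balaban1983to89.Site P j → ℂ} {ψ : Balaban1983to89.Site P (j + 1) → ℂ} {Λ₇ : Finset (Balaban1983to89.Site P j)} {R : ℕ},
      Λ₇ ⊆ collarShrink R Λ → φ = BIJ88Sect3Translations.phi330 Λ₇ a L φ0 corr →
      (∀ x ∈ Λ₇, corr x = (K *ᵥ ((qMatT (uOne U e₀ A0) 1)ᴴ *ᵥ ψ)) x) →
      ∀ {Λ₀ : Finset (Balaban1983to89.Site P j)} {Λ₀' : Finset (Balaban1983to89.Site P (j + 1))} {pe₀ lam₀ e₀' : ℝ}, 0 ≤ pe₀ →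
      ∀ {f0 : Balaban1983to89.Plaq P j → ℝ} {v : Balaban1983to89.Plaq P (j + 1) → ℂ} {Dψ : PBond P (j + 1) → ℂ},
      BIJ88Sect3Statements.SmallField315 pe₀ lam₀ Λ₀ Λ₀' (covD c (cfg U) φ) ψ (qMatT U 1 *ᵥ φ) φ f0 →
      BIJ88Sect3Statements.SmallBlock332 c' e₀' pe₀ lam₀ Λ₀' v ψ Dψ →
      (∀ b ∈ BIJ88Sect3Statements.starB Λ₀, |A0 b| ≤ cA * pe₀) →
      (∀ b : PBond P j, (b.src ∈ Λ ∨ b.tgt ∈ Λ) → b ∈ BIJ88Sect3Statements.starB Λ₀) →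
      (∀ y : Balaban1983to89.Site P (j + 1), blockK 1 y ⊆ Λ → y ∈ Λ₀') →
      0 < e₀ → e₀ < estar → e₀ ^ 2 ≤ C * lam₀ → κ * rLen r e₀ ≤ R → κ' * rLen r e₀ ≤ ρ - 3 → pe₀ ≤ cp * pLog p e₀ →
      ∀ x ∈ Λ₇, ‖φ0 x‖ ≤
        (2 * (2 ^ P.d * γ₀⁻¹ * (1 - thetaW P.d 2 γ₀ c₀ δ₀ M)⁻¹ * Real.exp (δ₀ / 4)) * latticeConst P.d (δ₀ / 8 / M)
              * (|c| * (2 * P.d) + a * L ^ (-(2 : ℤ)) * ((P.L : ℝ) ^ P.d)⁻¹) * (1 + |c| + P.d * (P.L - 1 : ℕ))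
          + 2 * (2 ^ P.d * γ₀⁻¹ * (1 - thetaW P.d 2 γ₀ c₀ δ₀ M)⁻¹ * Real.exp (δ₀ / 4)) * latticeConst P.d (δ₀ / 16 / M)
              * (|c| * (2 * P.d) * |c|)
          + a * L ^ (-(2 : ℤ)) * 2 * latticeConst P.d (δ₀ / 16 / M) * ((P.L : ℝ) ^ P.d)⁻¹) * pe₀ := by
  obtain ⟨estar, hstar, H⟩ := small333_scalar_of_smallField315_at_u_regime d γ₀ c₀ hδ hM c' cA cp p hκ hκ' hr hC
  refine ⟨estar, hstar, ?_⟩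
  intro P hPd j hj Λ a L c e₀ haL hcA U A0 hΛ hγ hc hA hU hMR hMθ hθW ρ K hK0 hKl φ φ0 corr ψ Λ₇ R h7c hφ hcorr Λ₀ Λ₀' pe₀ lam₀ e₀' hpe
    f0 v Dψ h315 h332 hA0 hB hY he₀ hlt hlam hRκ hρκ hpcp
  exact H hPd hj haL hcA U A0 hΛ hγ hc hA hU hMR hMθ hθW ρ K hK0 hKl (h7c.trans (collarShrink_subset R Λ)) hφ hcorr hpe h315 h332 hA0 hB hY
    (margin_of_subset_collarShrink h7c) he₀ hlt hlam hRκ hρκ hpcp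

end ScalarCollar

/-! ## §8  (v1.2) (3.33) AS ONE CONJUNCTION at the objects of record: (3.15) ⟹ `Small333 c p(e₀) Λ₇ A⁽⁰⁾ φ⁽⁰⁾` in print's regime on the collar tower -/

section Conj333

open Finset Matrix
open BIJ88Sect3Statements (U1 toC cfg covD plaqVar fieldStrength)
open BIJ85BlockAveragesTorus BIJ85BlockAveragesTorusK
open BIJ88NeumannPropagator227Torus (nOp)
open BIJ88DeltaLoc234Torus (qMatT qMatT_mulVec)
open BIJ88Eq240FlatTorus (compress)
open BIJ88RandomWalk242 BIJ88Eq242Lattice BIJ88Ineq246Lattice B4Sect5CubeBounds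
open BIJ88Eq242HiggsCovarianceTorus
open B4Sect5Proof (latticeConst)
open BIJ85Eq325Corrections (uOne)
open BIJ88RegionTower274 (collarShrink collarShrink_subset)
open BIJ88Sect3Translations (Aprime327)
open BIJ88SmallBlockFields332 (norm_psi_le_of_smallField315)
open BIJ88ClocEstimatesTorus (Cloc)
open BIJ85Eq531Proof (plaqDiv)
open BIJ85CurlQsstar (torusEdgeCells)
open BIJ85Sect1Model (argB)
open BIJ88RenormTransf311 (DeltaAx)
open GaugeField (plaqHol)

/-- **(3.33) AS ONE CONJUNCTION AT THE OBJECTS OF RECORD, FROM (3.15), IN PRINT'S REGIME ON THE COLLAR TOWER** — p. 270 [PDF 14]: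
*"Similarly, it can be shown that |A^{(0)}| ≦ cp(e₀) in Λ₁^{(0)*}, |φ^{(0)}| ≦ cp(e₀) in Λ₁^{(0)*}, (3.33) and we inse[r]t a factor
χ′_{Λ₇^{(0)}} enforcing these bounds in Λ₇^{(0)}"* — r18's typed predicate `Small333 c p(e₀) Λ₇ A^{(0)} φ^{(0)}` (gauge clause on `Λ₇*`,
scalar clause on `Λ₇`) with ONE constant `c > 0` and ONE threshold `e* > 0`, both depending only on the dimension `d`, the block size `L`,
the random-walk constants `(γ₀, c₀, δ₀, M)` of [6] (5.6), the exponents/margins `(c_p, p, r, κ, κ′, C)` of (2.3)/(2.33)/p. 266 and the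
coefficients `(a, L_r, c)` of the covariant operator `−Δ^c_{u₁} + aL_r^{−2}Q(u₁)*Q(u₁)` of (3.31) (print: `L_r = L`), such that on every torus
of these `(d, L)`: for every axial-gauge `U(1)` field `u` (`δ_{Ax}`, (3.11)) and fields `φ, ψ` with r18's (3.15)
`SmallField315 p(e₀) λ₀ Λ₀ Λ₀′ (D^c_uφ) ψ (Q(u)φ) φ |f^{(0)}|` AT THE OBJECTS OF RECORD on `(Λ₀, Λ₀′)` (ONE hypothesis; its bond, site and
plaquette clauses are all used) and (3.32) `SmallBlock332 c′ … Λ₀′ … ψ …` (its `ψ`-clause), every `A^{(0)}` tied to print's `A′ = arg(u′)/e₀`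
by (3.27) with p29's correction of record (`h327`, radius `R_g ≥ 0` of `C^{(0)}_{loc}`), the collar tower `Λ₁ ⊆ collarShrink r₁ Λ₀`
(`R_g + 7L + 2 ≤ r₁`; print p. 267: `Λ₁^{(0)}` = `Λ₀^{(0)}` minus `r(e₀)`-cubes at the boundary), the block union `Λ` of the Neumann operator
with every bond touching `Λ` in `Λ₁*` and every block inside `Λ` in `Λ₀′`, `Λ₇ ⊆ collarShrink R₇ Λ` with `R₇ ≥ κ·r(e₀)`, the localized
kernel `K = C_loc(ρ)` of `G(Λ, u₁)` at `u₁ = u·e^{−ie₀A^{(0)}}` (p11's `uOne`) with `ρ − 3 ≥ κ′·r(e₀)`, `φ = φ^{(0)} + aL_r^{−2}χ_{Λ₇}·corr`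
((3.30), `corr = K Q(u₁)*ψ` on `Λ₇`), and the regime `0 < e₀ < e*`, `e₀² ≤ Cλ₀` (p. 266 *"e²/λ = O(1)"*), `p(e₀) ≤ c_p|log e₀⁻¹|^p` ((2.33)):
**`Small333 c p(e₀) Λ₇ A^{(0)} φ^{(0)}`**, together with the gauge clause on the whole of `Λ₁*` as printed (*"in Λ₁^{(0)*}"*).
Assembly: §5 `small333_gauge_of_smallField315_collar_regime` gives `|A^{(0)}_b| ≤ c_g·p(e₀)` on ALL of `Λ₁*` (coarse region `Y` := the
blocks inside `collarShrink 2 Λ₀`, constructed here), which is exactly the input `hA0` of §7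
`small333_scalar_at_u_collar_regime` on `(Λ₁, Λ₀′)` ((3.15) restricted from `Λ₀` to `Λ₁ ⊆ Λ₀` — r18's `BIJ88SmallFieldPredicatesAPI.smallField315_mono`,
inlined); `Λ₇ ⊆ Λ ⊆ Λ₁` gives the gauge clause on `Λ₇* ⊆ Λ₁*`; `c = max(c_g, c_s)` as in r18's `small333_of_halves_subset` (inlined: that
module's olean was not yet built on the farm when this was filed).  The [6] (5.6)/`IsUnit` hypotheses on `G(Λ, u₁)` and the (3.32) input are
untouched (their discharges are p29's `BIJ88ScalarTranslation330Size` / p30's `BIJ88SmallBlockFields332Ubar`).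
[cite: BalabanImbrieJaffe1988, (3.33) p.270] [cite: BalabanImbrieJaffe1988, (3.15) p.267] -/
theorem small333_of_smallField315_collar_regime (d L : ℕ) (hd : 2 ≤ d) {γ₀ c₀ δ₀ : ℝ} (hγ : 0 < γ₀) (hc₀ : 0 ≤ c₀) (hδ : 0 < δ₀)
    {M : ℕ} (hM : 5 ≤ M) (hMR : kR d 2 γ₀ c₀ δ₀ < M) (hMθ : thetaConst d 2 γ₀ c₀ δ₀ < M) (hθW : thetaW d 2 γ₀ c₀ δ₀ M < 1)
    (c' cp p : ℝ) {κ κ' r C : ℝ} (hκ : 0 < κ) (hκ' : 0 < κ') (hr : 1 < r) (hC : 0 < C) {a Lr : ℝ} (haL : 0 ≤ a * Lr ^ (-(2 : ℤ)))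
    (c : ℝ) :
    ∃ c₃ : ℝ, 0 < c₃ ∧ ∃ estar : ℝ, 0 < estar ∧ ∀ (P : Params) (hPd : 2 ≤ P.d), P.d = d → P.L = L →
      ∀ {j : ℕ} (hj : j + 1 ≤ P.m + P.K) (Rg : ℝ), 0 ≤ Rg → ∀ {U : GaugeField P j U1}, DeltaAx U →
      ∀ {e₀ pe₀ lam₀ : ℝ}, 0 < e₀ → e₀ < estar → 0 ≤ pe₀ → pe₀ ≤ cp * pLog p e₀ → e₀ ^ 2 ≤ C * lam₀ →
      ∀ {Λ₀ Λ₁ Λ Λ₇ : Finset (Balaban1983to89.Site P j)} {r₁ R₇ : ℕ} {Λ₀' : Finset (Balaban1983to89.Site P (j + 1))},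
      Λ₁ ⊆ collarShrink r₁ Λ₀ → Rg + 7 * L + 2 ≤ r₁ →
      (∀ b : PBond P j, (b.src ∈ Λ ∨ b.tgt ∈ Λ) → b ∈ BIJ88Sect3Statements.starB Λ₁) →
      (∀ y : Balaban1983to89.Site P (j + 1), blockK 1 y ⊆ Λ → y ∈ Λ₀') →
      Λ₇ ⊆ collarShrink R₇ Λ → κ * rLen r e₀ ≤ R₇ →
      ∀ (A0 : PBond P j → ℝ), BIJ88NeumannNoZeroModesTorus.IsBlockUnion 1 Λ →
      B4.Hyp56 (chartSet Λ) (reOp Λ (nOp (a * Lr ^ (-(2 : ℤ))) c (uOne U e₀ A0) 1 univ)) γ₀ c₀ δ₀ →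
      IsUnit (compress Λ (nOp (a * Lr ^ (-(2 : ℤ))) c (uOne U e₀ A0) 1 univ)) → ∀ (ρ : ℝ)
      (K : Matrix (Balaban1983to89.Site P j) (Balaban1983to89.Site P j) ℂ), (∀ x₁ ∈ Λ, ∀ x₂ ∉ Λ, K x₁ x₂ = 0) →
      (∀ x₁ x₂ : ↥Λ, K x₁ x₂ =
        ⟨cLoc (ldist (N := 2) M) ρ (fun ω y₁ y₂ => latticeCw M (chartSet Λ) 2 (reOp Λ (nOp (a * Lr ^ (-(2 : ℤ))) c (uOne U e₀ A0) 1 univ))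
              ω y₁ y₂) (idxEquiv Λ (x₁, 0)) (idxEquiv Λ (x₂, 0)),
         cLoc (ldist (N := 2) M) ρ (fun ω y₁ y₂ => latticeCw M (chartSet Λ) 2 (reOp Λ (nOp (a * Lr ^ (-(2 : ℤ))) c (uOne U e₀ A0) 1 univ))
              ω y₁ y₂) (idxEquiv Λ (x₁, 1)) (idxEquiv Λ (x₂, 0))⟩) →
      κ' * rLen r e₀ ≤ ρ - 3 →
      ∀ {φ φ0 corr : Balaban1983to89.Site P j → ℂ} {ψ : Balaban1983to89.Site P (j + 1) → ℂ},
      φ = BIJ88Sect3Translations.phi330 Λ₇ a Lr φ0 corr → (∀ x ∈ Λ₇, corr x = (K *ᵥ ((qMatT (uOne U e₀ A0) 1)ᴴ *ᵥ ψ)) x) →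
      ∀ {e₀' : ℝ} {v : Balaban1983to89.Plaq P (j + 1) → ℂ} {Dψ : PBond P (j + 1) → ℂ},
      BIJ88Sect3Statements.SmallField315 pe₀ lam₀ Λ₀ Λ₀' (covD c (cfg U) φ) ψ (qMatT U 1 *ᵥ φ) φ
        (fun q => ‖fieldStrength e₀ (plaqVar (cfg U) q)‖) →
      BIJ88Sect3Statements.SmallBlock332 c' e₀' pe₀ lam₀ Λ₀' v ψ Dψ →
      ∀ (Λ₄s : Finset (PBond P j)),
      Aprime327 Λ₄s (L : ℝ) A0 ((Cloc P j Rg).mulVec (plaqDiv 1 ((torusEdgeCells P j hPd).Qstar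
        (fun q => (fieldStrength e₀ (toC (plaqHol (qU U) q))).re)))) = (fun b => argB (toC (uPrime U b)) / e₀) →
      (∀ b ∈ BIJ88Sect3Statements.starB Λ₁, |A0 b| ≤ c₃ * pe₀) ∧ BIJ88Sect3Statements.Small333 c₃ pe₀ Λ₇ A0 φ0 := by
  obtain ⟨cg, hcg, eg, heg, HG⟩ := small333_gauge_of_smallField315_collar_regime d L hd cp p
  obtain ⟨es, hes, HS⟩ := small333_scalar_at_u_collar_regime d γ₀ c₀ hδ hM c' cg cp p hκ hκ' hr hC
  refine ⟨max cg
      (2 * (2 ^ d * γ₀⁻¹ * (1 - thetaW d 2 γ₀ c₀ δ₀ M)⁻¹ * Real.exp (δ₀ / 4)) * latticeConst d (δ₀ / 8 / M)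
            * (|c| * (2 * d) + a * Lr ^ (-(2 : ℤ)) * ((L : ℝ) ^ d)⁻¹) * (1 + |c| + d * (L - 1 : ℕ))
        + 2 * (2 ^ d * γ₀⁻¹ * (1 - thetaW d 2 γ₀ c₀ δ₀ M)⁻¹ * Real.exp (δ₀ / 4)) * latticeConst d (δ₀ / 16 / M)
            * (|c| * (2 * d) * |c|)
        + a * Lr ^ (-(2 : ℤ)) * 2 * latticeConst d (δ₀ / 16 / M) * ((L : ℝ) ^ d)⁻¹),
    lt_max_of_lt_left hcg, min eg es, lt_min heg hes, ?_⟩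
  intro P hPd hP hPL j hj Rg hRg U hU e₀ pe₀ lam₀ he₀ hlt hpe hpcp hlam Λ₀ Λ₁ Λ Λ₇ r₁ R₇ Λ₀' hcol hr₁ hB hY h7c hR₇ A0 hΛ h56 hunit
    ρ K hK0 hKl hρ φ φ0 corr ψ hφ hcorr e₀' v Dψ h315 h332 Λ₄s h327
  subst hP hPL
  have hd0 : 0 < P.d := by omega
  -- `Λ ⊆ Λ₁` (every site of the block union starts a bond of `Λ₁*`), `Λ₇ ⊆ Λ`, `Λ₁ ⊆ Λ₀`
  have hΛΛ₁ : Λ ⊆ Λ₁ := fun x hx => ((BIJ88Sect3Statements.mem_starB _ _).1 (hB ⟨x, ⟨0, hd0⟩⟩ (Or.inl hx))).1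
  have h7Λ : Λ₇ ⊆ Λ := h7c.trans (collarShrink_subset R₇ Λ)
  have hΛ₁₀ : Λ₁ ⊆ Λ₀ := hcol.trans (collarShrink_subset r₁ Λ₀)
  have hmonoB : ∀ {X Y : Finset (Balaban1983to89.Site P j)}, X ⊆ Y →
      BIJ88Sect3Statements.starB X ⊆ BIJ88Sect3Statements.starB Y := fun hXY b hb => by
    rw [BIJ88Sect3Statements.mem_starB] at hb ⊢
    exact ⟨hXY hb.1, hXY hb.2⟩
  -- §5: the gauge-field half on ALL of `Λ₁*` (coarse region `Y` := the blocks inside `collarShrink 2 Λ₀`)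
  have hA0 : ∀ b ∈ BIJ88Sect3Statements.starB Λ₁, |A0 b| ≤ cg * pe₀ := by
    classical
    exact HG P hPd rfl rfl j hj Rg hRg U hU e₀ pe₀ lam₀ he₀ (hlt.trans_le (min_le_left _ _)) hpe hpcp Λ₀ Λ₁ r₁ hcol hr₁ Λ₀' _ _ _ _
      h315 _ Λ₄s subset_rfl (univ.filter fun y => Balaban1983to89.block y ⊆ collarShrink 2 Λ₀) (fun y => by simp) A0 h327
  -- (3.15) restricted from `Λ₀` to `Λ₁ ⊆ Λ₀` (r18's `smallField315_mono`, inlined)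
  have h315' : BIJ88Sect3Statements.SmallField315 pe₀ lam₀ Λ₁ Λ₀' (covD c (cfg U) φ) ψ (qMatT U 1 *ᵥ φ) φ
      (fun q => ‖fieldStrength e₀ (plaqVar (cfg U) q)‖) := by
    obtain ⟨hD, hQ, hφ', hf⟩ := h315
    refine ⟨fun b hb => hD b (hmonoB hΛ₁₀ hb), hQ, fun x hx => hφ' x (hΛ₁₀ hx), fun q hq => hf q ?_⟩
    rw [mem_starP] at hq ⊢
    exact ⟨hΛ₁₀ hq.1, hΛ₁₀ hq.2.1, hΛ₁₀ hq.2.2.1, hΛ₁₀ hq.2.2.2⟩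
  -- §7: the scalar-field half on `Λ₇`, fed with the gauge half as its `hA0`
  have hφ0 := HS rfl hj haL hcg.le U A0 hΛ hγ hc₀ h56 hunit hMR hMθ hθW ρ K hK0 hKl h7c hφ hcorr hpe h315' h332 hA0 hB hY he₀
    (hlt.trans_le (min_le_right _ _)) hlam hR₇ hρ hpcp
  refine ⟨fun b hb => ?_, fun b hb => ?_, fun x hx => (hφ0 x hx).trans (mul_le_mul_of_nonneg_right (le_max_right _ _) hpe)⟩
  · exact (hA0 b hb).trans (mul_le_mul_of_nonneg_right (le_max_left _ _) hpe)
  · exact (hA0 b (hmonoB (h7Λ.trans hΛΛ₁) hb)).trans (mul_le_mul_of_nonneg_right (le_max_left _ _) hpe)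

/-- **(3.33) FROM (3.15) ALONE** (p. 270: *"In the small field region Λ₀^{(0)} we have small block fields … |ψ(y)| ≦ cp(e₀)λ₀^{−1/4} … (3.32) …
Similarly, it can be shown that |A^{(0)}| ≦ cp(e₀) in Λ₁^{(0)*}, |φ^{(0)}| ≦ cp(e₀) … (3.33)"*): `small333_of_smallField315_collar_regime` with its
(3.32) input DISCHARGED — the only clause of (3.32) the scalar half uses, `|ψ(y)| ≤ c′p(e₀)λ₀^{−1/4}` on `Λ₀′`, follows from the second and third
clauses of (3.15) (p30's `BIJ88SmallBlockFields332.norm_psi_le_of_smallField315`: `c′ = 2`, for `0 < λ₀ ≤ 1`) once every block of `Λ₀′` lies in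
`Λ₀` (print: `Λ₀^{(0)′}` is the block-lattice region of `Λ₀^{(0)}`); the other two clauses are fed trivially (`v ≡ 1`, `D_{ū₁}ψ ≡ 0` — they do not
enter the scalar half).  Hypotheses left: r18's (3.15) at the objects of record (ONE hypothesis), the axial gauge, (3.27), the collar tower and
located margins, the [6] (5.6)/`IsUnit`/localized-kernel data of `G(Λ, u₁)`, and print's regime with `λ₀ ≤ 1`.
[cite: BalabanImbrieJaffe1988, (3.33) p.270] [cite: BalabanImbrieJaffe1988, (3.15) p.267] [cite: BalabanImbrieJaffe1988, (3.32) p.270] -/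
theorem small333_of_smallField315_only_collar_regime (d L : ℕ) (hd : 2 ≤ d) {γ₀ c₀ δ₀ : ℝ} (hγ : 0 < γ₀) (hc₀ : 0 ≤ c₀) (hδ : 0 < δ₀)
    {M : ℕ} (hM : 5 ≤ M) (hMR : kR d 2 γ₀ c₀ δ₀ < M) (hMθ : thetaConst d 2 γ₀ c₀ δ₀ < M) (hθW : thetaW d 2 γ₀ c₀ δ₀ M < 1)
    (cp p : ℝ) {κ κ' r C : ℝ} (hκ : 0 < κ) (hκ' : 0 < κ') (hr : 1 < r) (hC : 0 < C) {a Lr : ℝ} (haL : 0 ≤ a * Lr ^ (-(2 : ℤ)))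
    (c : ℝ) :
    ∃ c₃ : ℝ, 0 < c₃ ∧ ∃ estar : ℝ, 0 < estar ∧ ∀ (P : Params) (hPd : 2 ≤ P.d), P.d = d → P.L = L →
      ∀ {j : ℕ} (hj : j + 1 ≤ P.m + P.K) (Rg : ℝ), 0 ≤ Rg → ∀ {U : GaugeField P j U1}, DeltaAx U →
      ∀ {e₀ pe₀ lam₀ : ℝ}, 0 < e₀ → e₀ < estar → 0 ≤ pe₀ → pe₀ ≤ cp * pLog p e₀ → e₀ ^ 2 ≤ C * lam₀ → lam₀ ≤ 1 →
      ∀ {Λ₀ Λ₁ Λ Λ₇ : Finset (Balaban1983to89.Site P j)} {r₁ R₇ : ℕ} {Λ₀' : Finset (Balaban1983to89.Site P (j + 1))},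
      Λ₁ ⊆ collarShrink r₁ Λ₀ → Rg + 7 * L + 2 ≤ r₁ →
      (∀ b : PBond P j, (b.src ∈ Λ ∨ b.tgt ∈ Λ) → b ∈ BIJ88Sect3Statements.starB Λ₁) →
      (∀ y : Balaban1983to89.Site P (j + 1), blockK 1 y ⊆ Λ → y ∈ Λ₀') →
      (∀ x : Balaban1983to89.Site P j, blockOf x ∈ Λ₀' → x ∈ Λ₀) →
      Λ₇ ⊆ collarShrink R₇ Λ → κ * rLen r e₀ ≤ R₇ →
      ∀ (A0 : PBond P j → ℝ), BIJ88NeumannNoZeroModesTorus.IsBlockUnion 1 Λ →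
      B4.Hyp56 (chartSet Λ) (reOp Λ (nOp (a * Lr ^ (-(2 : ℤ))) c (uOne U e₀ A0) 1 univ)) γ₀ c₀ δ₀ →
      IsUnit (compress Λ (nOp (a * Lr ^ (-(2 : ℤ))) c (uOne U e₀ A0) 1 univ)) → ∀ (ρ : ℝ)
      (K : Matrix (Balaban1983to89.Site P j) (Balaban1983to89.Site P j) ℂ), (∀ x₁ ∈ Λ, ∀ x₂ ∉ Λ, K x₁ x₂ = 0) →
      (∀ x₁ x₂ : ↥Λ, K x₁ x₂ =
        ⟨cLoc (ldist (N := 2) M) ρ (fun ω y₁ y₂ => latticeCw M (chartSet Λ) 2 (reOp Λ (nOp (a * Lr ^ (-(2 : ℤ))) c (uOne U e₀ A0) 1 univ))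
              ω y₁ y₂) (idxEquiv Λ (x₁, 0)) (idxEquiv Λ (x₂, 0)),
         cLoc (ldist (N := 2) M) ρ (fun ω y₁ y₂ => latticeCw M (chartSet Λ) 2 (reOp Λ (nOp (a * Lr ^ (-(2 : ℤ))) c (uOne U e₀ A0) 1 univ))
              ω y₁ y₂) (idxEquiv Λ (x₁, 1)) (idxEquiv Λ (x₂, 0))⟩) →
      κ' * rLen r e₀ ≤ ρ - 3 →
      ∀ {φ φ0 corr : Balaban1983to89.Site P j → ℂ} {ψ : Balaban1983to89.Site P (j + 1) → ℂ},
      φ = BIJ88Sect3Translations.phi330 Λ₇ a Lr φ0 corr → (∀ x ∈ Λ₇, corr x = (K *ᵥ ((qMatT (uOne U e₀ A0) 1)ᴴ *ᵥ ψ)) x) →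
      BIJ88Sect3Statements.SmallField315 pe₀ lam₀ Λ₀ Λ₀' (covD c (cfg U) φ) ψ (qMatT U 1 *ᵥ φ) φ
        (fun q => ‖fieldStrength e₀ (plaqVar (cfg U) q)‖) →
      ∀ (Λ₄s : Finset (PBond P j)),
      Aprime327 Λ₄s (L : ℝ) A0 ((Cloc P j Rg).mulVec (plaqDiv 1 ((torusEdgeCells P j hPd).Qstar
        (fun q => (fieldStrength e₀ (toC (plaqHol (qU U) q))).re)))) = (fun b => argB (toC (uPrime U b)) / e₀) →
      (∀ b ∈ BIJ88Sect3Statements.starB Λ₁, |A0 b| ≤ c₃ * pe₀) ∧ BIJ88Sect3Statements.Small333 c₃ pe₀ Λ₇ A0 φ0 := by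
  obtain ⟨c₃, hc₃, estar, hstar, H⟩ :=
    small333_of_smallField315_collar_regime d L hd hγ hc₀ hδ hM hMR hMθ hθW 2 cp p hκ hκ' hr hC haL c
  refine ⟨c₃, hc₃, estar, hstar, ?_⟩
  intro P hPd hP hPL j hj Rg hRg U hU e₀ pe₀ lam₀ he₀ hlt hpe hpcp hlam hlam1 Λ₀ Λ₁ Λ Λ₇ r₁ R₇ Λ₀' hcol hr₁ hB hY hB₀ h7c hR₇ A0 hΛ h56
    hunit ρ K hK0 hKl hρ φ φ0 corr ψ hφ hcorr h315 Λ₄s h327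
  have hlam0 : 0 < lam₀ := by
    have : 0 < e₀ ^ 2 := by positivity
    nlinarith
  -- (3.15) with `Q(u)φ` in p11's form `qCov U φ` (`Q_1(u)` acts as `qCovK U 1 = qCov U`)
  have hQ : qMatT U 1 *ᵥ φ = qCov U φ := funext fun y => by rw [qMatT_mulVec]; rfl
  have h315q : BIJ88Sect3Statements.SmallField315 pe₀ lam₀ Λ₀ Λ₀' (covD c (cfg U) φ) ψ (qCov U φ) φ
      (fun q => ‖fieldStrength e₀ (plaqVar (cfg U) q)‖) := hQ ▸ h315
  -- the ψ-clause of (3.32) from (3.15); the `v`- and `D_{ū₁}ψ`-clauses are not used by the scalar half: feed `v ≡ 1`, `D ≡ 0`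
  have h332 : BIJ88Sect3Statements.SmallBlock332 2 e₀ pe₀ lam₀ Λ₀' (fun _ => 1) ψ (fun _ => 0) := by
    refine ⟨fun q _ => ?_, fun y hy => ?_, fun b _ => ?_⟩
    · rw [sub_self, norm_zero]; positivity
    · exact norm_psi_le_of_smallField315 hj hpe hlam0 hlam1 h315q hB₀ y hy
    · rw [norm_zero]; positivity
  exact H P hPd hP hPL hj Rg hRg hU he₀ hlt hpe hpcp hlam hcol hr₁ hB hY h7c hR₇ A0 hΛ h56 hunit ρ K hK0 hKl hρ hφ hcorr h315 h332 Λ₄s h327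

end Conj333

/-! ## §9  (v1.4) [6] (5.6) and invertibility of `(Δ + κP(u))|_Λ`, `(−Δ_u + κQ(u)*Q(u))|_Λ` for a field SMALL ON THE BLOCK UNION `Λ` ONLY -/

section LocalHyp56

open Finset Matrix
open BIJ88Sect3Statements (U1 toC starB mem_starB)
open BIJ85BlockAveragesTorus BIJ85BlockAveragesTorusK
open BIJ88NeumannNoZeroModesTorus (IsBlockUnion innerK mem_innerK)
open BIJ88NeumannPropagator227Torus (nOp)
open BIJ88Eq240FlatTorus (compress op240 c240 c240_pos ext0 ext0_of_not_mem ext0_coe star_dotProduct_compress re_form_op240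
  op240_isHermitian isUnit_compress_of_re_pos)
open BIJ88Eq242HiggsCovarianceTorus (chartSet reOp cdist hyp56_reOp norm_op240_apply_le_cdist)
open BIJ88ScalarTranslation330Torus (lapU nOp_univ_eq_op240 h238_lapU lapU_isHermitian)
open BIJ88ScalarTranslation330Size (norm_lapU_apply_le_cdist)
open BIJ88NeumannPropagatorSmallFieldRegion (coercive_region_poincare)

variable {P : Params} {j : ℕ}

/-- **THE BLOCK POINCARÉ STEP WITH THE SMALLNESS ASSUMED ON `Λ` ONLY** ([I] (7.3.2) p. 326 behind p. 264 *"by (2.38), C^{(k)}_Λ(u)^{−1} is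
bounded below"*): on `T^{(k)}` (`j + 1 ≤ m + K`) let `Λ` be a union of `L`-blocks and let the bond field `u` satisfy `‖u_b − 1‖ ≤ T` on the
bonds of `Λ*` lying inside one block and `‖u(Γ_{yx}) − 1‖ ≤ δ` for `x ∈ Λ` — NOTHING is assumed about `u` off `Λ`.  Then for every `φ`
supported in `Λ`: `(1 − (2(L−1)L·d·T² + 2δ²))Σ_x‖φ(x)‖² ≤ 2(L−1)L·Σ_b‖u_bφ(b₊) − φ(b₋)‖² + 2L^d·Σ_y‖(Q(u)φ)(y)‖²` — p34's regional Poincaré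
inequality `BIJ88NeumannPropagatorSmallFieldRegion.coercive_region_poincare` at `k = 1`, its right side enlarged to the full sums (p31's
`BIJ88Decay241SmallFieldTorus.sum_norm_sq_le_smallField` is the same with `hInt`/`hTree` on the whole torus). [cite: BalabanImbrieJaffe1985, (7.3.2) p.326] -/
theorem sum_norm_sq_le_smallField_on (hj : j + 1 ≤ P.m + P.K) {Λ : Finset (Balaban1983to89.Site P j)} (hΛ : IsBlockUnion 1 Λ)
    (U : GaugeField P j U1) {T δ : ℝ}
    (hInt : ∀ b ∈ starB Λ, blkIter 1 b.src = blkIter 1 b.tgt → ‖toC (U b) - 1‖ ≤ T)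
    (hTree : ∀ x ∈ Λ, ‖holCK U 1 x - 1‖ ≤ δ) (φ : Balaban1983to89.Site P j → ℂ) (hφ : ∀ x ∉ Λ, φ x = 0) :
    (1 - (2 * (((P.L : ℝ) - 1) * P.L) * P.d * T ^ 2 + 2 * δ ^ 2)) * ∑ x, ‖φ x‖ ^ 2 ≤
      2 * (((P.L : ℝ) - 1) * P.L) * ∑ b : PBond P j, ‖toC (U b) * φ b.tgt - φ b.src‖ ^ 2
        + 2 * (P.L : ℝ) ^ P.d * ∑ y, ‖qCovK U 1 φ y‖ ^ 2 := by
  have h := coercive_region_poincare (k := 1) hj hΛ U hInt hTree φ (fun x hx => hφ x hx)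
  simp only [pow_one, one_mul] at h
  have hL1 : (0 : ℝ) ≤ ((P.L : ℝ) - 1) * P.L := by
    have : (1 : ℝ) ≤ P.L := by exact_mod_cast P.L_pos
    nlinarith
  refine h.trans (add_le_add ?_ ?_)
  · exact mul_le_mul_of_nonneg_left (sum_le_univ_sum_of_nonneg fun _ => by positivity) (by positivity)
  · exact mul_le_mul_of_nonneg_left (sum_le_univ_sum_of_nonneg fun _ => by positivity) (by positivity)

/-- **THE LOWER BOUND OF p. 264 WITH THE SMALLNESS ON `Λ` ONLY** (*"by (2.38), C^{(k)}_Λ(u)^{−1} is bounded below"*): p31's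
`BIJ88Decay241SmallFieldTorus.lowerBound_op240_smallField` — `(c₀(γ,κ)(1 − σ) − E)‖φ‖² ≤ Re φᴴ(Δ + κP(u))φ` for `φ` supported in `Λ`, from the
PRINTED (2.38)-shape bound `γΣ_b|u(b)φ(b₊) − φ(b₋)|² − E‖φ‖² ≤ Re φᴴΔφ` on such `φ` — for a block union `Λ` and a bond field small on `Λ`
only (`‖u_b − 1‖ ≤ T` on the in-block bonds of `Λ*`, `‖u(Γ_{yx}) − 1‖ ≤ δ` on `Λ`, `2(L−1)L·d·T² + 2δ² ≤ σ`); same proof, the Poincaré step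
being `sum_norm_sq_le_smallField_on`. [cite: BalabanImbrieJaffe1988, (2.40) p.264] -/
theorem lowerBound_op240_smallField_on (hj : j + 1 ≤ P.m + P.K) {Λ : Finset (Balaban1983to89.Site P j)} (hΛ : IsBlockUnion 1 Λ)
    (U : GaugeField P j U1) {T δ σ : ℝ}
    (hInt : ∀ b ∈ starB Λ, blkIter 1 b.src = blkIter 1 b.tgt → ‖toC (U b) - 1‖ ≤ T)
    (hTree : ∀ x ∈ Λ, ‖holCK U 1 x - 1‖ ≤ δ)
    (hσ : 2 * (((P.L : ℝ) - 1) * P.L) * P.d * T ^ 2 + 2 * δ ^ 2 ≤ σ)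
    {Δ : Matrix (Balaban1983to89.Site P j) (Balaban1983to89.Site P j) ℂ} {γ E κ : ℝ} (hγ : 0 ≤ γ) (hκ : 0 ≤ κ)
    (h238 : ∀ φ : Balaban1983to89.Site P j → ℂ, (∀ x ∉ Λ, φ x = 0) →
      γ * ∑ b : PBond P j, ‖toC (U b) * φ b.tgt - φ b.src‖ ^ 2 - E * ∑ x, ‖φ x‖ ^ 2 ≤ (star φ ⬝ᵥ (Δ *ᵥ φ)).re)
    (φ : Balaban1983to89.Site P j → ℂ) (hφ : ∀ x ∉ Λ, φ x = 0) :
    (c240 P γ κ * (1 - σ) - E) * ∑ x, ‖φ x‖ ^ 2 ≤ (star φ ⬝ᵥ (op240 Δ κ U *ᵥ φ)).re := by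
  have hL2 : 2 ≤ P.L := P.hL.2
  have hL : (2 : ℝ) ≤ P.L := by exact_mod_cast hL2
  have hA : (0 : ℝ) < 2 * (((P.L : ℝ) - 1) * P.L) := by nlinarith
  have hB : (0 : ℝ) < 2 * (P.L : ℝ) ^ P.d := by positivity
  obtain ⟨Bf, hBf⟩ : ∃ x, x = ∑ b : PBond P j, ‖toC (U b) * φ b.tgt - φ b.src‖ ^ 2 := ⟨_, rfl⟩
  obtain ⟨Qf, hQf⟩ : ∃ x, x = ∑ y, ‖qCovK U 1 φ y‖ ^ 2 := ⟨_, rfl⟩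
  obtain ⟨N2, hN2⟩ : ∃ x, x = ∑ x, ‖φ x‖ ^ 2 := ⟨_, rfl⟩
  have hBf0 : 0 ≤ Bf := by rw [hBf]; positivity
  have hQf0 : 0 ≤ Qf := by rw [hQf]; positivity
  have hN0 : 0 ≤ N2 := by rw [hN2]; positivity
  have hP := sum_norm_sq_le_smallField_on hj hΛ U hInt hTree φ hφ
  rw [← hBf, ← hQf, ← hN2] at hP
  rw [re_form_op240, ← hQf, ← hN2]
  have h1 := h238 φ hφ
  rw [← hBf, ← hN2] at h1
  have hc1 : c240 P γ κ ≤ γ / (2 * (((P.L : ℝ) - 1) * P.L)) := min_le_left _ _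
  have hc2 : c240 P γ κ ≤ κ / (2 * (P.L : ℝ) ^ P.d) := min_le_right _ _
  have hc0 : 0 ≤ c240 P γ κ := le_min (div_nonneg hγ hA.le) (div_nonneg hκ hB.le)
  have hσ' : (1 - σ) * N2 ≤ (1 - (2 * (((P.L : ℝ) - 1) * P.L) * P.d * T ^ 2 + 2 * δ ^ 2)) * N2 :=
    mul_le_mul_of_nonneg_right (by linarith) hN0
  have key : c240 P γ κ * ((1 - σ) * N2) ≤ γ * Bf + κ * Qf := by
    calc c240 P γ κ * ((1 - σ) * N2) ≤ c240 P γ κ * (2 * (((P.L : ℝ) - 1) * P.L) * Bf + 2 * (P.L : ℝ) ^ P.d * Qf) :=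
          mul_le_mul_of_nonneg_left (hσ'.trans hP) hc0
      _ = c240 P γ κ * (2 * (((P.L : ℝ) - 1) * P.L)) * Bf + c240 P γ κ * (2 * (P.L : ℝ) ^ P.d) * Qf := by ring
      _ ≤ γ / (2 * (((P.L : ℝ) - 1) * P.L)) * (2 * (((P.L : ℝ) - 1) * P.L)) * Bf + κ / (2 * (P.L : ℝ) ^ P.d) * (2 * (P.L : ℝ) ^ P.d) * Qf :=
          add_le_add (mul_le_mul_of_nonneg_right (mul_le_mul_of_nonneg_right hc1 hA.le) hBf0)
            (mul_le_mul_of_nonneg_right (mul_le_mul_of_nonneg_right hc2 hB.le) hQf0)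
      _ = γ * Bf + κ * Qf := by rw [div_mul_cancel₀ _ hA.ne', div_mul_cancel₀ _ hB.ne']
  have e : (c240 P γ κ * (1 - σ) - E) * N2 = c240 P γ κ * ((1 - σ) * N2) - E * N2 := by ring
  rw [e]
  linarith

/-- **Strict positivity with the smallness on `Λ` only**: for `E < c₀(γ,κ)(1 − σ)` the form of `Δ + κP(u)` is STRICTLY positive on the
nonzero fields supported in the block union `Λ` (p31's `re_form_op240_smallField_pos`, localized). [cite: BalabanImbrieJaffe1988, (2.40) p.264] -/
theorem re_form_op240_smallField_pos_on (hj : j + 1 ≤ P.m + P.K) {Λ : Finset (Balaban1983to89.Site P j)} (hΛ : IsBlockUnion 1 Λ)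
    (U : GaugeField P j U1) {T δ σ : ℝ}
    (hInt : ∀ b ∈ starB Λ, blkIter 1 b.src = blkIter 1 b.tgt → ‖toC (U b) - 1‖ ≤ T)
    (hTree : ∀ x ∈ Λ, ‖holCK U 1 x - 1‖ ≤ δ)
    (hσ : 2 * (((P.L : ℝ) - 1) * P.L) * P.d * T ^ 2 + 2 * δ ^ 2 ≤ σ)
    {Δ : Matrix (Balaban1983to89.Site P j) (Balaban1983to89.Site P j) ℂ} {γ E κ : ℝ} (hγ : 0 ≤ γ) (hκ : 0 ≤ κ)
    (hE : E < c240 P γ κ * (1 - σ))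
    (h238 : ∀ φ : Balaban1983to89.Site P j → ℂ, (∀ x ∉ Λ, φ x = 0) →
      γ * ∑ b : PBond P j, ‖toC (U b) * φ b.tgt - φ b.src‖ ^ 2 - E * ∑ x, ‖φ x‖ ^ 2 ≤ (star φ ⬝ᵥ (Δ *ᵥ φ)).re)
    {φ : Balaban1983to89.Site P j → ℂ} (hφ : ∀ x ∉ Λ, φ x = 0) (hne : φ ≠ 0) :
    0 < (star φ ⬝ᵥ (op240 Δ κ U *ᵥ φ)).re := by
  have h := lowerBound_op240_smallField_on hj hΛ U hInt hTree hσ hγ hκ h238 φ hφ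
  have hpos : 0 < ∑ x, ‖φ x‖ ^ 2 := by
    obtain ⟨x, hx⟩ : ∃ x, φ x ≠ 0 := by
      by_contra hh; push Not at hh; exact hne (funext hh)
    exact lt_of_lt_of_le (by positivity : 0 < ‖φ x‖ ^ 2) (single_le_sum (f := fun x => ‖φ x‖ ^ 2) (fun _ _ => by positivity) (mem_univ x))
  nlinarith

/-- **(2.39)/(2.40) WITH THE SMALLNESS ON `Λ` ONLY: `C^{(k)}_Λ(u) = [(Δ + κQ(u)^*Q(u))|_Λ]^{−1}` EXISTS** — the compressed operator is
invertible on `ℓ²(Λ)` for a block union `Λ` and a bond field small on `Λ` only (p31's `isUnit_compress_op240_smallField`, localized; engine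
p31's `isUnit_compress_of_re_pos`). [cite: BalabanImbrieJaffe1988, (2.40) p.264] -/
theorem isUnit_compress_op240_smallField_on (hj : j + 1 ≤ P.m + P.K) {Λ : Finset (Balaban1983to89.Site P j)} (hΛ : IsBlockUnion 1 Λ)
    (U : GaugeField P j U1) {T δ σ : ℝ}
    (hInt : ∀ b ∈ starB Λ, blkIter 1 b.src = blkIter 1 b.tgt → ‖toC (U b) - 1‖ ≤ T)
    (hTree : ∀ x ∈ Λ, ‖holCK U 1 x - 1‖ ≤ δ)
    (hσ : 2 * (((P.L : ℝ) - 1) * P.L) * P.d * T ^ 2 + 2 * δ ^ 2 ≤ σ)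
    {Δ : Matrix (Balaban1983to89.Site P j) (Balaban1983to89.Site P j) ℂ} {γ E κ : ℝ} (hγ : 0 ≤ γ) (hκ : 0 ≤ κ)
    (hE : E < c240 P γ κ * (1 - σ))
    (h238 : ∀ φ : Balaban1983to89.Site P j → ℂ, (∀ x ∉ Λ, φ x = 0) →
      γ * ∑ b : PBond P j, ‖toC (U b) * φ b.tgt - φ b.src‖ ^ 2 - E * ∑ x, ‖φ x‖ ^ 2 ≤ (star φ ⬝ᵥ (Δ *ᵥ φ)).re) :
    IsUnit (compress Λ (op240 Δ κ U)) :=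
  isUnit_compress_of_re_pos fun _ hφ hne => re_form_op240_smallField_pos_on hj hΛ U hInt hTree hσ hγ hκ hE h238 hφ hne

/-- kernel: `Σ_x ‖(ext v)(x)‖² = Σ_{i∈Λ} ‖v_i‖²` (p31's private kernel, repeated). [folklore] -/
private theorem sum_norm_sq_ext0' {S : Type*} [Fintype S] [DecidableEq S] (Λ : Finset S) (v : ↥Λ → ℂ) :
    ∑ x, ‖ext0 Λ v x‖ ^ 2 = ∑ i : ↥Λ, ‖v i‖ ^ 2 := by
  have h1 : ∑ x, ‖ext0 Λ v x‖ ^ 2 = ∑ x ∈ Λ, ‖ext0 Λ v x‖ ^ 2 :=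
    (Finset.sum_subset (Finset.subset_univ Λ) fun x _ hx => by
      rw [ext0_of_not_mem v hx, norm_zero, zero_pow two_ne_zero]).symm
  rw [h1, ← Finset.sum_coe_sort Λ]
  exact Finset.sum_congr rfl fun i _ => by rw [ext0_coe]

/-- **The form of `(Δ + κP(u))|_Λ` is coercive on `ℓ²(Λ)` with the smallness on `Λ` only**: `(c₀(γ,κ)(1 − σ) − E)Σ_{i∈Λ}‖v_i‖² ≤
Re vᴴ(Δ + κP(u))|_Λv` (p31's `re_coercive_compress_smallField`, localized to a block union). [cite: BalabanImbrieJaffe1988, (2.40) p.264] -/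
theorem re_coercive_compress_smallField_on (hj : j + 1 ≤ P.m + P.K) {Λ : Finset (Balaban1983to89.Site P j)} (hΛ : IsBlockUnion 1 Λ)
    (U : GaugeField P j U1) {T δ σ : ℝ}
    (hInt : ∀ b ∈ starB Λ, blkIter 1 b.src = blkIter 1 b.tgt → ‖toC (U b) - 1‖ ≤ T)
    (hTree : ∀ x ∈ Λ, ‖holCK U 1 x - 1‖ ≤ δ)
    (hσ : 2 * (((P.L : ℝ) - 1) * P.L) * P.d * T ^ 2 + 2 * δ ^ 2 ≤ σ)
    {Δ : Matrix (Balaban1983to89.Site P j) (Balaban1983to89.Site P j) ℂ} {γ E κ : ℝ} (hγ : 0 ≤ γ) (hκ : 0 ≤ κ)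
    (h238 : ∀ φ : Balaban1983to89.Site P j → ℂ, (∀ x ∉ Λ, φ x = 0) →
      γ * ∑ b : PBond P j, ‖toC (U b) * φ b.tgt - φ b.src‖ ^ 2 - E * ∑ x, ‖φ x‖ ^ 2 ≤ (star φ ⬝ᵥ (Δ *ᵥ φ)).re)
    (v : ↥Λ → ℂ) :
    (c240 P γ κ * (1 - σ) - E) * ∑ i, ‖v i‖ ^ 2 ≤ (star v ⬝ᵥ (compress Λ (op240 Δ κ U) *ᵥ v)).re := by
  classical
  rw [star_dotProduct_compress, ← sum_norm_sq_ext0' Λ v]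
  exact lowerBound_op240_smallField_on hj hΛ U hInt hTree hσ hγ hκ h238 (ext0 Λ v) (fun x hx => ext0_of_not_mem v hx)

/-- **[6] (5.6) FOR `(Δ + κP(u))|_Λ` WITH THE SMALLNESS ON `Λ` ONLY** — p31's `BIJ88Eq242HiggsCovarianceTorus.hyp56_op240_smallField` for a
block union `Λ` and a bond field with `‖u_b − 1‖ ≤ T` on the in-block bonds of `Λ*`, `‖u(Γ_{yx}) − 1‖ ≤ δ` on `Λ`, `2(L−1)L·d·T² + 2δ² ≤ σ`
(nothing assumed off `Λ`): with the (2.38)-shape bound on the `Λ`-supported fields and the (2.36)-shape kernel bound on `Λ × Λ`, the charted real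
operator of `(Δ + κP(u))|_Λ` satisfies `B4.Hyp56` with `γ₀ = c₀(γ,κ)(1 − σ) − E`, `c₀ = c_Δ + κL^{−2d}e^{δ₀(L−1)}`, rate `δ₀` (p31's `hyp56_reOp`
and `norm_op240_apply_le_cdist` BY NAME). [cite: BalabanImbrieJaffe1988, (2.40) p.264] [cite: Balaban1983RegularityDecay, (5.6) p.594] -/
theorem hyp56_op240_smallField_on (hj : j + 1 ≤ P.m + P.K) {Λ : Finset (Balaban1983to89.Site P j)} (hΛ : IsBlockUnion 1 Λ)
    (U : GaugeField P j U1) {T δ σ : ℝ}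
    (hInt : ∀ b ∈ starB Λ, blkIter 1 b.src = blkIter 1 b.tgt → ‖toC (U b) - 1‖ ≤ T)
    (hTree : ∀ x ∈ Λ, ‖holCK U 1 x - 1‖ ≤ δ)
    (hσ : 2 * (((P.L : ℝ) - 1) * P.L) * P.d * T ^ 2 + 2 * δ ^ 2 ≤ σ)
    {Δ : Matrix (Balaban1983to89.Site P j) (Balaban1983to89.Site P j) ℂ} (hΔ : Δ.IsHermitian) {γ E κ : ℝ} (hγ : 0 ≤ γ) (hκ : 0 ≤ κ)
    (h238 : ∀ φ : Balaban1983to89.Site P j → ℂ, (∀ x ∉ Λ, φ x = 0) →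
      γ * ∑ b : PBond P j, ‖toC (U b) * φ b.tgt - φ b.src‖ ^ 2 - E * ∑ x, ‖φ x‖ ^ 2 ≤ (star φ ⬝ᵥ (Δ *ᵥ φ)).re)
    {cΔ δ₀ : ℝ} (hδ₀ : 0 ≤ δ₀)
    (hker : ∀ x₁ ∈ Λ, ∀ x₂ ∈ Λ, ‖Δ x₁ x₂‖ ≤ cΔ * Real.exp (-(δ₀ * cdist x₁ x₂))) :
    B4.Hyp56 (chartSet Λ) (reOp Λ (op240 Δ κ U)) (c240 P γ κ * (1 - σ) - E)
      (cΔ + κ * (((P.L : ℝ) ^ P.d)⁻¹) ^ 2 * Real.exp (δ₀ * ((P.L : ℝ) - 1))) δ₀ :=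
  hyp56_reOp ((op240_isHermitian hΔ κ U).submatrix _) (re_coercive_compress_smallField_on hj hΛ U hInt hTree hσ hγ hκ h238)
    fun x₁ h₁ x₂ h₂ => norm_op240_apply_le_cdist hj U hκ hδ₀ (hker x₁ h₁ x₂ h₂)

/-- **[6] (5.6) FOR THE CHARTED FIRST-STEP OPERATOR `(−Δ_u + κQ(u)*Q(u))|_Λ` WITH THE SMALLNESS ON `Λ` ONLY** — p29's
`BIJ88ScalarTranslation330Size.hyp56_nOp_univ_smallField` (p. 264 *"by (2.38), C^{(k)}_Λ(u)^{−1} is bounded below"* at the first step; the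
(2.38)-shape bound of `−Δ_u` is exact, `E = 0`) for a no-wrap block union `Λ` and a bond field with `‖u_b − 1‖ ≤ T` on the in-block bonds of
`Λ*` and `‖u(Γ_{yx}) − 1‖ ≤ δ` on `Λ` only: `B4.Hyp56 Λ′ (reOp Λ (−Δ_u + κQ*Q)) (c₂₄₀(c²,κ)(1−σ)) (4dc²e^{δ₀} + κL^{−2d}e^{δ₀(L−1)}) δ₀`.
[cite: BalabanImbrieJaffe1988, (2.40) p.264] [cite: Balaban1983RegularityDecay, (5.6) p.594] -/
theorem hyp56_nOp_univ_smallField_on (hj : j + 1 ≤ P.m + P.K) {Λ : Finset (Balaban1983to89.Site P j)} (hΛU : IsBlockUnion 1 Λ)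
    (U : GaugeField P j U1) {T δ σ : ℝ}
    (hInt : ∀ b ∈ starB Λ, blkIter 1 b.src = blkIter 1 b.tgt → ‖toC (U b) - 1‖ ≤ T)
    (hTree : ∀ x ∈ Λ, ‖holCK U 1 x - 1‖ ≤ δ)
    (hσ : 2 * (((P.L : ℝ) - 1) * P.L) * P.d * T ^ 2 + 2 * δ ^ 2 ≤ σ)
    (hΛ : ∀ b : PBond P j, b.src ∈ Λ → b.tgt ∈ Λ → cdist b.src b.tgt ≤ 1)
    (c : ℝ) {κ : ℝ} (hκ : 0 ≤ κ) {δ₀ : ℝ} (hδ₀ : 0 ≤ δ₀) :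
    B4.Hyp56 (chartSet Λ) (reOp Λ (nOp κ c U 1 univ)) (c240 P (c ^ 2) κ * (1 - σ) - 0)
      (4 * P.d * c ^ 2 * Real.exp δ₀ + κ * (((P.L : ℝ) ^ P.d)⁻¹) ^ 2 * Real.exp (δ₀ * ((P.L : ℝ) - 1))) δ₀ := by
  rw [nOp_univ_eq_op240]
  exact hyp56_op240_smallField_on hj hΛU U hInt hTree hσ (lapU_isHermitian c U) (sq_nonneg c) hκ (h238_lapU c U Λ) hδ₀
    fun x₁ h₁ x₂ h₂ => norm_lapU_apply_le_cdist c U hΛ hδ₀ h₁ h₂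

/-- **`(−Δ_u + κQ(u)*Q(u))|_Λ` IS INVERTIBLE WITH THE SMALLNESS ON `Λ` ONLY** (`σ < 1`, `κ > 0`, `c ≠ 0`; `Λ` a block union) — the existence
of the first-step propagator `C^{(0)}_Λ(u₁)` of (2.40)/(3.31): p29's `isUnit_compress_nOp_univ_smallField`, localized.
[cite: BalabanImbrieJaffe1988, (2.40) p.264] -/
theorem isUnit_compress_nOp_univ_smallField_on (hj : j + 1 ≤ P.m + P.K) {Λ : Finset (Balaban1983to89.Site P j)} (hΛU : IsBlockUnion 1 Λ)
    (U : GaugeField P j U1) {T δ σ : ℝ}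
    (hInt : ∀ b ∈ starB Λ, blkIter 1 b.src = blkIter 1 b.tgt → ‖toC (U b) - 1‖ ≤ T)
    (hTree : ∀ x ∈ Λ, ‖holCK U 1 x - 1‖ ≤ δ)
    (hσ : 2 * (((P.L : ℝ) - 1) * P.L) * P.d * T ^ 2 + 2 * δ ^ 2 ≤ σ) (hσ1 : σ < 1)
    {c : ℝ} (hc : c ≠ 0) {κ : ℝ} (hκ : 0 < κ) :
    IsUnit (compress Λ (nOp κ c U 1 univ)) := by
  rw [nOp_univ_eq_op240]
  have hE : (0 : ℝ) < c240 P (c ^ 2) κ * (1 - σ) := mul_pos (c240_pos P (by positivity) hκ) (by linarith)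
  exact isUnit_compress_op240_smallField_on hj hΛU U hInt hTree hσ (sq_nonneg c) hκ.le hE (h238_lapU c U Λ)

end LocalHyp56

/-! ## §10  (v1.4) The smallness of `u₁ = u·e^{−ie₀A⁽⁰⁾}` on a block union: axial gauge, the plaquettes of the blocks of `Λ`, `|A⁽⁰⁾| ≤ α` on `Λ*` -/

section SmallU1

open Finset
open BIJ88Sect3Statements (U1 toC starB mem_starB norm_toC)
open BIJ85BlockAveragesTorus BIJ85BlockAveragesTorusK
open BIJ88NeumannNoZeroModesTorus (IsBlockUnion)
open BIJ85Eq325Corrections (uOne toC_uOne)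
open BIJ85HolonomyDeviation (holCK_mul norm_mul_sub_one_le norm_prod_sub_one_le norm_toC_expU1_sub_one_le)
open BIJ85Sect1Model (argB)
open BIJ88Eq531SmallAPrime (interior_bound_bond exp_argB_mul_I_of_norm)
open BIJ88RenormTransf311 (DeltaAx inBlock)
open GaugeField (plaqHol)

variable {P : Params} {j : ℕ}

/-- kernel: `y + e_μ ≠ y` on every torus of the series (`2L^{m+K−j} ≥ 2` sites a direction). [folklore] -/
private theorem shift_ne_self' {k : ℕ} (y : Balaban1983to89.Site P k) (μ : Fin P.d) : y.shift μ ≠ y := by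
  intro h
  have h1 := congrFun h μ
  simp only [Balaban1983to89.Site.shift, Function.update_self] at h1
  exact one_ne_zero (add_eq_left.1 h1)

/-- kernel: **a bond inside a block does not cross**: `blockOf b₋ = blockOf b₊` excludes the surface bonds (a crossing bond joins adjacent blocks,
the tree's `blockOf_tgt_of_isCross`, and no block is its own neighbour). [cite: BalabanImbrieJaffe1985, (2.15) p.304] -/
theorem not_isCross_of_blkIter_eq (hj : j + 1 ≤ P.m + P.K) {b : PBond P j} (hb : blkIter 1 b.src = blkIter 1 b.tgt) : ¬ IsCross b := by
  intro hc
  have h := blockOf_tgt_of_isCross hj hc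
  simp only [blkIter_succ, blkIter_zero] at hb
  rw [← hb] at h
  exact shift_ne_self' _ _ h.symm

/-- kernel: `‖z − 1‖ ≤ |argB z|` on the unit circle (`z = e^{i·argB z}`, `|e^{iθ} − 1| ≤ |θ|`). [folklore] -/
private theorem norm_sub_one_le_abs_argB {z : ℂ} (hz : ‖z‖ = 1) : ‖z - 1‖ ≤ |argB z| := by
  have h := Real.norm_exp_I_mul_ofReal_sub_one_le (x := argB z)
  rw [Real.norm_eq_abs, mul_comm, exp_argB_mul_I_of_norm hz] at h
  exact h

/-- **`‖u₁(b) − 1‖ ≤ ‖u(b) − 1‖ + |eA_b|`** for `u₁ = u·e^{−ieA}` (p11's `uOne` = [I] (3.21) *"u^{(1)} = u exp(−ie(ε)A)"*; the field at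
which §3/§7/§8 take the first-step covariance `G(Λ, u₁)` of (3.31)). [cite: BalabanImbrieJaffe1985, (3.21) p.308] -/
theorem norm_toC_uOne_sub_one_le (U : GaugeField P j U1) (e : ℝ) (A : PBond P j → ℝ) (b : PBond P j) :
    ‖toC (uOne U e A b) - 1‖ ≤ ‖toC (U b) - 1‖ + |e * A b| := by
  have h := Real.norm_exp_I_mul_ofReal_sub_one_le (x := -(e * A b))
  rw [Real.norm_eq_abs, abs_neg, mul_comm Complex.I, Complex.ofReal_neg] at h
  rw [toC_uOne]
  refine (norm_mul_sub_one_le _ _).trans ?_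
  rw [norm_toC, one_mul, add_comm]
  exact add_le_add le_rfl h

/-- **THE IN-BLOCK BONDS OF `u₁` FROM THE PLAQUETTES, IN THE AXIAL GAUGE** (p. 280 *"Using the restrictions |u(p) − 1| ≦ e_kp(e_k) … and the
axial gauge conditions"*; p31's `interior_bound_bond`: `|arg u_b| ≤ (d−1)(L−1)ε` for a bond inside a block whose plaquettes have
`|arg u(∂p)| ≤ ε`, `(d−1)(L−1)ε < π`): `‖u₁(b) − 1‖ ≤ (d−1)(L−1)ε + |eA_b|`. [cite: BalabanImbrieJaffe1988, (5.3.1) p.280] -/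
theorem norm_toC_uOne_sub_one_le_of_plaquettes (hj : j + 1 ≤ P.m + P.K) {U : GaugeField P j U1} (hU : DeltaAx U) {ε : ℝ} (hε₀ : 0 ≤ ε)
    (hπ : (((P.d - 1) * (P.L - 1) : ℕ) : ℝ) * ε < Real.pi) {b : PBond P j} (hb : blkIter 1 b.src = blkIter 1 b.tgt)
    (hε : ∀ p : Balaban1983to89.Plaq P j, blockOf p.src = blockOf b.src → |argB (toC (plaqHol U p))| ≤ ε)
    (e : ℝ) (A : PBond P j → ℝ) :
    ‖toC (uOne U e A b) - 1‖ ≤ (((P.d - 1) * (P.L - 1) : ℕ) : ℝ) * ε + |e * A b| :=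
  (norm_toC_uOne_sub_one_le U e A b).trans (add_le_add
    ((norm_sub_one_le_abs_argB (norm_toC _)).trans (interior_bound_bond hj hU hε₀ (not_isCross_of_blkIter_eq hj hb) hε hπ)) le_rfl)

/-- **IN THE AXIAL GAUGE THE TREE TRANSPORT OF `u₁` IS THE TRANSPORT OF THE PHASE FIELD**: `u₁(Γ_{yx}) = Π_{b∈Γ_{yx}} e^{−ieA_b}`
(`u(Γ_{yx}) = 1`, p11's `holC_of_deltaAx`; `U(1)` is abelian, p11's `holCK_mul`). [cite: BalabanImbrieJaffe1985, (2.6) p.303] -/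
theorem holCK_uOne_of_deltaAx (hj : j + 1 ≤ P.m + P.K) {U : GaugeField P j U1} (hU : DeltaAx U) (e : ℝ) (A : PBond P j → ℝ)
    (x : Balaban1983to89.Site P j) : holCK (uOne U e A) 1 x = holC (fun b => expU1 (-(e * A b))) x := by
  have h := holCK_mul U (fun b => expU1 (-(e * A b))) 1 x
  rw [holCK_one, holCK_one, holCK_one, holC_of_deltaAx hj hU x, one_mul] at h
  rw [holCK_one]
  exact h

/-- **`‖u(Γ_{yx}) − 1‖ ≤ d(L−1)T` FROM THE LEG BONDS OF `x` ONLY** (p11's `BIJ85HolonomyDeviation.norm_holC_sub_one_le` assumes `‖u_b − 1‖ ≤ T`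
on every bond of the torus; the contour `Γ_{yx}` has `Σ_μ n_μ ≤ d(L−1)` bonds, p11's `legBond x μ t`, `t < n_μ`).
[cite: BalabanImbrieJaffe1985, (2.6) p.303] -/
theorem norm_holC_sub_one_le_on {U : GaugeField P j U1} {T : ℝ} (hT : 0 ≤ T) (z : Balaban1983to89.Site P j)
    (hU : ∀ μ : Fin P.d, ∀ t < inBlock z μ, ‖toC (U (legBond z μ t)) - 1‖ ≤ T) :
    ‖holC U z - 1‖ ≤ P.d * ((P.L : ℝ) - 1) * T := by
  unfold holC
  have hleg : ∀ μ, ‖legProd U z μ - 1‖ ≤ ((P.L : ℝ) - 1) * T := fun μ => by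
    unfold legProd
    refine (norm_prod_sub_one_le _ _ fun t _ => norm_toC _).trans ?_
    have hn : (inBlock z μ : ℝ) ≤ (P.L : ℝ) - 1 := by
      have h := Nat.mod_lt ((z μ).val) P.L_pos
      have h' : (inBlock z μ : ℝ) + 1 ≤ P.L := by
        unfold inBlock; exact_mod_cast h
      linarith
    calc ∑ t ∈ range (inBlock z μ), ‖toC (U (legBond z μ t)) - 1‖ ≤ ∑ _t ∈ range (inBlock z μ), T :=
          sum_le_sum fun t ht => hU μ t (mem_range.1 ht)
      _ = (inBlock z μ : ℝ) * T := by rw [sum_const, card_range, nsmul_eq_mul]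
      _ ≤ ((P.L : ℝ) - 1) * T := mul_le_mul_of_nonneg_right hn hT
  have hnorm : ∀ μ ∈ (univ : Finset (Fin P.d)), ‖legProd U z μ‖ = 1 := fun μ _ => by
    unfold legProd; rw [norm_prod]; exact prod_eq_one fun t _ => norm_toC _
  refine (norm_prod_sub_one_le _ _ hnorm).trans ?_
  calc ∑ μ : Fin P.d, ‖legProd U z μ - 1‖ ≤ ∑ _μ : Fin P.d, ((P.L : ℝ) - 1) * T := sum_le_sum fun μ _ => hleg μ
    _ = P.d * ((P.L : ℝ) - 1) * T := by rw [sum_const, card_univ, Fintype.card_fin, nsmul_eq_mul, mul_assoc]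

/-- kernel: **the bonds of `Γ_{yx}` lie in `Λ*`** for a block union `Λ ∋ x` (the legs stay in the block of `x`, p11's `blockOf_legSite`).
[cite: BalabanImbrieJaffe1985, (2.4) p.302] -/
theorem legBond_mem_starB (hj : j + 1 ≤ P.m + P.K) {Λ : Finset (Balaban1983to89.Site P j)} (hΛ : IsBlockUnion 1 Λ)
    {x : Balaban1983to89.Site P j} (hx : x ∈ Λ) (μ : Fin P.d) {t : ℕ} (ht : t < inBlock x μ) : legBond x μ t ∈ starB Λ := by
  have hL : inBlock x μ < P.L := Nat.mod_lt _ P.L_pos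
  have hsub : blockK 1 (blkIter 1 x) ⊆ Λ := hΛ x hx
  have key : ∀ s : ℕ, s < P.L → legSite x μ s ∈ Λ := fun s hs => by
    refine hsub (mem_blockK.2 ?_)
    simp only [blkIter_succ, blkIter_zero]
    exact blockOf_legSite hj x μ ⟨s, hs⟩
  rw [mem_starB]
  refine ⟨key t (by omega), ?_⟩
  rw [legBond_tgt]
  exact key (t + 1) (by omega)

/-- **THE TREE TRANSPORTS OF `u₁` ON A BLOCK UNION, IN THE AXIAL GAUGE**: if `|A_b| ≤ α` on `Λ*` then `‖u₁(Γ_{yx}) − 1‖ ≤ d(L−1)·|e|α` for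
every `x ∈ Λ` (`u₁ = u·e^{−ieA}`, `δ_{Ax}(u)`). [cite: BalabanImbrieJaffe1985, (2.6) p.303] -/
theorem norm_holCK_uOne_sub_one_le (hj : j + 1 ≤ P.m + P.K) {U : GaugeField P j U1} (hU : DeltaAx U)
    {Λ : Finset (Balaban1983to89.Site P j)} (hΛ : IsBlockUnion 1 Λ) {e α : ℝ} (hα : 0 ≤ α) {A : PBond P j → ℝ}
    (hA : ∀ b ∈ starB Λ, |A b| ≤ α) {x : Balaban1983to89.Site P j} (hx : x ∈ Λ) :
    ‖holCK (uOne U e A) 1 x - 1‖ ≤ P.d * ((P.L : ℝ) - 1) * (|e| * α) := by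
  rw [holCK_uOne_of_deltaAx hj hU e A x]
  refine norm_holC_sub_one_le_on (by positivity) x fun μ t ht => ?_
  refine (norm_toC_expU1_sub_one_le _).trans ?_
  rw [abs_neg, abs_mul]
  exact mul_le_mul_of_nonneg_left (hA _ (legBond_mem_starB hj hΛ hx μ ht)) (abs_nonneg e)

end SmallU1

/-! ## §11  (v1.4) (3.33) FROM (3.15) with the [6] (5.6)/invertibility hypotheses on `G(Λ, u₁)` DISCHARGED on a no-wrap block union -/

section Conj333NoWrap

open Finset Matrix
open BIJ88Sect3Statements (U1 toC cfg covD plaqVar fieldStrength starB starP mem_starB)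
open BIJ85BlockAveragesTorus BIJ85BlockAveragesTorusK
open BIJ88NeumannNoZeroModesTorus (IsBlockUnion)
open BIJ88NeumannPropagator227Torus (nOp)
open BIJ88DeltaLoc234Torus (qMatT)
open BIJ88Eq240FlatTorus (compress c240 c240_pos)
open BIJ88RandomWalk242 BIJ88Eq242Lattice BIJ88Ineq246Lattice B4Sect5CubeBounds
open BIJ88Eq242HiggsCovarianceTorus
open B4Sect5Proof (latticeConst)
open BIJ85Eq325Corrections (uOne)
open BIJ88RegionTower274 (collarShrink collarShrink_subset)
open BIJ88Sect3Translations (Aprime327)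
open BIJ88ClocEstimatesTorus (Cloc)
open BIJ85Eq531Proof (plaqDiv)
open BIJ85CurlQsstar (torusEdgeCells)
open BIJ85Sect1Model (argB)
open BIJ88RenormTransf311 (DeltaAx)
open GaugeField (plaqHol)
open BIJ85Ineq723Torus (supDist_le_of_blockOf_eq)
open BIJ88SmallBlockFields332 (plaqSmall_of_smallField315)

variable {P : Params} {j : ℕ}

/-- kernel: [6] (5.6) is monotone in its constants — a smaller coercivity constant and a larger kernel prefactor are still (5.6).
[cite: Balaban1983RegularityDecay, (5.6) p.594] -/
private theorem hyp56_mono' {dd N : ℕ} {Ω : Finset (Fin dd → ℤ)} {A : Matrix (B4.Idx Ω N) (B4.Idx Ω N) ℝ} {γ γ' c₀ c₀' δ : ℝ}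
    (h : B4.Hyp56 Ω A γ c₀ δ) (hγ : γ' ≤ γ) (hc : c₀ ≤ c₀') : B4.Hyp56 Ω A γ' c₀' δ := by
  obtain ⟨h1, h2, h3⟩ := h
  exact ⟨h1, fun v => (mul_le_mul_of_nonneg_right hγ (sum_nonneg fun p _ => sq_nonneg _)).trans (h2 v),
    fun p q => (h3 p q).trans (mul_le_mul_of_nonneg_right hc (Real.exp_pos _).le)⟩

/-- **THE REGIME OF THE SMALLNESS OF `u₁` ON `Λ`** ((2.33) p. 263, p. 266): for prefactors `K₁, K₂ ≥ 0` and any `c_p`, `p` there is `e* > 0`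
such that for `0 < e₀ < e*` and `0 ≤ p(e₀) ≤ c_p|log e₀⁻¹|^p`: `K₁·e₀p(e₀) < π` and `K₂·(e₀p(e₀))² ≤ ½` — the hypotheses `(d−1)(L−1)ε < π`
of p31's `interior_bound_bond` and `2(L−1)L·d·T² + 2δ² ≤ ½` of §9 at `ε = e₀p(e₀)`, `T, δ ∝ e₀p(e₀)` (§2's `regime332`, first clause).
[cite: BalabanImbrieJaffe1988, (2.33) p.263] -/
theorem regime_smallU1 (K₁ K₂ cp p : ℝ) (hK₁ : 0 ≤ K₁) (hK₂ : 0 ≤ K₂) :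
    ∃ estar > 0, ∀ e : ℝ, 0 < e → e < estar → ∀ pe : ℝ, 0 ≤ pe → pe ≤ cp * pLog p e →
      K₁ * (e * pe) < Real.pi ∧ K₂ * (e * pe) ^ 2 ≤ 1 / 2 := by
  obtain ⟨estar, hstar, hreg⟩ := regime332 (K₁ + Real.pi * (2 * K₂ + 2)) 0 0 cp p (by positivity) le_rfl le_rfl one_pos
  refine ⟨estar, hstar, fun e he hlt pe hpe hpcp => ?_⟩
  obtain ⟨h, -, -⟩ := hreg e he hlt pe (e ^ 2) hpcp (by rw [one_mul])
  have hX : 0 ≤ e * pe := mul_nonneg he.le hpe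
  have hπ : 0 < Real.pi := Real.pi_pos
  have h1 : K₁ * (e * pe) < Real.pi := by nlinarith [mul_nonneg (by positivity : 0 ≤ Real.pi * (2 * K₂ + 2)) hX]
  have h2 : Real.pi * ((2 * K₂ + 2) * (e * pe)) < Real.pi * 1 := by nlinarith [mul_nonneg hK₁ hX]
  have h3 : (2 * K₂ + 2) * (e * pe) < 1 := lt_of_mul_lt_mul_left h2 hπ.le
  refine ⟨h1, ?_⟩
  -- `X := e·pe < ½`, so `X² ≤ X/2` and `K₂X² ≤ K₂X/2 < ¼`
  have hX1 : e * pe ≤ 1 / 2 := by nlinarith [mul_nonneg hK₂ hX]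
  have hX2 : (e * pe) ^ 2 ≤ e * pe * (1 / 2) := by rw [sq]; exact mul_le_mul_of_nonneg_left hX1 hX
  nlinarith [mul_nonneg hK₂ hX, mul_le_mul_of_nonneg_left hX2 hK₂]

/-- **THE OPERATOR DATA OF `G(Λ, u₁)` FROM (3.15), THE GAUGE HALF AND THE AXIAL GAUGE** — the two hypotheses `B4.Hyp56 (chartSet Λ) (reOp Λ
((−Δ_{u₁} + aL_r^{−2}Q(u₁)*Q(u₁))|_Λ)) γ₀ c₀ δ₀` and `IsUnit (compress Λ (…))` of §3/§7/§8 (p. 264 *"by (2.38), C^{(k)}_Λ(u)^{−1} is bounded below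
and a random walk expansion as in [6] can be used"*; [6] (5.6)) HOLD at `u₁ = u·e^{−ie₀A⁽⁰⁾}` (p11's `uOne`) whenever: `u` is in the axial gauge
`δ_{Ax}`, `|arg u(∂p)| ≤ ε` for the plaquettes `p` based in the blocks of the block union `Λ`, `|A⁽⁰⁾_b| ≤ α` on `Λ*`, `Λ` does not wrap
around the torus (`|b₋ − b₊|_chart ≤ 1` on `Λ*`), `c ≠ 0`, `κ = aL_r^{−2} > 0`, and the smallness `(d−1)(L−1)ε < π`,
`2(L−1)L·d·((d−1)(L−1)ε + e₀α)² + 2(d(L−1)e₀α)² ≤ ½` holds; then (5.6) with `γ₀ ≤ ½c₂₄₀(c², κ)`, `c₀ ≥ 4dc²e^{δ₀} + κL^{−2d}e^{δ₀(L−1)}` (§9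
`hyp56_nOp_univ_smallField_on` / `isUnit_compress_nOp_univ_smallField_on` fed by §10). [cite: BalabanImbrieJaffe1988, (2.40) p.264]
[cite: Balaban1983RegularityDecay, (5.6) p.594] -/
theorem hyp56_isUnit_uOne_on (hj : j + 1 ≤ P.m + P.K) {U : GaugeField P j U1} (hU : DeltaAx U)
    {Λ : Finset (Balaban1983to89.Site P j)} (hΛ : IsBlockUnion 1 Λ)
    (hΛw : ∀ b : PBond P j, b.src ∈ Λ → b.tgt ∈ Λ → cdist b.src b.tgt ≤ 1)
    {ε e₀ α : ℝ} (hε₀ : 0 ≤ ε) (he₀ : 0 < e₀) (hα : 0 ≤ α)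
    (hπ : (((P.d - 1) * (P.L - 1) : ℕ) : ℝ) * ε < Real.pi)
    (hε : ∀ b ∈ starB Λ, blkIter 1 b.src = blkIter 1 b.tgt →
      ∀ p : Balaban1983to89.Plaq P j, blockOf p.src = blockOf b.src → |argB (toC (plaqHol U p))| ≤ ε)
    {A0 : PBond P j → ℝ} (hA : ∀ b ∈ starB Λ, |A0 b| ≤ α)
    (hσ : 2 * (((P.L : ℝ) - 1) * P.L) * P.d * ((((P.d - 1) * (P.L - 1) : ℕ) : ℝ) * ε + e₀ * α) ^ 2
      + 2 * (P.d * ((P.L : ℝ) - 1) * (e₀ * α)) ^ 2 ≤ 1 / 2)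
    {c κ : ℝ} (hc : c ≠ 0) (hκ : 0 < κ) {γ₀ c₀ δ₀ : ℝ} (hδ₀ : 0 ≤ δ₀) (hγ₀ : γ₀ ≤ c240 P (c ^ 2) κ / 2)
    (hc₀ : 4 * P.d * c ^ 2 * Real.exp δ₀ + κ * (((P.L : ℝ) ^ P.d)⁻¹) ^ 2 * Real.exp (δ₀ * ((P.L : ℝ) - 1)) ≤ c₀) :
    B4.Hyp56 (chartSet Λ) (reOp Λ (nOp κ c (uOne U e₀ A0) 1 univ)) γ₀ c₀ δ₀ ∧ IsUnit (compress Λ (nOp κ c (uOne U e₀ A0) 1 univ)) := by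
  -- §10: the smallness of `u₁` on `Λ`
  have hInt : ∀ b ∈ starB Λ, blkIter 1 b.src = blkIter 1 b.tgt →
      ‖toC (uOne U e₀ A0 b) - 1‖ ≤ (((P.d - 1) * (P.L - 1) : ℕ) : ℝ) * ε + e₀ * α := by
    intro b hb hbb
    refine (norm_toC_uOne_sub_one_le_of_plaquettes hj hU hε₀ hπ hbb (hε b hb hbb) e₀ A0).trans (add_le_add le_rfl ?_)
    rw [abs_mul, abs_of_pos he₀]
    exact mul_le_mul_of_nonneg_left (hA b hb) he₀.le
  have hTree : ∀ x ∈ Λ, ‖holCK (uOne U e₀ A0) 1 x - 1‖ ≤ P.d * ((P.L : ℝ) - 1) * (e₀ * α) := by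
    intro x hx
    have h := norm_holCK_uOne_sub_one_le hj hU hΛ (e := e₀) hα hA hx
    rwa [abs_of_pos he₀] at h
  -- §9 at `σ = ½`
  have h56 := hyp56_nOp_univ_smallField_on hj hΛ (uOne U e₀ A0) hInt hTree hσ hΛw c hκ.le hδ₀
  have hunit := isUnit_compress_nOp_univ_smallField_on hj hΛ (uOne U e₀ A0) hInt hTree hσ (by norm_num) hc hκ
  refine ⟨hyp56_mono' h56 ?_ hc₀, hunit⟩
  have : c240 P (c ^ 2) κ * (1 - 1 / 2) - 0 = c240 P (c ^ 2) κ / 2 := by ring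
  linarith

/-- **(3.33) FROM (3.15), THE OPERATOR DATA OF `G(Λ, u₁)` DISCHARGED** (p. 270: *"Similarly, it can be shown that |A^{(0)}| ≦ cp(e₀) in Λ₁^{(0)*},
|φ^{(0)}| ≦ cp(e₀) in Λ₁^{(0)*}, (3.33)"*; p. 264: *"by (2.38), C^{(k)}_Λ(u)^{−1} is bounded below and a random walk expansion as in [6] can be
used"*): §8's `small333_of_smallField315_only_collar_regime` with its two OPERATOR HYPOTHESES on the first-step covariance
`G(Λ, u₁) = [(−Δ_{u₁} + aL_r^{−2}Q(u₁)*Q(u₁))|_Λ]^{−1}` at `u₁ = u·e^{−ie₀A⁽⁰⁾}` — [6] (5.6) `B4.Hyp56 (chartSet Λ) (reOp Λ …) γ₀ c₀ δ₀` and the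
invertibility `IsUnit (compress Λ …)` — REMOVED: they follow (§9–§10, `hyp56_isUnit_uOne_on`) from the axial gauge, the fourth clause of (3.15)
on `Λ₀**` (p30's `plaqSmall_of_smallField315`; the blocks of `Λ ⊆ Λ₁ ⊆ collarShrink r₁ Λ₀` are based within `L + 1 ≤ r₁` of `Λ₁`), the gauge
half §5 (`|A⁽⁰⁾| ≤ c_g p(e₀)` on `Λ₁* ⊇ Λ*`) and print's regime (`e₀p(e₀) → 0`: `regime_smallU1`).  PRICE (p29's `BIJ88ScalarTranslation330Size`
HONEST SCOPE (iii)): `Λ` must not wrap around the torus — `|b₋ − b₊|_chart ≤ 1` on `Λ*`, true for `Λ` inside a box not crossing the coordinate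
seam — and `c ≠ 0`, `aL_r^{−2} > 0`; the walk constants of [6] (5.6) are now any `0 < γ₀ ≤ ½c₂₄₀(c², aL_r^{−2})`,
`c₀ ≥ 4dc²e^{δ₀} + aL_r^{−2}L^{−2d}e^{δ₀(L−1)}` at `(d, L)` (`c₂₄₀(γ, κ) = min(γ/(2(L−1)L), κ/(2L^d))`, p31's `c240`), with the cube-size
conditions `K_R, Θ₁ < M`, `θ_W < 1` hypotheses at these constants as before.  Hypotheses left: r18's (3.15) at the objects of record on
`(Λ₀, Λ₀′)` (ONE hypothesis), the axial gauge, (3.27), the collar tower / located margins, the no-wrap block union `Λ`, the localized kernel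
`K = C_loc(ρ)` of `G(Λ, u₁)` (data, characterized by `hK0`/`hKl`), print's regime with `λ₀ ≤ 1`.
[cite: BalabanImbrieJaffe1988, (3.33) p.270] [cite: BalabanImbrieJaffe1988, (3.15) p.267] [cite: BalabanImbrieJaffe1988, (2.40) p.264] -/
theorem small333_of_smallField315_noWrap_collar_regime (d L : ℕ) (hd : 2 ≤ d) {a Lr c : ℝ} (haL : 0 < a * Lr ^ (-(2 : ℤ))) (hc : c ≠ 0)
    {γ₀ c₀ δ₀ : ℝ} (hγ : 0 < γ₀)
    (hγle : γ₀ ≤ min (c ^ 2 / (2 * (((L : ℝ) - 1) * L))) (a * Lr ^ (-(2 : ℤ)) / (2 * (L : ℝ) ^ d)) / 2)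
    (hc₀ : 4 * (d : ℝ) * c ^ 2 * Real.exp δ₀ + a * Lr ^ (-(2 : ℤ)) * (((L : ℝ) ^ d)⁻¹) ^ 2 * Real.exp (δ₀ * ((L : ℝ) - 1)) ≤ c₀)
    (hδ : 0 < δ₀) {M : ℕ} (hM : 5 ≤ M) (hMR : kR d 2 γ₀ c₀ δ₀ < M) (hMθ : thetaConst d 2 γ₀ c₀ δ₀ < M) (hθW : thetaW d 2 γ₀ c₀ δ₀ M < 1)
    (cp p : ℝ) {κ κ' r C : ℝ} (hκ : 0 < κ) (hκ' : 0 < κ') (hr : 1 < r) (hC : 0 < C) :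
    ∃ c₃ : ℝ, 0 < c₃ ∧ ∃ estar : ℝ, 0 < estar ∧ ∀ (P : Params) (hPd : 2 ≤ P.d), P.d = d → P.L = L →
      ∀ {j : ℕ} (hj : j + 1 ≤ P.m + P.K) (Rg : ℝ), 0 ≤ Rg → ∀ {U : GaugeField P j U1}, DeltaAx U →
      ∀ {e₀ pe₀ lam₀ : ℝ}, 0 < e₀ → e₀ < estar → 0 ≤ pe₀ → pe₀ ≤ cp * pLog p e₀ → e₀ ^ 2 ≤ C * lam₀ → lam₀ ≤ 1 →
      ∀ {Λ₀ Λ₁ Λ Λ₇ : Finset (Balaban1983to89.Site P j)} {r₁ R₇ : ℕ} {Λ₀' : Finset (Balaban1983to89.Site P (j + 1))},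
      Λ₁ ⊆ collarShrink r₁ Λ₀ → Rg + 7 * L + 2 ≤ r₁ →
      (∀ b : PBond P j, (b.src ∈ Λ ∨ b.tgt ∈ Λ) → b ∈ BIJ88Sect3Statements.starB Λ₁) →
      (∀ y : Balaban1983to89.Site P (j + 1), blockK 1 y ⊆ Λ → y ∈ Λ₀') →
      (∀ x : Balaban1983to89.Site P j, blockOf x ∈ Λ₀' → x ∈ Λ₀) →
      Λ₇ ⊆ collarShrink R₇ Λ → κ * rLen r e₀ ≤ R₇ →
      ∀ (A0 : PBond P j → ℝ), BIJ88NeumannNoZeroModesTorus.IsBlockUnion 1 Λ →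
      (∀ b : PBond P j, b.src ∈ Λ → b.tgt ∈ Λ → cdist b.src b.tgt ≤ 1) → ∀ (ρ : ℝ)
      (K : Matrix (Balaban1983to89.Site P j) (Balaban1983to89.Site P j) ℂ), (∀ x₁ ∈ Λ, ∀ x₂ ∉ Λ, K x₁ x₂ = 0) →
      (∀ x₁ x₂ : ↥Λ, K x₁ x₂ =
        ⟨cLoc (ldist (N := 2) M) ρ (fun ω y₁ y₂ => latticeCw M (chartSet Λ) 2 (reOp Λ (nOp (a * Lr ^ (-(2 : ℤ))) c (uOne U e₀ A0) 1 univ))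
              ω y₁ y₂) (idxEquiv Λ (x₁, 0)) (idxEquiv Λ (x₂, 0)),
         cLoc (ldist (N := 2) M) ρ (fun ω y₁ y₂ => latticeCw M (chartSet Λ) 2 (reOp Λ (nOp (a * Lr ^ (-(2 : ℤ))) c (uOne U e₀ A0) 1 univ))
              ω y₁ y₂) (idxEquiv Λ (x₁, 1)) (idxEquiv Λ (x₂, 0))⟩) →
      κ' * rLen r e₀ ≤ ρ - 3 →
      ∀ {φ φ0 corr : Balaban1983to89.Site P j → ℂ} {ψ : Balaban1983to89.Site P (j + 1) → ℂ},
      φ = BIJ88Sect3Translations.phi330 Λ₇ a Lr φ0 corr → (∀ x ∈ Λ₇, corr x = (K *ᵥ ((qMatT (uOne U e₀ A0) 1)ᴴ *ᵥ ψ)) x) →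
      BIJ88Sect3Statements.SmallField315 pe₀ lam₀ Λ₀ Λ₀' (covD c (cfg U) φ) ψ (qMatT U 1 *ᵥ φ) φ
        (fun q => ‖fieldStrength e₀ (plaqVar (cfg U) q)‖) →
      ∀ (Λ₄s : Finset (PBond P j)),
      Aprime327 Λ₄s (L : ℝ) A0 ((Cloc P j Rg).mulVec (plaqDiv 1 ((torusEdgeCells P j hPd).Qstar
        (fun q => (fieldStrength e₀ (toC (plaqHol (qU U) q))).re)))) = (fun b => argB (toC (uPrime U b)) / e₀) →
      (∀ b ∈ BIJ88Sect3Statements.starB Λ₁, |A0 b| ≤ c₃ * pe₀) ∧ BIJ88Sect3Statements.Small333 c₃ pe₀ Λ₇ A0 φ0 := by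
  have hc₀' : 0 ≤ c₀ := le_trans (by positivity) hc₀
  obtain ⟨cg, hcg, eg, heg, HG⟩ := small333_gauge_of_smallField315_collar_regime d L hd cp p
  obtain ⟨c₃, hc₃, es, hes, H⟩ :=
    small333_of_smallField315_only_collar_regime d L hd hγ hc₀' hδ hM hMR hMθ hθW cp p hκ hκ' hr hC haL.le c
  have hL1 : (0 : ℝ) ≤ ((L : ℝ) - 1) * L := by
    rcases Nat.eq_zero_or_pos L with h | h
    · simp [h]
    · have : (1 : ℝ) ≤ L := by exact_mod_cast h
      nlinarith
  obtain ⟨e1, he1, hreg⟩ := regime_smallU1 (((d - 1) * (L - 1) : ℕ) : ℝ)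
    (2 * (((L : ℝ) - 1) * L) * d * ((((d - 1) * (L - 1) : ℕ) : ℝ) + cg) ^ 2 + 2 * (d * ((L : ℝ) - 1) * cg) ^ 2) cp p
    (by positivity) (add_nonneg (mul_nonneg (mul_nonneg (mul_nonneg two_pos.le hL1) (Nat.cast_nonneg d)) (sq_nonneg _)) (by positivity))
  refine ⟨c₃, hc₃, min (min eg es) e1, lt_min (lt_min heg hes) he1, ?_⟩
  intro P hPd hP hPL j hj Rg hRg U hU e₀ pe₀ lam₀ he₀ hlt hpe hpcp hlam hlam1 Λ₀ Λ₁ Λ Λ₇ r₁ R₇ Λ₀' hcol hr₁ hB hY hB₀ h7c hR₇ A0 hΛ hΛw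
    ρ K hK0 hKl hρ φ φ0 corr ψ hφ hcorr h315 Λ₄s h327
  have hlt_g : e₀ < eg := hlt.trans_le ((min_le_left _ _).trans (min_le_left _ _))
  have hlt_s : e₀ < es := hlt.trans_le ((min_le_left _ _).trans (min_le_right _ _))
  have hlt_1 : e₀ < e1 := hlt.trans_le (min_le_right _ _)
  -- the gauge half on all of `Λ₁*` (§5; coarse region `Y` := the blocks inside `collarShrink 2 Λ₀`)
  have hA0 : ∀ b ∈ BIJ88Sect3Statements.starB Λ₁, |A0 b| ≤ cg * pe₀ := by
    classical
    exact HG P hPd hP hPL j hj Rg hRg U hU e₀ pe₀ lam₀ he₀ hlt_g hpe hpcp Λ₀ Λ₁ r₁ hcol hr₁ Λ₀' _ _ _ _ h315 _ Λ₄s subset_rfl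
      (univ.filter fun y => Balaban1983to89.block y ⊆ collarShrink 2 Λ₀) (fun y => by simp) A0 h327
  -- the regime: `(d−1)(L−1)e₀p(e₀) < π` and `σ ≤ ½`
  obtain ⟨hπN, hσ⟩ := hreg e₀ he₀ hlt_1 pe₀ hpe hpcp
  subst hP hPL
  have hd0 : 0 < P.d := by omega
  have hL := P.L_pos
  -- `Λ ⊆ Λ₁ ⊆ Λ₀`; the plaquettes of the blocks of `Λ` lie in `Λ₀**`
  have hΛΛ₁ : Λ ⊆ Λ₁ := fun x hx => ((mem_starB _ _).1 (hB ⟨x, ⟨0, hd0⟩⟩ (Or.inl hx))).1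
  have hr7 : 7 * P.L + 2 ≤ r₁ := by
    have : ((7 * P.L + 2 : ℕ) : ℝ) ≤ (r₁ : ℝ) := by push_cast; linarith
    exact_mod_cast this
  have hsmall := plaqSmall_of_smallField315 he₀ h315
  have hε : ∀ b ∈ starB Λ, blkIter 1 b.src = blkIter 1 b.tgt →
      ∀ p : Balaban1983to89.Plaq P j, blockOf p.src = blockOf b.src → |argB (toC (plaqHol U p))| ≤ e₀ * pe₀ := by
    intro b hb _ p hp
    have hb1 : b.src ∈ Λ₁ := hΛΛ₁ ((mem_starB _ _).1 hb).1
    refine hsmall p (mem_starP_of_near_collarShrink (hcol hb1) p ?_)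
    have := supDist_le_of_blockOf_eq hj hp.symm
    omega
  have hAΛ : ∀ b ∈ starB Λ, |A0 b| ≤ cg * pe₀ := fun b hb =>
    hA0 b (hB b (Or.inl ((mem_starB _ _).1 hb).1))
  -- §9–§10: the operator data of `G(Λ, u₁)`
  have hσ' : 2 * (((P.L : ℝ) - 1) * P.L) * P.d * ((((P.d - 1) * (P.L - 1) : ℕ) : ℝ) * (e₀ * pe₀) + e₀ * (cg * pe₀)) ^ 2
      + 2 * (P.d * ((P.L : ℝ) - 1) * (e₀ * (cg * pe₀))) ^ 2 ≤ 1 / 2 := by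
    have e : 2 * (((P.L : ℝ) - 1) * P.L) * P.d * ((((P.d - 1) * (P.L - 1) : ℕ) : ℝ) * (e₀ * pe₀) + e₀ * (cg * pe₀)) ^ 2
        + 2 * (P.d * ((P.L : ℝ) - 1) * (e₀ * (cg * pe₀))) ^ 2 =
        (2 * (((P.L : ℝ) - 1) * P.L) * P.d * ((((P.d - 1) * (P.L - 1) : ℕ) : ℝ) + cg) ^ 2 + 2 * (P.d * ((P.L : ℝ) - 1) * cg) ^ 2)
          * (e₀ * pe₀) ^ 2 := by ring
    rw [e]; exact hσ
  have hγle' : γ₀ ≤ c240 P (c ^ 2) (a * Lr ^ (-(2 : ℤ))) / 2 := by unfold c240; exact hγle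
  obtain ⟨h56, hunit⟩ := hyp56_isUnit_uOne_on hj hU hΛ hΛw (by positivity) he₀ (by positivity) hπN hε hAΛ hσ' hc haL hδ.le hγle' hc₀
  exact H P hPd rfl rfl hj Rg hRg hU he₀ hlt_s hpe hpcp hlam hlam1 hcol hr₁ hB hY hB₀ h7c hR₇ A0 hΛ h56 hunit ρ K hK0 hKl hρ hφ hcorr h315
    Λ₄s h327

end Conj333NoWrap

/-! ## §12  (v1.4) p29's (3.33) scalar half at the composed objects, small-field form, WITH THE SMALLNESS ON `Λ` ONLY -/

section Corr330Local

open Finset Matrix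
open BIJ88Sect3Statements (U1 toC cfg covD starB)
open BIJ85BlockAveragesTorus BIJ85BlockAveragesTorusK
open BIJ88NeumannNoZeroModesTorus (IsBlockUnion)
open BIJ88NeumannPropagator227Torus (nOp)
open BIJ88DeltaLoc234Torus (qMatT)
open BIJ88Eq240FlatTorus (compress c240 c240_pos)
open BIJ88RandomWalk242 BIJ88Eq242Lattice BIJ88Ineq246Lattice B4Sect5CubeBounds
open BIJ88Eq242HiggsCovarianceTorus
open B4Sect5Proof (latticeConst)
open BIJ88Sect3Translations (phi330)
open BIJ88ScalarTranslation330Torus (corr330)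
open BIJ88ScalarTranslation330Size (small333_scalar_corr330)

variable {P : Params} {j : ℕ} {Λ : Finset (Balaban1983to89.Site P j)}

/-- **p29's `BIJ88ScalarTranslation330Size.small333_scalar_corr330_smallField` WITH THE SMALLNESS ON `Λ` ONLY** — the (3.33) scalar half
*"|φ^{(0)}| ≦ cp(e₀)"* at the composed correction of (3.30) (`K := cLocC …`, `corr := corr330 …`), [6] (5.6) and the invertibility of
`(−Δ_{u₁} + aL^{−2}Q(u₁)*Q(u₁))|_Λ` DISCHARGED by §9 (`hyp56_nOp_univ_smallField_on`, `isUnit_compress_nOp_univ_smallField_on`) under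
`‖u₁(b) − 1‖ ≤ T` on the in-block bonds of `Λ*` and `‖u₁(Γ_{yx}) − 1‖ ≤ δ` on `Λ` (p29: on the whole torus); all other hypotheses, the explicit
constants `γ₀ = c₂₄₀(c², aL^{−2})(1−σ)`, `c₀ = 4dc²e^{δ₀} + aL^{−2}L^{−2d}e^{δ₀(L−1)}` and the conclusion are p29's, verbatim (their
`small333_scalar_corr330` BY NAME). [cite: BalabanImbrieJaffe1988, (3.33) p.270] -/
theorem small333_scalar_corr330_smallField_on (hj : j + 1 ≤ P.m + P.K) {a L c : ℝ} (haL : 0 < a * L ^ (-(2 : ℤ))) (hcne : c ≠ 0)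
    (U : GaugeField P j U1) {T δ σ : ℝ} (hΛ : BIJ88NeumannNoZeroModesTorus.IsBlockUnion 1 Λ)
    (hInt : ∀ b ∈ starB Λ, blkIter 1 b.src = blkIter 1 b.tgt → ‖toC (U b) - 1‖ ≤ T)
    (hTree : ∀ x ∈ Λ, ‖holCK U 1 x - 1‖ ≤ δ)
    (hσ : 2 * (((P.L : ℝ) - 1) * P.L) * P.d * T ^ 2 + 2 * δ ^ 2 ≤ σ) (hσ1 : σ < 1)
    (hΛw : ∀ b : PBond P j, b.src ∈ Λ → b.tgt ∈ Λ → cdist b.src b.tgt ≤ 1)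
    {γ₀ c₀ δ₀ : ℝ} (hδ : 0 < δ₀) (hγ₀ : γ₀ = c240 P (c ^ 2) (a * L ^ (-(2 : ℤ))) * (1 - σ) - 0)
    (hc₀ : c₀ = 4 * P.d * c ^ 2 * Real.exp δ₀ + a * L ^ (-(2 : ℤ)) * (((P.L : ℝ) ^ P.d)⁻¹) ^ 2 * Real.exp (δ₀ * ((P.L : ℝ) - 1)))
    {M : ℕ} (hM : 5 ≤ M) (hMR : kR P.d 2 γ₀ c₀ δ₀ < M) (hMθ : thetaConst P.d 2 γ₀ c₀ δ₀ < M) (hθW : thetaW P.d 2 γ₀ c₀ δ₀ M < 1) (ρ : ℝ)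
    {φ φ0 : Balaban1983to89.Site P j → ℂ} {ψ : Balaban1983to89.Site P (j + 1) → ℂ} {Λ₇ : Finset (Balaban1983to89.Site P j)}
    (h7 : Λ₇ ⊆ Λ) (hφ : φ = phi330 Λ₇ a L φ0 (corr330 Λ (a * L ^ (-(2 : ℤ))) c U M ρ ψ))
    {pD pQ Φ Ψ R p c₁ : ℝ} (hΦ0 : 0 ≤ Φ)
    (hD : ∀ b : PBond P j, (b.src ∈ Λ ∨ b.tgt ∈ Λ) → ‖covD c (cfg U) φ b‖ ≤ pD)
    (hQ : ∀ y : Balaban1983to89.Site P (j + 1), blockK 1 y ⊆ Λ → ‖ψ y - (qMatT U 1 *ᵥ φ) y‖ ≤ pQ)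
    (hΦ : ∀ b : PBond P j, (b.src ∈ Λ → b.tgt ∉ Λ → ‖φ b.tgt‖ ≤ Φ) ∧ (b.tgt ∈ Λ → b.src ∉ Λ → ‖φ b.src‖ ≤ Φ))
    (hΨ : ∀ y : Balaban1983to89.Site P (j + 1), blockK 1 y ⊆ Λ → ‖ψ y‖ ≤ Ψ)
    (hR : ∀ x ∈ Λ₇, ∀ x₂ ∈ Λ, (∃ μ : Fin P.d, x₂.shift μ ∉ Λ ∨ x₂.unshift μ ∉ Λ) → R ≤ B5Ineq137Torus.T P j x x₂)
    (hpD : pD ≤ c₁ * p) (hpQ : pQ ≤ c₁ * p) (hRΦ : Real.exp (-(δ₀ / 16 / M * R)) * Φ ≤ p)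
    (hδΨ : 2 ^ P.d * γ₀⁻¹ * (1 - thetaW P.d 2 γ₀ c₀ δ₀ M)⁻¹ * Real.exp (-(δ₀ / 16 * (ρ - 3))) * Ψ ≤ p) :
    ∀ x ∈ Λ₇, ‖φ0 x‖ ≤
      (2 * (2 ^ P.d * γ₀⁻¹ * (1 - thetaW P.d 2 γ₀ c₀ δ₀ M)⁻¹ * Real.exp (δ₀ / 4)) * latticeConst P.d (δ₀ / 8 / M)
            * (|c| * (2 * P.d) + a * L ^ (-(2 : ℤ)) * ((P.L : ℝ) ^ P.d)⁻¹) * c₁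
        + 2 * (2 ^ P.d * γ₀⁻¹ * (1 - thetaW P.d 2 γ₀ c₀ δ₀ M)⁻¹ * Real.exp (δ₀ / 4)) * latticeConst P.d (δ₀ / 16 / M)
            * (|c| * (2 * P.d) * |c|)
        + a * L ^ (-(2 : ℤ)) * 2 * latticeConst P.d (δ₀ / 16 / M) * ((P.L : ℝ) ^ P.d)⁻¹) * p := by
  have hγ : 0 < γ₀ := by
    rw [hγ₀, sub_zero]
    exact mul_pos (c240_pos P (by positivity) haL) (by linarith)
  have hc0 : 0 ≤ c₀ := by rw [hc₀]; positivity
  have hA : B4.Hyp56 (chartSet Λ) (reOp Λ (nOp (a * L ^ (-(2 : ℤ))) c U 1 univ)) γ₀ c₀ δ₀ := by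
    rw [hγ₀, hc₀]
    exact hyp56_nOp_univ_smallField_on hj hΛ U hInt hTree hσ hΛw c haL.le hδ.le
  have hU : IsUnit (compress Λ (nOp (a * L ^ (-(2 : ℤ))) c U 1 univ)) :=
    isUnit_compress_nOp_univ_smallField_on hj hΛ U hInt hTree hσ hσ1 hcne haL
  exact small333_scalar_corr330 haL.le U hΛ hγ hc0 hδ hA hU hM hMR hMθ hθW ρ h7 hφ hΦ0 hD hQ hΦ hΨ hR hpD hpQ hRΦ hδΨ

end Corr330Local

/-! ## §13  (v1.5) The no-wrap hypothesis from a seam-free region, and §11 AT THE (2.43)-LOCALIZED KERNEL OF RECORD `C_loc` / `corr330` -/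

section Corr330Record

open Finset Matrix
open BIJ88Sect3Statements (U1 toC cfg covD plaqVar fieldStrength starB starP mem_starB)
open BIJ85BlockAveragesTorus BIJ85BlockAveragesTorusK
open BIJ88NeumannNoZeroModesTorus (IsBlockUnion)
open BIJ88NeumannPropagator227Torus (nOp)
open BIJ88DeltaLoc234Torus (qMatT)
open BIJ88Eq240FlatTorus (compress c240)
open BIJ88RandomWalk242 BIJ88Eq242Lattice BIJ88Ineq246Lattice B4Sect5CubeBounds
open BIJ88Eq242HiggsCovarianceTorus
open B4Sect5Proof (latticeConst)
open BIJ85Eq325Corrections (uOne)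
open BIJ88RegionTower274 (collarShrink)
open BIJ88Sect3Translations (Aprime327 phi330)
open BIJ88ClocEstimatesTorus (Cloc)
open BIJ85Eq531Proof (plaqDiv)
open BIJ85CurlQsstar (torusEdgeCells)
open BIJ85Sect1Model (argB)
open BIJ88RenormTransf311 (DeltaAx)
open GaugeField (plaqHol)
open BIJ88ScalarTranslation330Torus (cLocC corr330 cLocC_of_mem cLocC_of_not_mem_right)

variable {P : Params} {j : ℕ}

/-- **A BOND OFF THE COORDINATE SEAM IS A CHART NEIGHBOUR**: if the source of `b = ⟨x, x + e_μ⟩` has `x_μ + 1 < N` (integer representatives in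
`[0, N)`, `N = 2L^{m+K−j}` sites a direction), then `|b₋ − b₊|_chart ≤ 1` — the chart `x ↦ (x_μ.val)_μ` of p31's `BIJ88Eq242HiggsCovarianceTorus`
does not jump across `b`. [cite: BalabanImbrieJaffe1988, (2.42) p.264] -/
theorem cdist_src_tgt_le_one {b : PBond P j} (h : (b.src b.dir).val + 1 < P.sitesPerDir j) : cdist b.src b.tgt ≤ 1 := by
  unfold cdist
  refine (dist_pi_le_iff zero_le_one).2 fun ν => ?_
  rw [Int.dist_eq]
  have htgt : b.tgt = b.src.shift b.dir := rfl
  have h1 : ((1 : ZMod (P.sitesPerDir j))).val = 1 := ZMod.val_one _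
  by_cases hν : ν = b.dir
  · subst hν
    have hv : (b.tgt b.dir).val = (b.src b.dir).val + 1 := by
      rw [htgt]
      simp only [Balaban1983to89.Site.shift, Function.update_self]
      rw [ZMod.val_add_of_lt (by rw [h1]; exact h), h1]
    simp only [chart, hv]
    push_cast
    rw [show ((b.src b.dir).val : ℝ) - (((b.src b.dir).val : ℝ) + 1) = -1 by ring, abs_neg, abs_one]
  · have hv : b.tgt ν = b.src ν := by
      rw [htgt]
      simp only [Balaban1983to89.Site.shift, Function.update_of_ne hν]
    simp only [chart, hv, sub_self, abs_zero]
    exact zero_le_one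

/-- **THE NO-WRAP HYPOTHESIS FROM A SEAM-FREE REGION** (p29's `BIJ88ScalarTranslation330Size` HONEST SCOPE (iii): *"true for `Λ` inside a box
not crossing the coordinate seam"*): if no site of `Λ` has a coordinate representative `N − 1`, then every bond starting in `Λ` is a chart
neighbour, `|b₋ − b₊|_chart ≤ 1` — the hypothesis `hΛw` of §9/§11/§12. [cite: BalabanImbrieJaffe1988, (2.42) p.264] -/
theorem noWrap_of_seamFree {Λ : Finset (Balaban1983to89.Site P j)}
    (hΛ : ∀ x ∈ Λ, ∀ μ : Fin P.d, (x μ).val + 1 < P.sitesPerDir j) :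
    ∀ b : PBond P j, b.src ∈ Λ → b.tgt ∈ Λ → cdist b.src b.tgt ≤ 1 :=
  fun b hb _ => cdist_src_tgt_le_one (hΛ b.src hb b.dir)

/-- **(3.33) FROM (3.15) AT THE (2.43)-LOCALIZED KERNEL OF RECORD** — §11's `small333_of_smallField315_noWrap_collar_regime` with the kernel
DATA `K` (and its characterization `hK0`/`hKl`) and the correction data `corr` (and `hcorr`) ELIMINATED: `K := C^{(0)}_{Λ,loc}(u₁)` is p29's
definite matrix `BIJ88ScalarTranslation330Torus.cLocC Λ (−Δ_{u₁} + aL_r^{−2}Q(u₁)*Q(u₁)) M ρ` (p13's primed walk sum (2.43) of the charted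
operator, packaged; `hK0` = `cLocC_of_not_mem_right`, `hKl` = `cLocC_of_mem`) and the (3.30) correction is p29's
`corr330 Λ (aL_r^{−2}) c u₁ M ρ ψ = C^{(0)}_{Λ,loc}(u₁)Q(u₁)*ψ` (`hcorr` by `rfl`), `u₁ = u·e^{−ie₀A⁽⁰⁾}`.  Print p. 270: *"Again we make a local
translation, φ = φ^{(0)} + aL^{−2}Λ₇^{(0)}C^{(0)}_{loc}(u₁)Q*(u₁)ψ. (3.30) … |A^{(0)}| ≦ cp(e₀) in Λ₁^{(0)*}, |φ^{(0)}| ≦ cp(e₀) in Λ₁^{(0)*}, (3.33)"*.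
Hypotheses left: r18's (3.15) at the objects of record on `(Λ₀, Λ₀′)` (ONE hypothesis), the axial gauge, (3.27), the collar tower / located
margins, the no-wrap block union `Λ` (`noWrap_of_seamFree`), `ρ` with `κ′r(e₀) ≤ ρ − 3` (print: `ρM = ¼r(e₀)`), the walk-cube size `M` with
p13's conditions at the explicit `(γ₀, c₀, δ₀)`, print's regime with `λ₀ ≤ 1`, and `φ = φ^{(0)} + aL_r^{−2}χ_{Λ₇}C^{(0)}_{Λ,loc}(u₁)Q(u₁)*ψ`
(r18's `phi330` at p29's `corr330`). [cite: BalabanImbrieJaffe1988, (3.33) p.270] [cite: BalabanImbrieJaffe1988, (3.30) p.270]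
[cite: BalabanImbrieJaffe1988, (2.43) p.264] -/
theorem small333_of_smallField315_corr330_collar_regime (d L : ℕ) (hd : 2 ≤ d) {a Lr c : ℝ} (haL : 0 < a * Lr ^ (-(2 : ℤ))) (hc : c ≠ 0)
    {γ₀ c₀ δ₀ : ℝ} (hγ : 0 < γ₀)
    (hγle : γ₀ ≤ min (c ^ 2 / (2 * (((L : ℝ) - 1) * L))) (a * Lr ^ (-(2 : ℤ)) / (2 * (L : ℝ) ^ d)) / 2)
    (hc₀ : 4 * (d : ℝ) * c ^ 2 * Real.exp δ₀ + a * Lr ^ (-(2 : ℤ)) * (((L : ℝ) ^ d)⁻¹) ^ 2 * Real.exp (δ₀ * ((L : ℝ) - 1)) ≤ c₀)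
    (hδ : 0 < δ₀) {M : ℕ} (hM : 5 ≤ M) (hMR : kR d 2 γ₀ c₀ δ₀ < M) (hMθ : thetaConst d 2 γ₀ c₀ δ₀ < M) (hθW : thetaW d 2 γ₀ c₀ δ₀ M < 1)
    (cp p : ℝ) {κ κ' r C : ℝ} (hκ : 0 < κ) (hκ' : 0 < κ') (hr : 1 < r) (hC : 0 < C) :
    ∃ c₃ : ℝ, 0 < c₃ ∧ ∃ estar : ℝ, 0 < estar ∧ ∀ (P : Params) (hPd : 2 ≤ P.d), P.d = d → P.L = L →
      ∀ {j : ℕ} (hj : j + 1 ≤ P.m + P.K) (Rg : ℝ), 0 ≤ Rg → ∀ {U : GaugeField P j U1}, DeltaAx U →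
      ∀ {e₀ pe₀ lam₀ : ℝ}, 0 < e₀ → e₀ < estar → 0 ≤ pe₀ → pe₀ ≤ cp * pLog p e₀ → e₀ ^ 2 ≤ C * lam₀ → lam₀ ≤ 1 →
      ∀ {Λ₀ Λ₁ Λ Λ₇ : Finset (Balaban1983to89.Site P j)} {r₁ R₇ : ℕ} {Λ₀' : Finset (Balaban1983to89.Site P (j + 1))},
      Λ₁ ⊆ collarShrink r₁ Λ₀ → Rg + 7 * L + 2 ≤ r₁ →
      (∀ b : PBond P j, (b.src ∈ Λ ∨ b.tgt ∈ Λ) → b ∈ BIJ88Sect3Statements.starB Λ₁) →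
      (∀ y : Balaban1983to89.Site P (j + 1), blockK 1 y ⊆ Λ → y ∈ Λ₀') →
      (∀ x : Balaban1983to89.Site P j, blockOf x ∈ Λ₀' → x ∈ Λ₀) →
      Λ₇ ⊆ collarShrink R₇ Λ → κ * rLen r e₀ ≤ R₇ →
      ∀ (A0 : PBond P j → ℝ), BIJ88NeumannNoZeroModesTorus.IsBlockUnion 1 Λ →
      (∀ b : PBond P j, b.src ∈ Λ → b.tgt ∈ Λ → cdist b.src b.tgt ≤ 1) → ∀ (ρ : ℝ), κ' * rLen r e₀ ≤ ρ - 3 →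
      ∀ {φ φ0 : Balaban1983to89.Site P j → ℂ} {ψ : Balaban1983to89.Site P (j + 1) → ℂ},
      φ = phi330 Λ₇ a Lr φ0 (corr330 Λ (a * Lr ^ (-(2 : ℤ))) c (uOne U e₀ A0) M ρ ψ) →
      BIJ88Sect3Statements.SmallField315 pe₀ lam₀ Λ₀ Λ₀' (covD c (cfg U) φ) ψ (qMatT U 1 *ᵥ φ) φ
        (fun q => ‖fieldStrength e₀ (plaqVar (cfg U) q)‖) →
      ∀ (Λ₄s : Finset (PBond P j)),
      Aprime327 Λ₄s (L : ℝ) A0 ((Cloc P j Rg).mulVec (plaqDiv 1 ((torusEdgeCells P j hPd).Qstar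
        (fun q => (fieldStrength e₀ (toC (plaqHol (qU U) q))).re)))) = (fun b => argB (toC (uPrime U b)) / e₀) →
      (∀ b ∈ BIJ88Sect3Statements.starB Λ₁, |A0 b| ≤ c₃ * pe₀) ∧ BIJ88Sect3Statements.Small333 c₃ pe₀ Λ₇ A0 φ0 := by
  obtain ⟨c₃, hc₃, estar, hstar, H⟩ :=
    small333_of_smallField315_noWrap_collar_regime d L hd haL hc hγ hγle hc₀ hδ hM hMR hMθ hθW cp p hκ hκ' hr hC
  refine ⟨c₃, hc₃, estar, hstar, ?_⟩
  intro P hPd hP hPL j hj Rg hRg U hU e₀ pe₀ lam₀ he₀ hlt hpe hpcp hlam hlam1 Λ₀ Λ₁ Λ Λ₇ r₁ R₇ Λ₀' hcol hr₁ hB hY hB₀ h7c hR₇ A0 hΛ hΛw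
    ρ hρ φ φ0 ψ hφ h315 Λ₄s h327
  exact H P hPd hP hPL hj Rg hRg hU he₀ hlt hpe hpcp hlam hlam1 hcol hr₁ hB hY hB₀ h7c hR₇ A0 hΛ hΛw ρ
    (cLocC Λ (nOp (a * Lr ^ (-(2 : ℤ))) c (uOne U e₀ A0) 1 univ) M ρ) (fun x₁ _ x₂ hx₂ => cLocC_of_not_mem_right x₁ hx₂)
    (fun x₁ x₂ => cLocC_of_mem x₁.2 x₂.2) hρ hφ (fun _ _ => rfl) h315 Λ₄s h327

end Corr330Record

/-! ## §14  (v1.6) THE CUBE SIZE FIXED FIRST and PRINT'S (2.43) RADIUS `¼r(e₀)`: the walk-parameter and radius binders of §13 eliminated -/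

section CubeSizeFirst

open Finset Matrix
open BIJ88Sect3Statements (U1 toC cfg covD plaqVar fieldStrength starB starP mem_starB)
open BIJ85BlockAveragesTorus BIJ85BlockAveragesTorusK
open BIJ88NeumannNoZeroModesTorus (IsBlockUnion)
open BIJ88NeumannPropagator227Torus (nOp)
open BIJ88DeltaLoc234Torus (qMatT)
open BIJ88Eq240FlatTorus (compress c240)
open BIJ88RandomWalk242 BIJ88Eq242Lattice BIJ88Ineq246Lattice B4Sect5CubeBounds
open BIJ88Eq242HiggsCovarianceTorus
open B4Sect5Proof (latticeConst)
open BIJ85Eq325Corrections (uOne)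
open BIJ88RegionTower274 (collarShrink)
open BIJ88Sect3Translations (Aprime327 phi330)
open BIJ88ClocEstimatesTorus (Cloc)
open BIJ85Eq531Proof (plaqDiv)
open BIJ85CurlQsstar (torusEdgeCells)
open BIJ85Sect1Model (argB)
open BIJ88RenormTransf311 (DeltaAx)
open GaugeField (plaqHol)
open BIJ88ScalarTranslation330Torus (cLocC corr330)
open BIJ88Eq249GaugeCovarianceUniformTorus (exists_cubeSize)

variable {P : Params} {j : ℕ}

/-- **WALK CONSTANTS FOR THE FIRST-STEP COVARIANCE, CHOSEN FROM `(d, L, aL_r^{−2}, c)` ALONE** ([6] = [Balaban1983RegularityDecay] p. 596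
*"Finally we fix M"*; p. 264 *"where ω is a walk on a lattice of spacing M = O(1)"*): for every dimension `d`, block size `L > 1`, mass
parameter `κ₀ > 0` (print's `aL^{−2}`) and `c ≠ 0` there are [6] (5.6) constants `γ₀, c₀, δ₀` and a cube size `M ≥ 5` meeting ALL EIGHT side
conditions of §11/§13: `0 < γ₀ ≤ ½c₂₄₀(c², κ₀)` (`c₂₄₀(γ, κ) = min(γ/(2(L−1)L), κ/(2L^d))`, p31's `c240` written out at `(d, L)`),
`c₀ ≥ 4dc²e^{δ₀} + κ₀L^{−2d}e^{δ₀(L−1)}`, `δ₀ > 0`, and p13's cube thresholds `K_R < M`, `Θ₁ < M`, `θ_W(M) < 1` — here `δ₀ = 1`, `γ₀` = the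
bound itself, `c₀` = the bound itself, `M` = p31's `exists_cubeSize` (`θ_W(M) ≤ ½`). [cite: BalabanImbrieJaffe1988, (2.42) p.264]
[cite: Balaban1983RegularityDecay, (5.21) p.596] -/
theorem exists_walkConsts (d L : ℕ) (hL : 1 < L) {κ₀ c : ℝ} (hκ₀ : 0 < κ₀) (hc : c ≠ 0) :
    ∃ γ₀ c₀ δ₀ : ℝ, 0 < γ₀ ∧ γ₀ ≤ min (c ^ 2 / (2 * (((L : ℝ) - 1) * L))) (κ₀ / (2 * (L : ℝ) ^ d)) / 2 ∧
      4 * (d : ℝ) * c ^ 2 * Real.exp δ₀ + κ₀ * (((L : ℝ) ^ d)⁻¹) ^ 2 * Real.exp (δ₀ * ((L : ℝ) - 1)) ≤ c₀ ∧ 0 < δ₀ ∧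
      ∃ M : ℕ, 5 ≤ M ∧ kR d 2 γ₀ c₀ δ₀ < M ∧ thetaConst d 2 γ₀ c₀ δ₀ < M ∧ thetaW d 2 γ₀ c₀ δ₀ M < 1 := by
  have hL1 : (0 : ℝ) < (L : ℝ) - 1 := by
    have : (1 : ℝ) < L := by exact_mod_cast hL
    linarith
  have hL0 : (0 : ℝ) < L := by linarith
  have hc2 : 0 < c ^ 2 := by positivity
  have h1 : 0 < c ^ 2 / (2 * (((L : ℝ) - 1) * L)) := div_pos hc2 (mul_pos two_pos (mul_pos hL1 hL0))
  have h2 : 0 < κ₀ / (2 * (L : ℝ) ^ d) := by positivity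
  have hγ : 0 < min (c ^ 2 / (2 * (((L : ℝ) - 1) * L))) (κ₀ / (2 * (L : ℝ) ^ d)) / 2 := div_pos (lt_min h1 h2) two_pos
  have hc₀ : (0 : ℝ) ≤ 4 * (d : ℝ) * c ^ 2 * Real.exp 1 + κ₀ * (((L : ℝ) ^ d)⁻¹) ^ 2 * Real.exp (1 * ((L : ℝ) - 1)) := by
    positivity
  obtain ⟨M, hM5, hMR, hMθ, hθ⟩ := exists_cubeSize d 2 hγ hc₀ one_pos
  exact ⟨_, _, 1, hγ, le_rfl, le_rfl, one_pos, M, hM5, hMR, hMθ, by linarith⟩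

/-- `r(e) = |log e⁻¹|^r → +∞` as `e → 0⁺` (`r > 0`): every constant is eventually below the localization length (2.3).
[cite: BalabanImbrieJaffe1988, (2.3) p.260] -/
theorem eventually_const_le_rLen (K r : ℝ) (hr : 0 < r) : ∀ᶠ ek : ℝ in 𝓝[>] 0, K ≤ rLen r ek := by
  filter_upwards [tendsto_abs_log_inv.eventually ((tendsto_rpow_atTop hr).eventually_ge_atTop K)] with ek hek
  simpa only [rLen] using hek

/-- **(3.33) FROM (3.15) WITH THE CUBE SIZE FIXED FIRST** — §13's `small333_of_smallField315_corr330_collar_regime` with its eight walk-parameter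
binders (`hγ`, `hγle`, `hc₀`, `hδ`, `hM`, `hMR`, `hMθ`, `hθW`) ELIMINATED by `exists_walkConsts`: there are a cube size `M ≥ 5` of the (2.42)
walk lattice, a constant `c₃` and a threshold `e*`, all depending on `(d, L, aL_r^{−2}, c, c_p, p, κ, κ′, r, C)` ONLY — chosen BEFORE the torus,
the level, the gauge field, the charge `e₀ < e*` and the regions — such that the §13 implication holds at that `M`: p. 264 *"where ω is a walk on a
lattice of spacing M = O(1)"*, [6] p. 596 *"Finally we fix M"*.  Conclusion verbatim as in §13: for `φ = φ^{(0)} + aL_r^{−2}χ_{Λ₇}C^{(0)}_{Λ,loc}(u₁)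
Q(u₁)*ψ` ((3.30), p29's `corr330 … M ρ` at every radius `ρ` with `κ′r(e₀) ≤ ρ − 3`), (3.15) at the objects of record + the axial gauge + (3.27)
+ the collar tower + a no-wrap block union `Λ` + print's regime give `|A^{(0)}| ≤ c₃p(e₀)` on `Λ₁*` and `Small333 c₃ p(e₀) Λ₇ A^{(0)} φ^{(0)}`.
[cite: BalabanImbrieJaffe1988, (3.33) p.270] [cite: BalabanImbrieJaffe1988, (2.42) p.264] [cite: Balaban1983RegularityDecay, (5.21) p.596] -/
theorem small333_of_smallField315_corr330_regime_uniform (d L : ℕ) (hd : 2 ≤ d) (hL : 1 < L) {a Lr c : ℝ}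
    (haL : 0 < a * Lr ^ (-(2 : ℤ))) (hc : c ≠ 0) (cp p : ℝ) {κ κ' r C : ℝ} (hκ : 0 < κ) (hκ' : 0 < κ') (hr : 1 < r) (hC : 0 < C) :
    ∃ M : ℕ, 5 ≤ M ∧ ∃ c₃ : ℝ, 0 < c₃ ∧ ∃ estar : ℝ, 0 < estar ∧ ∀ (P : Params) (hPd : 2 ≤ P.d), P.d = d → P.L = L →
      ∀ {j : ℕ} (hj : j + 1 ≤ P.m + P.K) (Rg : ℝ), 0 ≤ Rg → ∀ {U : GaugeField P j U1}, DeltaAx U →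
      ∀ {e₀ pe₀ lam₀ : ℝ}, 0 < e₀ → e₀ < estar → 0 ≤ pe₀ → pe₀ ≤ cp * pLog p e₀ → e₀ ^ 2 ≤ C * lam₀ → lam₀ ≤ 1 →
      ∀ {Λ₀ Λ₁ Λ Λ₇ : Finset (Balaban1983to89.Site P j)} {r₁ R₇ : ℕ} {Λ₀' : Finset (Balaban1983to89.Site P (j + 1))},
      Λ₁ ⊆ collarShrink r₁ Λ₀ → Rg + 7 * L + 2 ≤ r₁ →
      (∀ b : PBond P j, (b.src ∈ Λ ∨ b.tgt ∈ Λ) → b ∈ BIJ88Sect3Statements.starB Λ₁) →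
      (∀ y : Balaban1983to89.Site P (j + 1), blockK 1 y ⊆ Λ → y ∈ Λ₀') →
      (∀ x : Balaban1983to89.Site P j, blockOf x ∈ Λ₀' → x ∈ Λ₀) →
      Λ₇ ⊆ collarShrink R₇ Λ → κ * rLen r e₀ ≤ R₇ →
      ∀ (A0 : PBond P j → ℝ), BIJ88NeumannNoZeroModesTorus.IsBlockUnion 1 Λ →
      (∀ b : PBond P j, b.src ∈ Λ → b.tgt ∈ Λ → cdist b.src b.tgt ≤ 1) → ∀ (ρ : ℝ), κ' * rLen r e₀ ≤ ρ - 3 →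
      ∀ {φ φ0 : Balaban1983to89.Site P j → ℂ} {ψ : Balaban1983to89.Site P (j + 1) → ℂ},
      φ = phi330 Λ₇ a Lr φ0 (corr330 Λ (a * Lr ^ (-(2 : ℤ))) c (uOne U e₀ A0) M ρ ψ) →
      BIJ88Sect3Statements.SmallField315 pe₀ lam₀ Λ₀ Λ₀' (covD c (cfg U) φ) ψ (qMatT U 1 *ᵥ φ) φ
        (fun q => ‖fieldStrength e₀ (plaqVar (cfg U) q)‖) →
      ∀ (Λ₄s : Finset (PBond P j)),
      Aprime327 Λ₄s (L : ℝ) A0 ((Cloc P j Rg).mulVec (plaqDiv 1 ((torusEdgeCells P j hPd).Qstar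
        (fun q => (fieldStrength e₀ (toC (plaqHol (qU U) q))).re)))) = (fun b => argB (toC (uPrime U b)) / e₀) →
      (∀ b ∈ BIJ88Sect3Statements.starB Λ₁, |A0 b| ≤ c₃ * pe₀) ∧ BIJ88Sect3Statements.Small333 c₃ pe₀ Λ₇ A0 φ0 := by
  obtain ⟨γ₀, c₀, δ₀, hγ, hγle, hc₀, hδ, M, hM, hMR, hMθ, hθW⟩ := exists_walkConsts d L hL haL hc
  obtain ⟨c₃, hc₃, estar, hstar, H⟩ :=
    small333_of_smallField315_corr330_collar_regime d L hd haL hc hγ hγle hc₀ hδ hM hMR hMθ hθW cp p hκ hκ' hr hC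
  exact ⟨M, hM, c₃, hc₃, estar, hstar, H⟩

/-- **(3.33) FROM (3.15) AT PRINT'S LOCALIZATION RADIUS** — (2.43) p. 264: *"C^{(k)}_{Λ,loc}(u; x₁, x₂) = Σ′_ω C^{(k)}_{Λ,ω}(x₁, x₂), (2.43) where the
prime indicates that only ω remaining within ¼r(e_k) of x₁, x₂ are included"*: `small333_of_smallField315_corr330_regime_uniform` with the radius
binders `ρ`, `κ′`, `κ′r(e₀) ≤ ρ − 3` ELIMINATED as well — the correction of (3.30) is p29's `corr330 Λ (aL_r^{−2}) c u₁ M ρ` AT `ρ = r(e₀)/(4M)`, i.e.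
print's `¼r(e₀)` measured in units of the walk lattice spacing `M` (p13's label-to-site distance `ldist`, in label units; p29: *"ρM = ¼r(e_k)"*),
the threshold `e*` being shrunk so that `r(e₀) ≥ 24M` (then `(8M)⁻¹r(e₀) ≤ ρ − 3`, `eventually_const_le_rLen`).  Hypotheses left: (3.15) at the
objects of record, the axial gauge, (3.27), the collar tower / located margins, the no-wrap (seam-free, §13) block union `Λ`, print's regime
(`e₀ < e*`, `p(e₀) ≤ c_p|log e₀⁻¹|^p`, `e₀² ≤ Cλ₀`, `λ₀ ≤ 1`). [cite: BalabanImbrieJaffe1988, (3.33) p.270] [cite: BalabanImbrieJaffe1988, (2.43) p.264]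
[cite: BalabanImbrieJaffe1988, (3.30) p.270] -/
theorem small333_of_smallField315_corr330_regime_printRadius (d L : ℕ) (hd : 2 ≤ d) (hL : 1 < L) {a Lr c : ℝ}
    (haL : 0 < a * Lr ^ (-(2 : ℤ))) (hc : c ≠ 0) (cp p : ℝ) {κ r C : ℝ} (hκ : 0 < κ) (hr : 1 < r) (hC : 0 < C) :
    ∃ M : ℕ, 5 ≤ M ∧ ∃ c₃ : ℝ, 0 < c₃ ∧ ∃ estar : ℝ, 0 < estar ∧ ∀ (P : Params) (hPd : 2 ≤ P.d), P.d = d → P.L = L →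
      ∀ {j : ℕ} (hj : j + 1 ≤ P.m + P.K) (Rg : ℝ), 0 ≤ Rg → ∀ {U : GaugeField P j U1}, DeltaAx U →
      ∀ {e₀ pe₀ lam₀ : ℝ}, 0 < e₀ → e₀ < estar → 0 ≤ pe₀ → pe₀ ≤ cp * pLog p e₀ → e₀ ^ 2 ≤ C * lam₀ → lam₀ ≤ 1 →
      ∀ {Λ₀ Λ₁ Λ Λ₇ : Finset (Balaban1983to89.Site P j)} {r₁ R₇ : ℕ} {Λ₀' : Finset (Balaban1983to89.Site P (j + 1))},
      Λ₁ ⊆ collarShrink r₁ Λ₀ → Rg + 7 * L + 2 ≤ r₁ →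
      (∀ b : PBond P j, (b.src ∈ Λ ∨ b.tgt ∈ Λ) → b ∈ BIJ88Sect3Statements.starB Λ₁) →
      (∀ y : Balaban1983to89.Site P (j + 1), blockK 1 y ⊆ Λ → y ∈ Λ₀') →
      (∀ x : Balaban1983to89.Site P j, blockOf x ∈ Λ₀' → x ∈ Λ₀) →
      Λ₇ ⊆ collarShrink R₇ Λ → κ * rLen r e₀ ≤ R₇ →
      ∀ (A0 : PBond P j → ℝ), BIJ88NeumannNoZeroModesTorus.IsBlockUnion 1 Λ →
      (∀ b : PBond P j, b.src ∈ Λ → b.tgt ∈ Λ → cdist b.src b.tgt ≤ 1) →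
      ∀ {φ φ0 : Balaban1983to89.Site P j → ℂ} {ψ : Balaban1983to89.Site P (j + 1) → ℂ},
      φ = phi330 Λ₇ a Lr φ0 (corr330 Λ (a * Lr ^ (-(2 : ℤ))) c (uOne U e₀ A0) M (rLen r e₀ / (4 * (M : ℝ))) ψ) →
      BIJ88Sect3Statements.SmallField315 pe₀ lam₀ Λ₀ Λ₀' (covD c (cfg U) φ) ψ (qMatT U 1 *ᵥ φ) φ
        (fun q => ‖fieldStrength e₀ (plaqVar (cfg U) q)‖) →
      ∀ (Λ₄s : Finset (PBond P j)),
      Aprime327 Λ₄s (L : ℝ) A0 ((Cloc P j Rg).mulVec (plaqDiv 1 ((torusEdgeCells P j hPd).Qstar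
        (fun q => (fieldStrength e₀ (toC (plaqHol (qU U) q))).re)))) = (fun b => argB (toC (uPrime U b)) / e₀) →
      (∀ b ∈ BIJ88Sect3Statements.starB Λ₁, |A0 b| ≤ c₃ * pe₀) ∧ BIJ88Sect3Statements.Small333 c₃ pe₀ Λ₇ A0 φ0 := by
  obtain ⟨γ₀, c₀, δ₀, hγ, hγle, hc₀, hδ, M, hM, hMR, hMθ, hθW⟩ := exists_walkConsts d L hL haL hc
  have hM0 : (0 : ℝ) < M := by exact_mod_cast (show 0 < M by omega)
  have hκ' : (0 : ℝ) < 1 / (8 * (M : ℝ)) := by positivity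
  obtain ⟨c₃, hc₃, estar, hstar, H⟩ :=
    small333_of_smallField315_corr330_collar_regime d L hd haL hc hγ hγle hc₀ hδ hM hMR hMθ hθW cp p hκ hκ' hr hC
  obtain ⟨e1, he1, hlen⟩ := exists_threshold (eventually_const_le_rLen (24 * (M : ℝ)) r (by linarith))
  refine ⟨M, hM, c₃, hc₃, min estar e1, lt_min hstar he1, ?_⟩
  intro P hPd hP hPL j hj Rg hRg U hU e₀ pe₀ lam₀ he₀ hlt hpe hpcp hlam hlam1 Λ₀ Λ₁ Λ Λ₇ r₁ R₇ Λ₀' hcol hr₁ hB hY hB₀ h7c hR₇ A0 hΛ hΛw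
    φ φ0 ψ hφ h315 Λ₄s h327
  have h24 : 24 * (M : ℝ) ≤ rLen r e₀ := hlen e₀ he₀ (hlt.trans_le (min_le_right _ _))
  have hρ : 1 / (8 * (M : ℝ)) * rLen r e₀ ≤ rLen r e₀ / (4 * (M : ℝ)) - 3 := by
    have e1' : 1 / (8 * (M : ℝ)) * rLen r e₀ = rLen r e₀ / (8 * (M : ℝ)) := by ring
    have e2 : rLen r e₀ / (4 * (M : ℝ)) = 2 * (rLen r e₀ / (8 * (M : ℝ))) := by
      field_simp; ring
    have e3 : 3 ≤ rLen r e₀ / (8 * (M : ℝ)) := by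
      rw [le_div_iff₀ (by positivity)]; linarith
    rw [e1', e2]; linarith
  exact H P hPd hP hPL hj Rg hRg hU he₀ (hlt.trans_le (min_le_left _ _)) hpe hpcp hlam hlam1 hcol hr₁ hB hY hB₀ h7c hR₇ A0 hΛ hΛw
    _ hρ hφ h315 Λ₄s h327

end CubeSizeFirst

/-! ## §15  (v1.6) NON-VACUITY of the theorem of record: the trivial configuration on a large seam-free block union meets EVERY hypothesis of §14

Throughout, «innerRegion» names the explicit block union `barRegion 1 {y : ∀ μ, y_μ + 1 < N′}` (every `L`-block off the last coarse layer of each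
direction; r18's `barRegion`) and «centre site» a site with all coordinate representatives `N/2`; no definitions are introduced. -/

section NonVacuous

open Finset Matrix
open BIJ88Sect3Statements (U1 toC toC_one toC_mul cfg covD plaqVar fieldStrength starB starP mem_starB SmallField315 Small333)
open BIJ85BlockAveragesTorus BIJ85BlockAveragesTorusK
open BIJ88NeumannNoZeroModesTorus (IsBlockUnion)
open BIJ88NeumannPropagator227Torus (nOp)
open BIJ88DeltaLoc234Torus (qMatT)
open BIJ88RandomWalk242 BIJ88Eq242Lattice BIJ88Ineq246Lattice B4Sect5CubeBounds
open BIJ88Eq242HiggsCovarianceTorus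
open BIJ85Eq325Corrections (uOne)
open BIJ88RegionTower274 (collarShrink mem_collarShrink collarShrink_univ barRegion mem_barRegion isBlockUnion_barRegion)
open BIJ88Sect3Translations (Aprime327 phi330)
open BIJ88ClocEstimatesTorus (Cloc)
open BIJ85Eq531Proof (plaqDiv)
open BIJ85CurlQsstar (torusEdgeCells)
open BIJ85Sect1Model (argB)
open BIJ85SmallFieldSplit64 (argB_exp_mul_I)
open BIJ88RenormTransf311 (DeltaAx)
open BIJ88Sect3Rescaling (toC_injective_U1)
open GaugeField (plaqHol)
open BIJ88ScalarTranslation330Torus (cLocC corr330)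
open LatticeFieldCalculus (supDist)
open B3TorusRadialSums (cdist_le_supDist)

variable {P : Params} {j : ℕ}

/-! ### The trivial configuration `u ≡ 1`: block average, translated field, plaquettes, field strength -/

/-- kernel: `argB 1 = 0` (p31's `BIJ88Eq531SmallAPrime.argB_one_eq_zero`, private there). [cite: BalabanImbrieJaffe1985, (2.11) p.303] -/
private theorem argB_one' : argB 1 = 0 := by
  have h := argB_exp_mul_I (t := 0) ⟨by linarith [Real.pi_pos], Real.pi_pos⟩
  simpa using h

/-- at `u ≡ 1` every straight run transports trivially: `u(Γ_{xx′}) = 1`. [cite: BalabanImbrieJaffe1985, (2.10) p.303] -/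
private theorem runC_one' (x : Balaban1983to89.Site P j) (μ : Fin P.d) : runC (1 : GaugeField P j U1) x μ = 1 := by
  unfold runC
  exact prod_eq_one fun _ _ => toC_one

/-- at `u ≡ 1` the comb contours transport trivially: `u(Γ_{yx}) = 1`. [cite: BalabanImbrieJaffe1985, (2.10) p.303] -/
private theorem holC_one' (x : Balaban1983to89.Site P j) : holC (1 : GaugeField P j U1) x = 1 := by
  unfold holC legProd
  exact prod_eq_one fun _ _ => prod_eq_one fun _ _ => toC_one

/-- at `u ≡ 1` the loop variables of (2.10) are `1`. [cite: BalabanImbrieJaffe1985, (2.10) p.303] -/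
private theorem loopC_one' (c : PBond P (j + 1)) (x : Balaban1983to89.Site P j) : loopC (1 : GaugeField P j U1) c x = 1 := by
  simp [loopC, runC_one', holC_one']

/-- at `u ≡ 1` the exponent of (2.10) vanishes. [cite: BalabanImbrieJaffe1985, (2.11) p.303] -/
theorem loopAvg_one (c : PBond P (j + 1)) : loopAvg (1 : GaugeField P j U1) c = 0 := by
  simp [loopAvg, loopC_one', argB_one']

/-- **`Q(1) = 1`**: the nonlinear block average (2.10) of the trivial configuration is trivial. [cite: BalabanImbrieJaffe1985, (2.10) p.303] -/
theorem qU_one_apply (c : PBond P (j + 1)) : qU (1 : GaugeField P j U1) c = 1 := by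
  apply toC_injective_U1
  rw [toC_qU, runC_one', loopAvg_one, toC_one]
  simp

/-- `Q(1) = 1` as block fields. [cite: BalabanImbrieJaffe1985, (2.10) p.303] -/
theorem qU_one : qU (1 : GaugeField P j U1) = 1 := funext qU_one_apply

/-- **`u′ = 1` at `u ≡ 1`**: the translated field (3.9)/(3.24) of the trivial configuration is trivial. [cite: BalabanImbrieJaffe1985, (3.9) p.307] -/
theorem uPrime_one : uPrime (1 : GaugeField P j U1) = 1 := by
  funext b
  show (1 : U1) * surfFactor _ b = 1
  unfold surfFactor
  rw [qU_one]
  split_ifs <;> simp [show ∀ c, (1 : GaugeField P (j + 1) U1) c = 1 from fun _ => rfl]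

/-- the plaquette variables of the trivial configuration are `1`. [cite: BalabanImbrieJaffe1988, (3.3) p.265] -/
private theorem plaqHol_one' (q : Balaban1983to89.Plaq P j) : plaqHol (1 : GaugeField P j U1) q = 1 := by
  simp [GaugeField.plaqHol, show ∀ b, (1 : GaugeField P j U1) b = 1 from fun _ => rfl]

/-- the `ℂ`-valued plaquette variables of the trivial configuration are `1`. [cite: BalabanImbrieJaffe1988, (3.3) p.265] -/
theorem plaqVar_cfg_one (q : Balaban1983to89.Plaq P j) : plaqVar (cfg (1 : GaugeField P j U1)) q = 1 := by
  simp [plaqVar, cfg, show ∀ b, (1 : GaugeField P j U1) b = 1 from fun _ => rfl, toC_one]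

/-- the field strength `(ie₀)⁻¹ log 1 = 0`. [cite: BalabanImbrieJaffe1988, (3.26) p.269] -/
theorem fieldStrength_one (e₀ : ℝ) : fieldStrength e₀ 1 = 0 := by
  simp [fieldStrength]

/-- the covariant derivative of the zero field vanishes. [cite: BalabanImbrieJaffe1988, (3.3) p.265] -/
private theorem covD_zero_field (c : ℝ) (u : PBond P j → ℂ) : covD c u 0 = 0 := by
  funext b; simp [covD]

/-- `Q^{e*}0 = 0` for the torus edge cells ((2.22)). [cite: BalabanImbrieJaffe1985, (2.22) p.305] -/
private theorem Qstar_torusEdgeCells_zero (hPd : 2 ≤ P.d) : (torusEdgeCells P j hPd).Qstar 0 = 0 := by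
  funext p
  simp [BIJ85CellAverages.Cells.Qstar]

/-- the plaquette divergence of the zero function vanishes. [cite: Balaban1984PropagatorsI, (1.2) p.18] -/
private theorem plaqDiv_zero (c : ℝ) : plaqDiv (P := P) (j := j) c 0 = 0 := by
  funext b; simp [plaqDiv]

/-- (3.27) at `A⁽⁰⁾ = 0` with a vanishing correction is `0`. [cite: BalabanImbrieJaffe1988, (3.27) p.269] -/
private theorem aprime327_zero (Λ₄s : Finset (PBond P j)) (L : ℝ) : Aprime327 Λ₄s L (0 : PBond P j → ℝ) 0 = 0 := by
  funext b; simp [Aprime327]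

/-- (3.30) at `φ⁽⁰⁾ = 0`, `ψ = 0`: the translated field is `0` (the correction `C_loc Q*ψ` is linear in `ψ`). [cite: BalabanImbrieJaffe1988, (3.30) p.270] -/
theorem phi330_corr330_zero (Λ₇ Λ : Finset (Balaban1983to89.Site P j)) (a Lr κ c : ℝ) (U : GaugeField P j U1) (M : ℕ) (ρ : ℝ) :
    phi330 Λ₇ a Lr 0 (corr330 Λ κ c U M ρ 0) = 0 := by
  funext x
  simp [phi330, corr330, Matrix.mulVec_zero]


/-! ### A seam-free block union with a deep interior on a large torus -/

/-- kernel: membership in «innerRegion» through the block label. [cite: BalabanImbrieJaffe1988, (4.1) p.274] -/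
theorem mem_innerRegion {x : Balaban1983to89.Site P j} :
    x ∈ (barRegion 1 (univ.filter fun y : Balaban1983to89.Site P (j + 1) => ∀ μ : Fin P.d, (y μ).val + 1 < P.sitesPerDir (j + 1))) ↔ ∀ μ : Fin P.d, ((blockOf x) μ).val + 1 < P.sitesPerDir (j + 1) := by
  simp [mem_barRegion]

/-- «innerRegion» is a union of `L`-blocks (r18's `isBlockUnion_barRegion`). [cite: BalabanImbrieJaffe1988, (4.1) p.274] -/
theorem isBlockUnion_innerRegion : IsBlockUnion 1 (barRegion 1 (univ.filter fun y : Balaban1983to89.Site P (j + 1) => ∀ μ : Fin P.d, (y μ).val + 1 < P.sitesPerDir (j + 1))) := isBlockUnion_barRegion 1 _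

/-- kernel: `(N′ − 1)·L + L = N′·L = N` (one coarse layer is `L` fine layers). [cite: Balaban1987RG1, (0.1) p.252] -/
private theorem pred_mul_add (hj : j + 1 ≤ P.m + P.K) :
    (P.sitesPerDir (j + 1) - 1) * P.L + P.L = P.sitesPerDir j := by
  have hN : 1 ≤ P.sitesPerDir (j + 1) := Nat.one_le_iff_ne_zero.2 (P.sitesPerDir_ne_zero _)
  rw [P.sitesPerDir_eq_mul_succ hj, ← Nat.succ_mul]
  congr 1
  omega

/-- «innerRegion» is SEAM-FREE: every coordinate representative of its sites is `< N − L`, in particular `+1 < N` (§13's hypothesis of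
`noWrap_of_seamFree`). [cite: BalabanImbrieJaffe1988, (2.42) p.264] -/
theorem val_lt_of_mem_innerRegion (hj : j + 1 ≤ P.m + P.K) {x : Balaban1983to89.Site P j} (hx : x ∈ (barRegion 1 (univ.filter fun y : Balaban1983to89.Site P (j + 1) => ∀ μ : Fin P.d, (y μ).val + 1 < P.sitesPerDir (j + 1)))) (μ : Fin P.d) :
    (x μ).val + P.L < P.sitesPerDir j + 1 := by
  have h := (mem_innerRegion.1 hx) μ
  rw [Balaban1983to89.Site.val_blockOf hj] at h
  have h1 : (x μ).val / P.L < P.sitesPerDir (j + 1) - 1 := by omega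
  rw [Nat.div_lt_iff_lt_mul P.L_pos] at h1
  have e := pred_mul_add (P := P) hj
  omega

/-- the seam-free block union meets §13's hypothesis of `noWrap_of_seamFree`: every coordinate representative `+ 1 < N`.
[cite: BalabanImbrieJaffe1988, (2.42) p.264] -/
theorem seamFree_innerRegion (hj : j + 1 ≤ P.m + P.K) {x : Balaban1983to89.Site P j} (hx : x ∈ (barRegion 1 (univ.filter fun y : Balaban1983to89.Site P (j + 1) => ∀ μ : Fin P.d, (y μ).val + 1 < P.sitesPerDir (j + 1)))) (μ : Fin P.d) :
    (x μ).val + 1 < P.sitesPerDir j := by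
  have := val_lt_of_mem_innerRegion hj hx μ
  have hL := P.hL.2
  omega

/-- kernel: a site NOT in «innerRegion» has a coordinate representative in the last `L` fine layers, `≥ N − L`.
[cite: BalabanImbrieJaffe1988, (4.1) p.274] -/
theorem exists_val_ge_of_not_mem_innerRegion (hj : j + 1 ≤ P.m + P.K) {y : Balaban1983to89.Site P j} (hy : y ∉ (barRegion 1 (univ.filter fun y : Balaban1983to89.Site P (j + 1) => ∀ μ : Fin P.d, (y μ).val + 1 < P.sitesPerDir (j + 1)))) :
    ∃ μ : Fin P.d, P.sitesPerDir j ≤ (y μ).val + P.L := by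
  simp only [mem_innerRegion, not_forall, not_lt] at hy
  obtain ⟨μ, hμ⟩ := hy
  refine ⟨μ, ?_⟩
  have hμ' : P.sitesPerDir (j + 1) ≤ (y μ).val / P.L + 1 := by rwa [Balaban1983to89.Site.val_blockOf hj] at hμ
  have h1 : P.sitesPerDir (j + 1) - 1 ≤ (y μ).val / P.L := Nat.sub_le_iff_le_add.2 hμ'
  rw [Nat.le_div_iff_mul_le P.L_pos] at h1
  have e := pred_mul_add (P := P) hj
  omega

/-- THE CENTRE SITE of the chart exists: a site all of whose coordinate representatives are `N/2`. [cite: BalabanImbrieJaffe1988, (4.1) p.274] -/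
theorem exists_centreSite (P : Params) (j : ℕ) : ∃ x₀ : Balaban1983to89.Site P j, ∀ μ : Fin P.d, (x₀ μ).val = P.sitesPerDir j / 2 := by
  refine ⟨fun _ => ((P.sitesPerDir j / 2 : ℕ) : ZMod (P.sitesPerDir j)), fun μ => ?_⟩
  simp only [ZMod.val_natCast]
  exact Nat.mod_eq_of_lt (Nat.div_lt_self (Nat.pos_of_ne_zero (P.sitesPerDir_ne_zero j)) one_lt_two)

/-- kernel: `N = N′·L` and `N′` is even, so `N/2 = (N′/2)·L` and `(N/2)/L = N′/2`. [cite: Balaban1987RG1, (0.1) p.252] -/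
private theorem half_div_L (hj : j + 1 ≤ P.m + P.K) : P.sitesPerDir j / 2 / P.L = P.sitesPerDir (j + 1) / 2 := by
  rw [P.sitesPerDir_eq_mul_succ hj]
  have h2 : 2 ∣ P.sitesPerDir (j + 1) := ⟨P.L ^ (P.m + P.K - (j + 1)), rfl⟩
  obtain ⟨n, hn⟩ := h2
  rw [hn, mul_assoc, Nat.mul_div_cancel_left _ two_pos, Nat.mul_div_cancel _ P.L_pos, Nat.mul_div_cancel_left _ two_pos]

/-- a centre site lies in «innerRegion» as soon as there are at least two levels above `j` (`N′ ≥ 2L > 2`).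
[cite: BalabanImbrieJaffe1988, (4.1) p.274] -/
theorem centreSite_mem_innerRegion (hj : j + 2 ≤ P.m + P.K) {x₀ : Balaban1983to89.Site P j}
    (hx₀ : ∀ μ : Fin P.d, (x₀ μ).val = P.sitesPerDir j / 2) :
    x₀ ∈ (barRegion 1 (univ.filter fun y : Balaban1983to89.Site P (j + 1) => ∀ μ : Fin P.d, (y μ).val + 1 < P.sitesPerDir (j + 1))) := by
  have hj1 : j + 1 ≤ P.m + P.K := by omega
  rw [mem_innerRegion]
  intro μ
  rw [Balaban1983to89.Site.val_blockOf hj1, hx₀, half_div_L hj1]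
  -- `N′ = 2·L^{e}` with `e ≥ 1`, so `N′ ≥ 2L ≥ 4` and `N′/2 + 1 < N′`
  have hN' : 2 * P.L ≤ P.sitesPerDir (j + 1) := by
    show 2 * P.L ≤ 2 * P.L ^ (P.m + P.K - (j + 1))
    have : P.L ≤ P.L ^ (P.m + P.K - (j + 1)) := by
      calc P.L = P.L ^ 1 := (pow_one _).symm
        _ ≤ P.L ^ (P.m + P.K - (j + 1)) := Nat.pow_le_pow_right P.L_pos (by omega)
    omega
  have hL := P.hL.2
  omega

/-- **THE CENTRE IS DEEP**: every site outside «innerRegion» is at sup torus distance `≥ N/2 − L` from a centre site (its offending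
coordinate lies in the last `L` fine layers, the centre coordinate is `N/2`). [cite: BalabanImbrieJaffe1988, (4.1) p.274] -/
theorem supDist_centreSite_ge (hj : j + 1 ≤ P.m + P.K) (hLN : 2 * P.L < P.sitesPerDir j) {x₀ : Balaban1983to89.Site P j}
    (hx₀ : ∀ μ : Fin P.d, (x₀ μ).val = P.sitesPerDir j / 2) {y : Balaban1983to89.Site P j} (hy : y ∉ (barRegion 1 (univ.filter fun y : Balaban1983to89.Site P (j + 1) => ∀ μ : Fin P.d, (y μ).val + 1 < P.sitesPerDir (j + 1)))) :
    P.sitesPerDir j / 2 ≤ supDist x₀ y + P.L := by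
  obtain ⟨μ, hμ⟩ := exists_val_ge_of_not_mem_innerRegion hj hy
  have hyv : (y μ).val < P.sitesPerDir j := ZMod.val_lt _
  have hc : (x₀ μ).val = P.sitesPerDir j / 2 := hx₀ μ
  -- the difference `y_μ − c_μ` has representative `(y μ).val − N/2 ∈ [N/2 − L, N/2)`
  have hle : (x₀ μ).val ≤ (y μ).val := by rw [hc]; omega
  have hsub : (y μ - x₀ μ).val = (y μ).val - P.sitesPerDir j / 2 := by rw [ZMod.val_sub hle, hc]
  have hne : y μ - x₀ μ ≠ 0 := by
    intro h0
    have := congrArg ZMod.val h0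
    rw [hsub, ZMod.val_zero] at this
    omega
  have hneg : (x₀ μ - y μ).val = P.sitesPerDir j - ((y μ).val - P.sitesPerDir j / 2) := by
    rw [← neg_sub, ZMod.neg_val, if_neg hne, hsub]
  have hcd : P.sitesPerDir j / 2 ≤ B3TorusRadialSums.cdist (x₀ μ - y μ) + P.L := by
    unfold B3TorusRadialSums.cdist
    rw [neg_sub, hneg, hsub]
    rcases le_total (P.sitesPerDir j - ((y μ).val - P.sitesPerDir j / 2)) ((y μ).val - P.sitesPerDir j / 2) with h | h
    · rw [min_eq_left h]; omega
    · rw [min_eq_right h]; omega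
  have := cdist_le_supDist x₀ y μ
  omega

/-- hence a centre site survives any collar of width `R < N/2 − L`: `collarShrink R` «innerRegion» is NONEMPTY on a large torus.
[cite: BalabanImbrieJaffe1988, (4.1) p.274] -/
theorem centreSite_mem_collarShrink (hj : j + 2 ≤ P.m + P.K) {R : ℕ} (hR : R + P.L < P.sitesPerDir j / 2)
    {x₀ : Balaban1983to89.Site P j} (hx₀ : ∀ μ : Fin P.d, (x₀ μ).val = P.sitesPerDir j / 2) :
    x₀ ∈ collarShrink R (barRegion 1 (univ.filter fun y : Balaban1983to89.Site P (j + 1) => ∀ μ : Fin P.d, (y μ).val + 1 < P.sitesPerDir (j + 1))) := by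
  have hj1 : j + 1 ≤ P.m + P.K := by omega
  rw [mem_collarShrink]
  refine ⟨centreSite_mem_innerRegion hj hx₀, fun y hy => ?_⟩
  have hLN : 2 * P.L < P.sitesPerDir j := by omega
  have := supDist_centreSite_ge hj1 hLN hx₀ hy
  omega

/-- `collarShrink R` «innerRegion» is nonempty for `R + L < N/2` (two levels above `j`). [cite: BalabanImbrieJaffe1988, (4.1) p.274] -/
theorem collarShrink_innerRegion_nonempty (hj : j + 2 ≤ P.m + P.K) {R : ℕ} (hR : R + P.L < P.sitesPerDir j / 2) :
    (collarShrink R (barRegion 1 (univ.filter fun y : Balaban1983to89.Site P (j + 1) => ∀ μ : Fin P.d, (y μ).val + 1 < P.sitesPerDir (j + 1)))).Nonempty := by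
  obtain ⟨x₀, hx₀⟩ := exists_centreSite P j
  exact ⟨x₀, centreSite_mem_collarShrink hj hR hx₀⟩

/-! ### The certificate -/

/-- kernel: on the torus with `K = 0`, `j = 0`: `N = 2L^m`, so `N/2 = L^m`. [cite: Balaban1987RG1, (0.1) p.252] -/
private theorem half_sitesPerDir_zero (P : Params) (hK : P.K = 0) : P.sitesPerDir 0 / 2 = P.L ^ P.m := by
  show 2 * P.L ^ (P.m + P.K - 0) / 2 = _
  rw [hK, Nat.add_zero, Nat.sub_zero, Nat.mul_div_cancel_left _ two_pos]

/-- **NON-VACUITY OF THE THEOREM OF RECORD `small333_of_smallField315_corr330_regime_printRadius`** — its hypotheses are met SIMULTANEOUSLY,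
with a NONEMPTY target region `Λ₇`, by an explicit configuration: for every admissible charge `e₀ < e*` (and `e₀² ≤ C`, print's
*"e²/λ = O(1)"* at `λ₀ = 1`) take the torus `(ℤ/2L^m)^d` with `m = ⌈κr(e₀)⌉ + L + 2` (`K = 0`, level `j = 0`, next level present), the
SEAM-FREE BLOCK UNION Λ = «innerRegion» (every `L`-block off the last coarse layer of each direction; r18's `barRegion`), `Λ₇ = collarShrink R₇ Λ`
with `R₇ = ⌈κr(e₀)⌉` — which CONTAINS THE CENTRE SITE (`centreSite_mem_collarShrink`: the centre is at sup-distance `≥ N/2 − L = L^m − L > R₇`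
from `Λᶜ`) —, `Λ₀ = Λ₁ = T`, `Λ₀′ = T′`, `r₁ = 7L + 2`, `R_g = 0`, and the TRIVIAL CONFIGURATION `u ≡ 1` (axial gauge holds), `A⁽⁰⁾ = 0`,
`φ⁽⁰⁾ = ψ = 0`, `p(e₀)`-slot `= 0`, `λ₀ = 1`: then (3.15) holds (`Q(1) = 1`, all covariant derivatives and field strengths vanish), (3.27) holds
(`u′ = 1`, both sides of `h327` are `0`), (3.30) gives `φ = 0`, and §14's conclusion follows AT THESE DATA by the theorem itself (last conjunct;
obtained in the proof by applying `small333_of_smallField315_corr330_regime_printRadius`, not by hand).  What this certifies: the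
geometric / regime / gauge-fixing binders of the theorem of record are jointly consistent with a nonempty `Λ₇` on arbitrarily large tori;
it says nothing about non-trivial fields. [cite: BalabanImbrieJaffe1988, (3.33) p.270] [cite: BalabanImbrieJaffe1988, (3.15) p.267]
[cite: BalabanImbrieJaffe1988, (4.1) p.274] -/
theorem small333_of_smallField315_corr330_regime_printRadius_nonvacuous (d L : ℕ) (hd : 2 ≤ d) (hLo : Odd L ∧ 1 < L)
    {a Lr c : ℝ} (haL : 0 < a * Lr ^ (-(2 : ℤ))) (hc : c ≠ 0) {cp : ℝ} (hcp : 0 ≤ cp) (p : ℝ) {κ r C : ℝ} (hκ : 0 < κ)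
    (hr : 1 < r) (hC : 0 < C) :
    ∃ M : ℕ, 5 ≤ M ∧ ∃ c₃ : ℝ, 0 < c₃ ∧ ∃ estar : ℝ, 0 < estar ∧
      ∀ {e₀ : ℝ}, 0 < e₀ → e₀ < estar → e₀ ^ 2 ≤ C →
      ∃ (P : Params) (hPd : 2 ≤ P.d) (_ : P.d = d) (_ : P.L = L) (_ : 0 + 1 ≤ P.m + P.K) (R₇ : ℕ),
        -- the target region is NONEMPTY
        (collarShrink R₇ ((barRegion 1 (univ.filter fun y : Balaban1983to89.Site P (0 + 1) => ∀ μ : Fin P.d, (y μ).val + 1 < P.sitesPerDir (0 + 1))))).Nonempty ∧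
        -- the axial gauge, the regime slots `p(e₀) ↦ 0`, `λ₀ ↦ 1`
        DeltaAx (1 : GaugeField P 0 U1) ∧ ((0 : ℝ) ≤ 0 ∧ (0 : ℝ) ≤ cp * pLog p e₀ ∧ e₀ ^ 2 ≤ C * 1 ∧ (1 : ℝ) ≤ 1) ∧
        -- the collar tower / located margins (`Λ₀ = Λ₁ = T`, `Λ₀′ = T′`, `r₁ = 7L + 2`, `R_g = 0`)
        ((univ : Finset (Balaban1983to89.Site P 0)) ⊆ collarShrink (7 * L + 2) univ ∧ (0 : ℝ) + 7 * L + 2 ≤ ((7 * L + 2 : ℕ) : ℝ)) ∧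
        (∀ b : PBond P 0, (b.src ∈ (barRegion 1 (univ.filter fun y : Balaban1983to89.Site P (0 + 1) => ∀ μ : Fin P.d, (y μ).val + 1 < P.sitesPerDir (0 + 1))) ∨ b.tgt ∈ (barRegion 1 (univ.filter fun y : Balaban1983to89.Site P (0 + 1) => ∀ μ : Fin P.d, (y μ).val + 1 < P.sitesPerDir (0 + 1)))) → b ∈ BIJ88Sect3Statements.starB univ) ∧
        (∀ y : Balaban1983to89.Site P (0 + 1), blockK 1 y ⊆ (barRegion 1 (univ.filter fun y : Balaban1983to89.Site P (0 + 1) => ∀ μ : Fin P.d, (y μ).val + 1 < P.sitesPerDir (0 + 1))) → y ∈ (univ : Finset _)) ∧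
        (∀ x : Balaban1983to89.Site P 0, blockOf x ∈ (univ : Finset (Balaban1983to89.Site P (0 + 1))) → x ∈ (univ : Finset _)) ∧
        (collarShrink R₇ ((barRegion 1 (univ.filter fun y : Balaban1983to89.Site P (0 + 1) => ∀ μ : Fin P.d, (y μ).val + 1 < P.sitesPerDir (0 + 1)))) ⊆ collarShrink R₇ ((barRegion 1 (univ.filter fun y : Balaban1983to89.Site P (0 + 1) => ∀ μ : Fin P.d, (y μ).val + 1 < P.sitesPerDir (0 + 1)))) ∧ κ * rLen r e₀ ≤ R₇) ∧
        -- the Dirichlet region: an `L`-block union that does not wrap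
        (BIJ88NeumannNoZeroModesTorus.IsBlockUnion 1 ((barRegion 1 (univ.filter fun y : Balaban1983to89.Site P (0 + 1) => ∀ μ : Fin P.d, (y μ).val + 1 < P.sitesPerDir (0 + 1)))) ∧
          ∀ b : PBond P 0, b.src ∈ (barRegion 1 (univ.filter fun y : Balaban1983to89.Site P (0 + 1) => ∀ μ : Fin P.d, (y μ).val + 1 < P.sitesPerDir (0 + 1))) → b.tgt ∈ (barRegion 1 (univ.filter fun y : Balaban1983to89.Site P (0 + 1) => ∀ μ : Fin P.d, (y μ).val + 1 < P.sitesPerDir (0 + 1))) → cdist b.src b.tgt ≤ 1) ∧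
        -- (3.30) at `φ⁽⁰⁾ = ψ = 0`, print's radius
        (0 : Balaban1983to89.Site P 0 → ℂ) = phi330 (collarShrink R₇ ((barRegion 1 (univ.filter fun y : Balaban1983to89.Site P (0 + 1) => ∀ μ : Fin P.d, (y μ).val + 1 < P.sitesPerDir (0 + 1))))) a Lr 0
            (corr330 ((barRegion 1 (univ.filter fun y : Balaban1983to89.Site P (0 + 1) => ∀ μ : Fin P.d, (y μ).val + 1 < P.sitesPerDir (0 + 1)))) (a * Lr ^ (-(2 : ℤ))) c (uOne (1 : GaugeField P 0 U1) e₀ 0) M (rLen r e₀ / (4 * (M : ℝ))) 0) ∧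
        -- (3.15) at the objects of record
        BIJ88Sect3Statements.SmallField315 0 1 univ univ (covD c (cfg (1 : GaugeField P 0 U1)) 0) 0
          (qMatT (1 : GaugeField P 0 U1) 1 *ᵥ (0 : Balaban1983to89.Site P 0 → ℂ)) 0
          (fun q => ‖fieldStrength e₀ (plaqVar (cfg (1 : GaugeField P 0 U1)) q)‖) ∧
        -- (3.27), for every `Λ₄*`
        (∀ Λ₄s : Finset (PBond P 0),
          Aprime327 Λ₄s (L : ℝ) 0 ((Cloc P 0 0).mulVec (plaqDiv 1 ((torusEdgeCells P 0 hPd).Qstar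
            (fun q => (fieldStrength e₀ (toC (plaqHol (qU (1 : GaugeField P 0 U1)) q))).re)))) =
            fun b => argB (toC (uPrime (1 : GaugeField P 0 U1) b)) / e₀) ∧
        -- and §14's conclusion at these data, by the theorem
        ((∀ b ∈ BIJ88Sect3Statements.starB (univ : Finset (Balaban1983to89.Site P 0)), |(0 : PBond P 0 → ℝ) b| ≤ c₃ * 0) ∧
          BIJ88Sect3Statements.Small333 c₃ 0 (collarShrink R₇ ((barRegion 1 (univ.filter fun y : Balaban1983to89.Site P (0 + 1) => ∀ μ : Fin P.d, (y μ).val + 1 < P.sitesPerDir (0 + 1))))) 0 0) := by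
  obtain ⟨M, hM, c₃, hc₃, estar, hstar, H⟩ :=
    small333_of_smallField315_corr330_regime_printRadius d L hd hLo.2 haL hc cp p hκ hr hC
  refine ⟨M, hM, c₃, hc₃, estar, hstar, fun {e₀} he₀ hlt hsq => ?_⟩
  -- the torus
  set R₇ : ℕ := ⌈κ * rLen r e₀⌉₊ with hR₇
  set mexp : ℕ := R₇ + L + 2 with hmexp
  have hd1 : 1 ≤ d := by omega
  let P : Params := ⟨d, L, mexp, 0, hd1, hLo⟩
  have hPd : 2 ≤ P.d := hd
  have hj : 0 + 1 ≤ P.m + P.K := by show 0 + 1 ≤ mexp + 0; omega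
  have hj2 : 0 + 2 ≤ P.m + P.K := by show 0 + 2 ≤ mexp + 0; omega
  have hhalf : P.sitesPerDir 0 / 2 = L ^ mexp := half_sitesPerDir_zero P rfl
  have hpow : R₇ + L < L ^ mexp := by
    have := Nat.lt_pow_self hLo.2 (n := mexp)
    omega
  have hR : R₇ + P.L < P.sitesPerDir 0 / 2 := by rw [hhalf]; exact hpow
  refine ⟨P, hPd, rfl, rfl, hj, R₇, collarShrink_innerRegion_nonempty hj2 hR, ?_⟩
  -- the hypotheses one by one
  have hU : DeltaAx (1 : GaugeField P 0 U1) := fun _ _ => rfl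
  have hpcp : (0 : ℝ) ≤ cp * pLog p e₀ := mul_nonneg hcp (by unfold pLog; positivity)
  have hreg : (0 : ℝ) ≤ 0 ∧ (0 : ℝ) ≤ cp * pLog p e₀ ∧ e₀ ^ 2 ≤ C * 1 ∧ (1 : ℝ) ≤ 1 := ⟨le_rfl, hpcp, by rw [mul_one]; exact hsq, le_rfl⟩
  have hcol : (univ : Finset (Balaban1983to89.Site P 0)) ⊆ collarShrink (7 * L + 2) univ := by rw [collarShrink_univ]
  have hr₁ : (0 : ℝ) + 7 * L + 2 ≤ ((7 * L + 2 : ℕ) : ℝ) := by push_cast; linarith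
  have hB : ∀ b : PBond P 0, (b.src ∈ (barRegion 1 (univ.filter fun y : Balaban1983to89.Site P (0 + 1) => ∀ μ : Fin P.d, (y μ).val + 1 < P.sitesPerDir (0 + 1))) ∨ b.tgt ∈ (barRegion 1 (univ.filter fun y : Balaban1983to89.Site P (0 + 1) => ∀ μ : Fin P.d, (y μ).val + 1 < P.sitesPerDir (0 + 1)))) → b ∈ BIJ88Sect3Statements.starB univ :=
    fun b _ => (mem_starB _ _).2 ⟨mem_univ _, mem_univ _⟩
  have hY : ∀ y : Balaban1983to89.Site P (0 + 1), blockK 1 y ⊆ (barRegion 1 (univ.filter fun y : Balaban1983to89.Site P (0 + 1) => ∀ μ : Fin P.d, (y μ).val + 1 < P.sitesPerDir (0 + 1))) → y ∈ (univ : Finset _) := fun _ _ => mem_univ _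
  have hB₀ : ∀ x : Balaban1983to89.Site P 0, blockOf x ∈ (univ : Finset (Balaban1983to89.Site P (0 + 1))) → x ∈ (univ : Finset _) :=
    fun _ _ => mem_univ _
  have hR₇ : κ * rLen r e₀ ≤ R₇ := Nat.le_ceil _
  have hΛ : BIJ88NeumannNoZeroModesTorus.IsBlockUnion 1 ((barRegion 1 (univ.filter fun y : Balaban1983to89.Site P (0 + 1) => ∀ μ : Fin P.d, (y μ).val + 1 < P.sitesPerDir (0 + 1)))) := isBlockUnion_innerRegion
  have hΛw : ∀ b : PBond P 0, b.src ∈ (barRegion 1 (univ.filter fun y : Balaban1983to89.Site P (0 + 1) => ∀ μ : Fin P.d, (y μ).val + 1 < P.sitesPerDir (0 + 1))) → b.tgt ∈ (barRegion 1 (univ.filter fun y : Balaban1983to89.Site P (0 + 1) => ∀ μ : Fin P.d, (y μ).val + 1 < P.sitesPerDir (0 + 1))) → cdist b.src b.tgt ≤ 1 :=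
    noWrap_of_seamFree fun x hx μ => seamFree_innerRegion hj hx μ
  have hφ : (0 : Balaban1983to89.Site P 0 → ℂ) = phi330 (collarShrink R₇ ((barRegion 1 (univ.filter fun y : Balaban1983to89.Site P (0 + 1) => ∀ μ : Fin P.d, (y μ).val + 1 < P.sitesPerDir (0 + 1))))) a Lr 0
      (corr330 ((barRegion 1 (univ.filter fun y : Balaban1983to89.Site P (0 + 1) => ∀ μ : Fin P.d, (y μ).val + 1 < P.sitesPerDir (0 + 1)))) (a * Lr ^ (-(2 : ℤ))) c (uOne (1 : GaugeField P 0 U1) e₀ 0) M (rLen r e₀ / (4 * (M : ℝ))) 0) :=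
    (phi330_corr330_zero _ _ _ _ _ _ _ _ _).symm
  have h315 : BIJ88Sect3Statements.SmallField315 0 1 univ univ (covD c (cfg (1 : GaugeField P 0 U1)) 0) 0
      (qMatT (1 : GaugeField P 0 U1) 1 *ᵥ (0 : Balaban1983to89.Site P 0 → ℂ)) 0
      (fun q => ‖fieldStrength e₀ (plaqVar (cfg (1 : GaugeField P 0 U1)) q)‖) := by
    refine ⟨fun b _ => ?_, fun y _ => ?_, fun x _ => ?_, fun q _ => ?_⟩
    · rw [covD_zero_field]; simp
    · simp [Matrix.mulVec_zero]
    · simp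
    · dsimp only
      rw [plaqVar_cfg_one, fieldStrength_one]; simp
  have h327 : ∀ Λ₄s : Finset (PBond P 0),
      Aprime327 Λ₄s (L : ℝ) 0 ((Cloc P 0 0).mulVec (plaqDiv 1 ((torusEdgeCells P 0 hPd).Qstar
        (fun q => (fieldStrength e₀ (toC (plaqHol (qU (1 : GaugeField P 0 U1)) q))).re)))) =
        fun b => argB (toC (uPrime (1 : GaugeField P 0 U1) b)) / e₀ := by
    intro Λ₄s
    have hf : (fun q => (fieldStrength e₀ (toC (plaqHol (qU (1 : GaugeField P 0 U1)) q))).re) = 0 := by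
      funext q
      rw [qU_one, plaqHol_one', toC_one, fieldStrength_one]
      simp
    rw [hf, Qstar_torusEdgeCells_zero, plaqDiv_zero, Matrix.mulVec_zero, aprime327_zero]
    funext b
    rw [uPrime_one]
    show (0 : ℝ) = argB (toC (1 : U1)) / e₀
    rw [toC_one, argB_one', zero_div]
  refine ⟨hU, hreg, ⟨hcol, hr₁⟩, hB, hY, hB₀, ⟨subset_rfl, hR₇⟩, ⟨hΛ, hΛw⟩, hφ, h315, h327, ?_⟩
  exact H P hPd rfl rfl hj 0 le_rfl hU he₀ hlt le_rfl hpcp (by rw [mul_one]; exact hsq) le_rfl hcol hr₁ hB hY hB₀ subset_rfl hR₇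
    0 hΛ hΛw hφ h315 univ (h327 univ)

end NonVacuous

end

end Literature.MathematicalPhysics.QuantumFieldTheory.BalabanImbrieJaffe1984to88.BIJ88Small333Regime
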